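import Literature.Geometry.Kaehler.CyclotomicThirtyTwoHodgeConjecture
import Literature.AlgebraicGeometry.ComplexMultiplication.CyclotomicCMTypeCensusFortyEight
import HarnessLib

/-!
# `ℚ(ζ₄₈) = ℚ(ζ₁₆, ζ₃)` (`φ = 16`): the RANK TABLE `9 ∕ 7 ∕ 5 ∕ 3 ∕ 2` of its `256` CM types, the Hodge conjecture for all powers of the abelian
# varieties of the `192` types OFF the 4 degenerate primitive families, SIMPLE CM `8`-FOLDS WITH `B⁴ ≠ D⁴` or `B² ≠ D²` for the `64` types ON them,
# and the complex `8`-tori with an endomorphism of characteristic polynomial `Φ₄₈`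

Layer `Literature/Geometry/Kaehler`, namespace `Literature.Geometry.Kaehler.ComplexTorus`; lane `lit-hodgefound` (Track 2 foundations
library), prover seat `lit-hodgefound-p10`, generation 34 (addendum), row «A2-26 (ℚ(ζ₄₈) Hodge)» (self-proposed 2026-08-28).  Theorems only; no
`def`, no instance, no named fact (net Literature debt 0).  The cyclotomic fields of degree `16` (`d ∈ {17, 32, 34, 40, 48, 60}`) all have a
`2`-GROUP as Galois group; `ℚ(ζ₁₇) = ℚ(ζ₃₄)` (cyclic: every type nondegenerate) is the tree's `CyclicTwoPowerCMTypesFermat`; this file treats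
`ℚ(ζ₄₈)`, `(ℤ/48)ˣ ≅ C₂ × C₂ × C₄`, where degenerate PRIMITIVE types occur (`{1, 5, 7, 11, 13, 17, 25, 29}`: rank `7`; `{1, 5, 7, 11, 13, 23, 29, 31}`: rank `7`; `{1, 5, 7, 13, 17, 19, 25, 37}`: rank `7`; `{1, 5, 7, 13, 19, 23, 31, 37}`: rank `7`).

INPUT: the census `CyclotomicCMTypeCensusFortyEight` (24 families sorted «not coset-balanced ∕ free & balanced ∕ not free»; the maximal
`(−1)`-free subgroups; the balance of the representatives), `Pohlmann1968/CyclotomicCosetBalancedCMTypes` (Yanai at full strength on residues: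
`cmTypeRank_add_le_of_cosetBalanced`; Mumford–Pohlmann: `exists_exceptional_of_cosetBalanced`) and explicit rank certificates.

* §1 RANKS: lower bounds by explicit invertible minors of the `16 × 16` translate matrix `([u·c ∈ S])` (`9 × 9` for the eight not
  coset-balanced representatives, `7 × 7`, `7 × 7`, `7 × 7`, `7 × 7` for the degenerate primitive ones, `5 × 5` for the
  representatives with stabiliser of order `2`), upper bounds by Kubota (`≤ 9`), Yanai (`rank + m ≤ 9` when balanced for `W`, `|W|·2m = 16`)
  and the induced-type bound; **`cmTypeRank_eq_nine_of_not_cosetBalanced_fortyEight`**, **`cmTypeRank_of_isPrimitive_of_cosetBalanced_fortyEight`**,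
  **`cmTypeRank_of_not_isPrimitive_fortyEight`** (`5 ∕ 3 ∕ 2` by stabiliser order `2 ∕ 4 ∕ 8`), `cmTypeRank_mem_fortyEight`, **`isNondegenerate_iff_not_cosetBalanced_fortyEight`**,
  `isPrimitive_iff_seven_le_cmTypeRank_fortyEight`, `ncard_isNondegenerate_fortyEight` (`128`).
* §2 VARIETIES of type `(ℚ(ζ₄₈); Φ)` (all of dimension `8`): **`hodgeClassSpan_pow_eq_divisorClassesSpan_of_fortyEight`** and
  **`hodgeConjectureFor_pow_of_fortyEight`** — `B•(Aⁿ) ⊗ ℂ = D•(Aⁿ) ⊗ ℂ` and the Hodge conjecture for ALL powers whenever `Φ` is not a primitive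
  coset-balanced type (`192` types: the `128` nondegenerate ones and the `64` imprimitive ones, which are induced from NONDEGENERATE types);
  **`exists_exceptional_four_of_cosetBalanced_fortyEight`** (primitive, balanced for a maximal `(−1)`-free subgroup of order `8` ⟹ `A` simple,
  rational `(4,4)`-classes outside `D⁴(A) ⊗ ℂ`, `dim B⁴ − dim D⁴ ≥ 2`: Weil type `(4,4)` over an imaginary quadratic subfield),
  **`exists_exceptional_two_of_cosetBalanced_fortyEight`** (balanced for a `(−1)`-free subgroup of order `4` ⟹ rational `(2,2)`-classes outside
  `D²(A) ⊗ ℂ`); the DICHOTOMY **`hodgeConjectureFor_pow_or_exceptional_fortyEight`**; non-vacuity `exists_isSimple_exceptional_fortyEight`.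
* §3 TORI with an endomorphism `u` of characteristic polynomial `Φ₄₈`: `mtRank_hodgeStructure_mem_fortyEight`, `isSimple_iff_seven_le_mtRank_fortyEight`,
  **`forall_divisorClasses_powPeriod_eq_hodgeClasses_iff_fortyEight`** (`Hdg = Div` on ALL powers ⟺ (`X` simple → `rank MT(X) = 9`)),
  `exists_isSimple_mtRank_eq_fortyEight` (simple abelian `8`-folds `ℂ⁸/Φ(𝔞)` with `u = ζ₄₈` of each primitive rank).

HONEST SCOPE.  For the `64` primitive coset-balanced types the Hodge conjecture for `A` itself (algebraicity of the Weil-type classes) is NOT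
asserted; what is proved is `B⁴ ≠ D⁴` resp. `B² ≠ D²` and the failure of «`Hdg = Div` on all powers».

## References

* [Gordon1999HodgeAVSurvey] B. B. Gordon, *A survey of the Hodge conjecture for abelian varieties* (1999), 5.13 (ii), Thm. 6.4, 7.5, 9.2.2, §9.3,
  §9.4.1 (Prop. 9.4.1, Kubota rank), §9.4.2 (Lenstra's `ℚ(ζ₃₂)` types), 9.4.3 (Theorem [B.140], Yanai).
* [GreenGriffithsKerr2012] M. Green, P. Griffiths, M. Kerr, *Mumford–Tate Groups and Domains* (2012), (V.A.6)(i), (V.A.7)–(V.A.8), (V.D.8).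
* [Shimura1998] G. Shimura, *Abelian Varieties with Complex Multiplication and Modular Functions* (1998), §6.2 Thm. 3, §8.2 Prop. 26, §8.4.
* [Kubota1965] T. Kubota, Trans. AMS 118 (1965), §2 p. 115, §4 Lemma 2.
* [KoblitzRohrlich1978] N. Koblitz, D. Rohrlich, Canad. J. Math. 30 (1978), §1 p. 1184 (`[L : K₁] = |W|`).
* [vanGeemen1994HodgeAV] B. van Geemen, LNM 1594 (1994), Thm. 4.5, 4.7.
* [Pohlmann1968] H. Pohlmann, Ann. of Math. 88 (1968), Thm. 1, §3.
* [MoonenZarhin1999LowDim] B. Moonen, Yu. Zarhin, Math. Ann. 315 (1999), §2 (2.7).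
-/

noncomputable section

open scoped Classical nonZeroDivisors NumberField Manifold ContDiff MatrixGroups
open NumberField Module Polynomial CategoryTheory CategoryTheory.Limits

namespace Literature.Geometry.Kaehler

namespace ComplexTorus

-- `open scoped`: the tree's action of `Aut(ℂ)` on `Hom(K, ℂ)` by composition (`ringEquivCompAction`) is a scoped instance
open scoped Literature.NumberTheory.ComplexMultiplication
open Literature.NumberTheory.Automorphic (IsTorusSubgroup)
open Literature.AlgebraicGeometry.Motives (CMType AbelianVariety HodgeTensorFacts hodgeTensorFacts_holds)
open Literature.AlgebraicGeometry.HodgeTheory (HodgeConjectureFor complexBetti IsRationalClass IsOfHodgeType)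
open Literature.AlgebraicGeometry.VanGeemen1994 (hodgeClassSpan)
open Literature.Barriers.HodgeConjecture (divisorClassesSpan)
open Literature.NumberTheory.ComplexMultiplication (IsPrimitive inducedCMType translateInd translateInd_of_mem translateInd_of_not_mem
  isPrimitive_iff_forall_eq exists_primitive_inducedCMType_eq_of_isCMField)
open Literature.NumberTheory.ComplexMultiplication.CMTypeLattice (periodIso basisIndex card_basisIndex_eq_finrank
  isSimple_periodIso_iff_isPrimitive isAbelianVariety_periodIso isIsogenous_powPeriod_periodIso_of_basis)
open Literature.AlgebraicGeometry.Pohlmann1968 (cmTypeRank cmTypeRank_le IsNondegenerate isNondegenerate_iff cmTypeRank_inducedCMType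
  isPretransitive_ringEquiv_complex)
open Literature.AlgebraicGeometry.Pohlmann1968.Cyclotomic (autExp expOf exists_autExp_eq exists_expOf_eq finrank_eq_totient
  not_isNondegenerate_of_cosetBalanced cmTypeRank_le_of_cosetBalanced cmTypeRank_add_le_of_cosetBalanced exists_exceptional_of_cosetBalanced
  two_le_finrank_hodgeClassSpan_sub_finrank_divisorClassesSpan_of_cosetBalanced cosetBalanced_of_isAutTransform)
open Literature.AlgebraicGeometry.ComplexMultiplication (IsCMTypeRealisation isSimple_iff_isPrimitive isPrimitive_ringEquiv_complex_iff
  isSimple_of_isCMTypeRealisation_of_isPrimitive finrank_eq_card_filter_of_primitive)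
open Literature.AlgebraicGeometry.ComplexMultiplication.CMTorus (mtRank_hodgeStructure_periodIso_eq_cmTypeRank)
open Literature.AlgebraicGeometry.ComplexMultiplication.CyclotomicCMTypeResidueSets (IsAutTransform IsAutTransform.symm IsAutTransform.refl
  unitResidues residueSet HasTrivialStabilizer allCMResidueSets expOf_smul expOf_mem_residueSet_iff IsAutTransform.isPrimitive_iff
  isPrimitive_iff_hasTrivialStabilizer coprime_iff_mem_unitResidues isCMResidueSet_residueSet card_filter_allCMResidueSets_eq
  ncard_setOf_eq_card_filter_powerset_half)
open Literature.AlgebraicGeometry.ComplexMultiplication.CyclotomicCMTypeCensusFortyEight (isCMResidueSet_half_fortyEight isCMResidueSet_reps_fortyEight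
  hasTrivialStabilizer_reps_fortyEight stabilizer_reps_fortyEight subgroups_fortyEight cosetBalanced_reps_fortyEight not_cosetBalanced_reps_fortyEight exists_isAutTransform_fortyEight
  isPrimitive_of_not_cosetBalanced_fortyEight card_stabilizer_of_not_isPrimitive_fortyEight filter_stabilizer_eq_of_isAutTransform_fortyEight residueSet_mem_fortyEight
  exists_residueSet_eq_fortyEight ncard_not_cosetBalanced_fortyEight)

/-! ### §1 The ranks of the CM types of `ℚ(ζ₄₈)` -/

section Types

variable {K : Type} [Field K] [NumberField K]

variable [IsCyclotomicExtension {48} ℚ K]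

variable (K) in
/-- `ℚ(ζ₄₈)` is a CM field (Mathlib). No instance is registered. [folklore] -/
private theorem isCMField₈ : IsCMField K :=
  IsCyclotomicExtension.Rat.isCMField K (S := ({48} : Set ℕ)) ⟨48, rfl, by norm_num⟩

variable (K) in
/-- `[ℚ(ζ₄₈) : ℚ] = 16`. [folklore] -/
private theorem finrank_eq_sixteen₈ : finrank ℚ K = 16 := by
  rw [finrank_eq_totient 48 K]; decide +kernel

/-- The indicator of a translate of `Φ`, read on exponents. [cite: Shimura1998, §8.4 Example (1)] -/
private theorem translateInd_eq_ite₈ (Φ : CMType K) (τ : ℂ ≃+* ℂ) (σ : K →+* ℂ) :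
    translateInd Φ.1 τ σ = if autExp 48 τ * expOf 48 K σ ∈ residueSet 48 Φ then (1 : ℚ) else 0 := by
  have h : τ • σ ∈ Φ.1 ↔ autExp 48 τ * expOf 48 K σ ∈ residueSet 48 Φ := by
    rw [← expOf_mem_residueSet_iff 48 Φ, expOf_smul]
  by_cases hm : autExp 48 τ * expOf 48 K σ ∈ residueSet 48 Φ
  · rw [translateInd_of_mem (h.2 hm), if_pos hm]
  · rw [translateInd_of_not_mem (fun h' => hm (h.1 h')), if_neg hm]

/-- **`Rank(Φ) ≥ 9` for the type with residue set `{1, 5, 7, 11, 13, 17, 19, 25}`** (`N1`): the translates by the automorphisms of `ℂ` with cyclotomic characters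
`1, 5, 7, 11, 13, 17, 19, 23, 25`, read at the embeddings with exponents `1, 5, 7, 11, 13, 17, 19, 23, 25`, are linearly independent (the `9 × 9` minor of
`([u·c ∈ S])` has determinant `10`). [cite: Kubota1965, §2 (p. 115)] [cite: GreenGriffithsKerr2012, (V.A.7)–(V.A.8)] -/
private theorem nine_le_cmTypeRank_of_residueSet_eq_N1_fortyEight (Φ : CMType K) (hΦ : residueSet 48 Φ = {1, 5, 7, 11, 13, 17, 19, 25}) :
    9 ≤ cmTypeRank Φ := by
  classical
  have hu : ∀ i : Fin 9, ((![1, 5, 7, 11, 13, 17, 19, 23, 25] : Fin 9 → ZMod 48) i).val.Coprime 48 := by decide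
  have hc : ∀ j : Fin 9, ((![1, 5, 7, 11, 13, 17, 19, 23, 25] : Fin 9 → ZMod 48) j).val.Coprime 48 := by decide
  choose τ hτ using fun i : Fin 9 => exists_autExp_eq 48 _ (hu i)
  choose σ hσ using fun j : Fin 9 => exists_expOf_eq 48 K _ (hc j)
  let f : Fin 9 → (K →+* ℂ) → ℚ := fun i => translateInd Φ.1 (τ i)
  have hval : ∀ i j : Fin 9, f i (σ j) =
      if (![1, 5, 7, 11, 13, 17, 19, 23, 25] : Fin 9 → ZMod 48) i * (![1, 5, 7, 11, 13, 17, 19, 23, 25] : Fin 9 → ZMod 48) j ∈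
        ({1, 5, 7, 11, 13, 17, 19, 25} : Finset (ZMod 48)) then (1 : ℚ) else 0 := by
    intro i j
    show translateInd Φ.1 (τ i) (σ j) = _
    rw [translateInd_eq_ite₈, hτ, hσ, hΦ]
  have hli : LinearIndependent ℚ f := by
    rw [Fintype.linearIndependent_iff]
    intro g hg
    have heval : ∀ j : Fin 9, ∑ i, g i * f i (σ j) = 0 := fun j => by
      have := congrFun hg (σ j)
      simpa only [Finset.sum_apply, Pi.smul_apply, smul_eq_mul, Pi.zero_apply] using this
    have e0 := heval 0
    have e1 := heval 1
    have e2 := heval 2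
    have e3 := heval 3
    have e4 := heval 4
    have e5 := heval 5
    have e6 := heval 6
    have e7 := heval 7
    have e8 := heval 8
    simp (config := { decide := true }) [Fin.sum_univ_succ, hval] at e0 e1 e2 e3 e4 e5 e6 e7 e8
    intro i
    fin_cases i <;> simp <;> linarith
  have h1 : Module.finrank ℚ (Submodule.span ℚ (Set.range f)) = 9 := by
    rw [finrank_span_eq_card hli, Fintype.card_fin]
  have h2 : Submodule.span ℚ (Set.range f) ≤
      Submodule.span ℚ (Set.range fun g : ℂ ≃+* ℂ => translateInd Φ.1 g) :=
    Submodule.span_mono (by rintro _ ⟨i, rfl⟩; exact ⟨τ i, rfl⟩)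
  have h3 := Submodule.finrank_mono h2
  rw [h1] at h3
  exact h3

/-- **`Rank(Φ) ≥ 9` for the type with residue set `{1, 5, 7, 11, 13, 17, 23, 29}`** (`N2`): the translates by the automorphisms of `ℂ` with cyclotomic characters
`1, 5, 7, 11, 13, 17, 19, 23, 25`, read at the embeddings with exponents `1, 5, 7, 11, 13, 17, 19, 23, 25`, are linearly independent (the `9 × 9` minor of
`([u·c ∈ S])` has determinant `10`). [cite: Kubota1965, §2 (p. 115)] [cite: GreenGriffithsKerr2012, (V.A.7)–(V.A.8)] -/
private theorem nine_le_cmTypeRank_of_residueSet_eq_N2_fortyEight (Φ : CMType K) (hΦ : residueSet 48 Φ = {1, 5, 7, 11, 13, 17, 23, 29}) :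
    9 ≤ cmTypeRank Φ := by
  classical
  have hu : ∀ i : Fin 9, ((![1, 5, 7, 11, 13, 17, 19, 23, 25] : Fin 9 → ZMod 48) i).val.Coprime 48 := by decide
  have hc : ∀ j : Fin 9, ((![1, 5, 7, 11, 13, 17, 19, 23, 25] : Fin 9 → ZMod 48) j).val.Coprime 48 := by decide
  choose τ hτ using fun i : Fin 9 => exists_autExp_eq 48 _ (hu i)
  choose σ hσ using fun j : Fin 9 => exists_expOf_eq 48 K _ (hc j)
  let f : Fin 9 → (K →+* ℂ) → ℚ := fun i => translateInd Φ.1 (τ i)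
  have hval : ∀ i j : Fin 9, f i (σ j) =
      if (![1, 5, 7, 11, 13, 17, 19, 23, 25] : Fin 9 → ZMod 48) i * (![1, 5, 7, 11, 13, 17, 19, 23, 25] : Fin 9 → ZMod 48) j ∈
        ({1, 5, 7, 11, 13, 17, 23, 29} : Finset (ZMod 48)) then (1 : ℚ) else 0 := by
    intro i j
    show translateInd Φ.1 (τ i) (σ j) = _
    rw [translateInd_eq_ite₈, hτ, hσ, hΦ]
  have hli : LinearIndependent ℚ f := by
    rw [Fintype.linearIndependent_iff]
    intro g hg
    have heval : ∀ j : Fin 9, ∑ i, g i * f i (σ j) = 0 := fun j => by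
      have := congrFun hg (σ j)
      simpa only [Finset.sum_apply, Pi.smul_apply, smul_eq_mul, Pi.zero_apply] using this
    have e0 := heval 0
    have e1 := heval 1
    have e2 := heval 2
    have e3 := heval 3
    have e4 := heval 4
    have e5 := heval 5
    have e6 := heval 6
    have e7 := heval 7
    have e8 := heval 8
    simp (config := { decide := true }) [Fin.sum_univ_succ, hval] at e0 e1 e2 e3 e4 e5 e6 e7 e8
    intro i
    fin_cases i <;> simp <;> linarith
  have h1 : Module.finrank ℚ (Submodule.span ℚ (Set.range f)) = 9 := by
    rw [finrank_span_eq_card hli, Fintype.card_fin]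
  have h2 : Submodule.span ℚ (Set.range f) ≤
      Submodule.span ℚ (Set.range fun g : ℂ ≃+* ℂ => translateInd Φ.1 g) :=
    Submodule.span_mono (by rintro _ ⟨i, rfl⟩; exact ⟨τ i, rfl⟩)
  have h3 := Submodule.finrank_mono h2
  rw [h1] at h3
  exact h3

/-- **`Rank(Φ) ≥ 9` for the type with residue set `{1, 5, 7, 11, 13, 19, 23, 31}`** (`N3`): the translates by the automorphisms of `ℂ` with cyclotomic characters
`1, 5, 7, 11, 13, 17, 19, 23, 25`, read at the embeddings with exponents `1, 5, 7, 11, 13, 17, 19, 23, 25`, are linearly independent (the `9 × 9` minor of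
`([u·c ∈ S])` has determinant `10`). [cite: Kubota1965, §2 (p. 115)] [cite: GreenGriffithsKerr2012, (V.A.7)–(V.A.8)] -/
private theorem nine_le_cmTypeRank_of_residueSet_eq_N3_fortyEight (Φ : CMType K) (hΦ : residueSet 48 Φ = {1, 5, 7, 11, 13, 19, 23, 31}) :
    9 ≤ cmTypeRank Φ := by
  classical
  have hu : ∀ i : Fin 9, ((![1, 5, 7, 11, 13, 17, 19, 23, 25] : Fin 9 → ZMod 48) i).val.Coprime 48 := by decide
  have hc : ∀ j : Fin 9, ((![1, 5, 7, 11, 13, 17, 19, 23, 25] : Fin 9 → ZMod 48) j).val.Coprime 48 := by decide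
  choose τ hτ using fun i : Fin 9 => exists_autExp_eq 48 _ (hu i)
  choose σ hσ using fun j : Fin 9 => exists_expOf_eq 48 K _ (hc j)
  let f : Fin 9 → (K →+* ℂ) → ℚ := fun i => translateInd Φ.1 (τ i)
  have hval : ∀ i j : Fin 9, f i (σ j) =
      if (![1, 5, 7, 11, 13, 17, 19, 23, 25] : Fin 9 → ZMod 48) i * (![1, 5, 7, 11, 13, 17, 19, 23, 25] : Fin 9 → ZMod 48) j ∈
        ({1, 5, 7, 11, 13, 19, 23, 31} : Finset (ZMod 48)) then (1 : ℚ) else 0 := by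
    intro i j
    show translateInd Φ.1 (τ i) (σ j) = _
    rw [translateInd_eq_ite₈, hτ, hσ, hΦ]
  have hli : LinearIndependent ℚ f := by
    rw [Fintype.linearIndependent_iff]
    intro g hg
    have heval : ∀ j : Fin 9, ∑ i, g i * f i (σ j) = 0 := fun j => by
      have := congrFun hg (σ j)
      simpa only [Finset.sum_apply, Pi.smul_apply, smul_eq_mul, Pi.zero_apply] using this
    have e0 := heval 0
    have e1 := heval 1
    have e2 := heval 2
    have e3 := heval 3
    have e4 := heval 4
    have e5 := heval 5
    have e6 := heval 6
    have e7 := heval 7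
    have e8 := heval 8
    simp (config := { decide := true }) [Fin.sum_univ_succ, hval] at e0 e1 e2 e3 e4 e5 e6 e7 e8
    intro i
    fin_cases i <;> simp <;> linarith
  have h1 : Module.finrank ℚ (Submodule.span ℚ (Set.range f)) = 9 := by
    rw [finrank_span_eq_card hli, Fintype.card_fin]
  have h2 : Submodule.span ℚ (Set.range f) ≤
      Submodule.span ℚ (Set.range fun g : ℂ ≃+* ℂ => translateInd Φ.1 g) :=
    Submodule.span_mono (by rintro _ ⟨i, rfl⟩; exact ⟨τ i, rfl⟩)
  have h3 := Submodule.finrank_mono h2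
  rw [h1] at h3
  exact h3

/-- **`Rank(Φ) ≥ 9` for the type with residue set `{1, 5, 7, 11, 13, 25, 29, 31}`** (`N4`): the translates by the automorphisms of `ℂ` with cyclotomic characters
`1, 5, 7, 11, 13, 17, 19, 23, 25`, read at the embeddings with exponents `1, 5, 7, 11, 13, 17, 19, 23, 25`, are linearly independent (the `9 × 9` minor of
`([u·c ∈ S])` has determinant `-6`). [cite: Kubota1965, §2 (p. 115)] [cite: GreenGriffithsKerr2012, (V.A.7)–(V.A.8)] -/
private theorem nine_le_cmTypeRank_of_residueSet_eq_N4_fortyEight (Φ : CMType K) (hΦ : residueSet 48 Φ = {1, 5, 7, 11, 13, 25, 29, 31}) :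
    9 ≤ cmTypeRank Φ := by
  classical
  have hu : ∀ i : Fin 9, ((![1, 5, 7, 11, 13, 17, 19, 23, 25] : Fin 9 → ZMod 48) i).val.Coprime 48 := by decide
  have hc : ∀ j : Fin 9, ((![1, 5, 7, 11, 13, 17, 19, 23, 25] : Fin 9 → ZMod 48) j).val.Coprime 48 := by decide
  choose τ hτ using fun i : Fin 9 => exists_autExp_eq 48 _ (hu i)
  choose σ hσ using fun j : Fin 9 => exists_expOf_eq 48 K _ (hc j)
  let f : Fin 9 → (K →+* ℂ) → ℚ := fun i => translateInd Φ.1 (τ i)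
  have hval : ∀ i j : Fin 9, f i (σ j) =
      if (![1, 5, 7, 11, 13, 17, 19, 23, 25] : Fin 9 → ZMod 48) i * (![1, 5, 7, 11, 13, 17, 19, 23, 25] : Fin 9 → ZMod 48) j ∈
        ({1, 5, 7, 11, 13, 25, 29, 31} : Finset (ZMod 48)) then (1 : ℚ) else 0 := by
    intro i j
    show translateInd Φ.1 (τ i) (σ j) = _
    rw [translateInd_eq_ite₈, hτ, hσ, hΦ]
  have hli : LinearIndependent ℚ f := by
    rw [Fintype.linearIndependent_iff]
    intro g hg
    have heval : ∀ j : Fin 9, ∑ i, g i * f i (σ j) = 0 := fun j => by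
      have := congrFun hg (σ j)
      simpa only [Finset.sum_apply, Pi.smul_apply, smul_eq_mul, Pi.zero_apply] using this
    have e0 := heval 0
    have e1 := heval 1
    have e2 := heval 2
    have e3 := heval 3
    have e4 := heval 4
    have e5 := heval 5
    have e6 := heval 6
    have e7 := heval 7
    have e8 := heval 8
    simp (config := { decide := true }) [Fin.sum_univ_succ, hval] at e0 e1 e2 e3 e4 e5 e6 e7 e8
    intro i
    fin_cases i <;> simp <;> linarith
  have h1 : Module.finrank ℚ (Submodule.span ℚ (Set.range f)) = 9 := by
    rw [finrank_span_eq_card hli, Fintype.card_fin]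
  have h2 : Submodule.span ℚ (Set.range f) ≤
      Submodule.span ℚ (Set.range fun g : ℂ ≃+* ℂ => translateInd Φ.1 g) :=
    Submodule.span_mono (by rintro _ ⟨i, rfl⟩; exact ⟨τ i, rfl⟩)
  have h3 := Submodule.finrank_mono h2
  rw [h1] at h3
  exact h3

/-- **`Rank(Φ) ≥ 9` for the type with residue set `{1, 5, 7, 11, 17, 19, 23, 35}`** (`N5`): the translates by the automorphisms of `ℂ` with cyclotomic characters
`1, 5, 7, 11, 13, 17, 19, 23, 25`, read at the embeddings with exponents `1, 5, 7, 11, 13, 17, 19, 23, 25`, are linearly independent (the `9 × 9` minor of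
`([u·c ∈ S])` has determinant `10`). [cite: Kubota1965, §2 (p. 115)] [cite: GreenGriffithsKerr2012, (V.A.7)–(V.A.8)] -/
private theorem nine_le_cmTypeRank_of_residueSet_eq_N5_fortyEight (Φ : CMType K) (hΦ : residueSet 48 Φ = {1, 5, 7, 11, 17, 19, 23, 35}) :
    9 ≤ cmTypeRank Φ := by
  classical
  have hu : ∀ i : Fin 9, ((![1, 5, 7, 11, 13, 17, 19, 23, 25] : Fin 9 → ZMod 48) i).val.Coprime 48 := by decide
  have hc : ∀ j : Fin 9, ((![1, 5, 7, 11, 13, 17, 19, 23, 25] : Fin 9 → ZMod 48) j).val.Coprime 48 := by decide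
  choose τ hτ using fun i : Fin 9 => exists_autExp_eq 48 _ (hu i)
  choose σ hσ using fun j : Fin 9 => exists_expOf_eq 48 K _ (hc j)
  let f : Fin 9 → (K →+* ℂ) → ℚ := fun i => translateInd Φ.1 (τ i)
  have hval : ∀ i j : Fin 9, f i (σ j) =
      if (![1, 5, 7, 11, 13, 17, 19, 23, 25] : Fin 9 → ZMod 48) i * (![1, 5, 7, 11, 13, 17, 19, 23, 25] : Fin 9 → ZMod 48) j ∈
        ({1, 5, 7, 11, 17, 19, 23, 35} : Finset (ZMod 48)) then (1 : ℚ) else 0 := by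
    intro i j
    show translateInd Φ.1 (τ i) (σ j) = _
    rw [translateInd_eq_ite₈, hτ, hσ, hΦ]
  have hli : LinearIndependent ℚ f := by
    rw [Fintype.linearIndependent_iff]
    intro g hg
    have heval : ∀ j : Fin 9, ∑ i, g i * f i (σ j) = 0 := fun j => by
      have := congrFun hg (σ j)
      simpa only [Finset.sum_apply, Pi.smul_apply, smul_eq_mul, Pi.zero_apply] using this
    have e0 := heval 0
    have e1 := heval 1
    have e2 := heval 2
    have e3 := heval 3
    have e4 := heval 4
    have e5 := heval 5
    have e6 := heval 6
    have e7 := heval 7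
    have e8 := heval 8
    simp (config := { decide := true }) [Fin.sum_univ_succ, hval] at e0 e1 e2 e3 e4 e5 e6 e7 e8
    intro i
    fin_cases i <;> simp <;> linarith
  have h1 : Module.finrank ℚ (Submodule.span ℚ (Set.range f)) = 9 := by
    rw [finrank_span_eq_card hli, Fintype.card_fin]
  have h2 : Submodule.span ℚ (Set.range f) ≤
      Submodule.span ℚ (Set.range fun g : ℂ ≃+* ℂ => translateInd Φ.1 g) :=
    Submodule.span_mono (by rintro _ ⟨i, rfl⟩; exact ⟨τ i, rfl⟩)
  have h3 := Submodule.finrank_mono h2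
  rw [h1] at h3
  exact h3

/-- **`Rank(Φ) ≥ 9` for the type with residue set `{1, 5, 7, 13, 17, 25, 29, 37}`** (`N6`): the translates by the automorphisms of `ℂ` with cyclotomic characters
`1, 5, 7, 11, 13, 17, 19, 23, 25`, read at the embeddings with exponents `1, 5, 7, 11, 13, 17, 19, 23, 25`, are linearly independent (the `9 × 9` minor of
`([u·c ∈ S])` has determinant `-6`). [cite: Kubota1965, §2 (p. 115)] [cite: GreenGriffithsKerr2012, (V.A.7)–(V.A.8)] -/
private theorem nine_le_cmTypeRank_of_residueSet_eq_N6_fortyEight (Φ : CMType K) (hΦ : residueSet 48 Φ = {1, 5, 7, 13, 17, 25, 29, 37}) :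
    9 ≤ cmTypeRank Φ := by
  classical
  have hu : ∀ i : Fin 9, ((![1, 5, 7, 11, 13, 17, 19, 23, 25] : Fin 9 → ZMod 48) i).val.Coprime 48 := by decide
  have hc : ∀ j : Fin 9, ((![1, 5, 7, 11, 13, 17, 19, 23, 25] : Fin 9 → ZMod 48) j).val.Coprime 48 := by decide
  choose τ hτ using fun i : Fin 9 => exists_autExp_eq 48 _ (hu i)
  choose σ hσ using fun j : Fin 9 => exists_expOf_eq 48 K _ (hc j)
  let f : Fin 9 → (K →+* ℂ) → ℚ := fun i => translateInd Φ.1 (τ i)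
  have hval : ∀ i j : Fin 9, f i (σ j) =
      if (![1, 5, 7, 11, 13, 17, 19, 23, 25] : Fin 9 → ZMod 48) i * (![1, 5, 7, 11, 13, 17, 19, 23, 25] : Fin 9 → ZMod 48) j ∈
        ({1, 5, 7, 13, 17, 25, 29, 37} : Finset (ZMod 48)) then (1 : ℚ) else 0 := by
    intro i j
    show translateInd Φ.1 (τ i) (σ j) = _
    rw [translateInd_eq_ite₈, hτ, hσ, hΦ]
  have hli : LinearIndependent ℚ f := by
    rw [Fintype.linearIndependent_iff]
    intro g hg
    have heval : ∀ j : Fin 9, ∑ i, g i * f i (σ j) = 0 := fun j => by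
      have := congrFun hg (σ j)
      simpa only [Finset.sum_apply, Pi.smul_apply, smul_eq_mul, Pi.zero_apply] using this
    have e0 := heval 0
    have e1 := heval 1
    have e2 := heval 2
    have e3 := heval 3
    have e4 := heval 4
    have e5 := heval 5
    have e6 := heval 6
    have e7 := heval 7
    have e8 := heval 8
    simp (config := { decide := true }) [Fin.sum_univ_succ, hval] at e0 e1 e2 e3 e4 e5 e6 e7 e8
    intro i
    fin_cases i <;> simp <;> linarith
  have h1 : Module.finrank ℚ (Submodule.span ℚ (Set.range f)) = 9 := by
    rw [finrank_span_eq_card hli, Fintype.card_fin]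
  have h2 : Submodule.span ℚ (Set.range f) ≤
      Submodule.span ℚ (Set.range fun g : ℂ ≃+* ℂ => translateInd Φ.1 g) :=
    Submodule.span_mono (by rintro _ ⟨i, rfl⟩; exact ⟨τ i, rfl⟩)
  have h3 := Submodule.finrank_mono h2
  rw [h1] at h3
  exact h3

/-- **`Rank(Φ) ≥ 9` for the type with residue set `{1, 5, 7, 13, 19, 25, 31, 37}`** (`N7`): the translates by the automorphisms of `ℂ` with cyclotomic characters
`1, 5, 7, 11, 13, 17, 19, 23, 25`, read at the embeddings with exponents `1, 5, 7, 11, 13, 17, 19, 23, 25`, are linearly independent (the `9 × 9` minor of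
`([u·c ∈ S])` has determinant `-6`). [cite: Kubota1965, §2 (p. 115)] [cite: GreenGriffithsKerr2012, (V.A.7)–(V.A.8)] -/
private theorem nine_le_cmTypeRank_of_residueSet_eq_N7_fortyEight (Φ : CMType K) (hΦ : residueSet 48 Φ = {1, 5, 7, 13, 19, 25, 31, 37}) :
    9 ≤ cmTypeRank Φ := by
  classical
  have hu : ∀ i : Fin 9, ((![1, 5, 7, 11, 13, 17, 19, 23, 25] : Fin 9 → ZMod 48) i).val.Coprime 48 := by decide
  have hc : ∀ j : Fin 9, ((![1, 5, 7, 11, 13, 17, 19, 23, 25] : Fin 9 → ZMod 48) j).val.Coprime 48 := by decide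
  choose τ hτ using fun i : Fin 9 => exists_autExp_eq 48 _ (hu i)
  choose σ hσ using fun j : Fin 9 => exists_expOf_eq 48 K _ (hc j)
  let f : Fin 9 → (K →+* ℂ) → ℚ := fun i => translateInd Φ.1 (τ i)
  have hval : ∀ i j : Fin 9, f i (σ j) =
      if (![1, 5, 7, 11, 13, 17, 19, 23, 25] : Fin 9 → ZMod 48) i * (![1, 5, 7, 11, 13, 17, 19, 23, 25] : Fin 9 → ZMod 48) j ∈
        ({1, 5, 7, 13, 19, 25, 31, 37} : Finset (ZMod 48)) then (1 : ℚ) else 0 := by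
    intro i j
    show translateInd Φ.1 (τ i) (σ j) = _
    rw [translateInd_eq_ite₈, hτ, hσ, hΦ]
  have hli : LinearIndependent ℚ f := by
    rw [Fintype.linearIndependent_iff]
    intro g hg
    have heval : ∀ j : Fin 9, ∑ i, g i * f i (σ j) = 0 := fun j => by
      have := congrFun hg (σ j)
      simpa only [Finset.sum_apply, Pi.smul_apply, smul_eq_mul, Pi.zero_apply] using this
    have e0 := heval 0
    have e1 := heval 1
    have e2 := heval 2
    have e3 := heval 3
    have e4 := heval 4
    have e5 := heval 5
    have e6 := heval 6
    have e7 := heval 7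
    have e8 := heval 8
    simp (config := { decide := true }) [Fin.sum_univ_succ, hval] at e0 e1 e2 e3 e4 e5 e6 e7 e8
    intro i
    fin_cases i <;> simp <;> linarith
  have h1 : Module.finrank ℚ (Submodule.span ℚ (Set.range f)) = 9 := by
    rw [finrank_span_eq_card hli, Fintype.card_fin]
  have h2 : Submodule.span ℚ (Set.range f) ≤
      Submodule.span ℚ (Set.range fun g : ℂ ≃+* ℂ => translateInd Φ.1 g) :=
    Submodule.span_mono (by rintro _ ⟨i, rfl⟩; exact ⟨τ i, rfl⟩)
  have h3 := Submodule.finrank_mono h2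
  rw [h1] at h3
  exact h3

/-- **`Rank(Φ) ≥ 9` for the type with residue set `{1, 5, 7, 13, 23, 29, 31, 37}`** (`N8`): the translates by the automorphisms of `ℂ` with cyclotomic characters
`1, 5, 7, 11, 13, 17, 19, 23, 25`, read at the embeddings with exponents `1, 5, 7, 11, 13, 17, 19, 23, 25`, are linearly independent (the `9 × 9` minor of
`([u·c ∈ S])` has determinant `-6`). [cite: Kubota1965, §2 (p. 115)] [cite: GreenGriffithsKerr2012, (V.A.7)–(V.A.8)] -/
private theorem nine_le_cmTypeRank_of_residueSet_eq_N8_fortyEight (Φ : CMType K) (hΦ : residueSet 48 Φ = {1, 5, 7, 13, 23, 29, 31, 37}) :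
    9 ≤ cmTypeRank Φ := by
  classical
  have hu : ∀ i : Fin 9, ((![1, 5, 7, 11, 13, 17, 19, 23, 25] : Fin 9 → ZMod 48) i).val.Coprime 48 := by decide
  have hc : ∀ j : Fin 9, ((![1, 5, 7, 11, 13, 17, 19, 23, 25] : Fin 9 → ZMod 48) j).val.Coprime 48 := by decide
  choose τ hτ using fun i : Fin 9 => exists_autExp_eq 48 _ (hu i)
  choose σ hσ using fun j : Fin 9 => exists_expOf_eq 48 K _ (hc j)
  let f : Fin 9 → (K →+* ℂ) → ℚ := fun i => translateInd Φ.1 (τ i)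
  have hval : ∀ i j : Fin 9, f i (σ j) =
      if (![1, 5, 7, 11, 13, 17, 19, 23, 25] : Fin 9 → ZMod 48) i * (![1, 5, 7, 11, 13, 17, 19, 23, 25] : Fin 9 → ZMod 48) j ∈
        ({1, 5, 7, 13, 23, 29, 31, 37} : Finset (ZMod 48)) then (1 : ℚ) else 0 := by
    intro i j
    show translateInd Φ.1 (τ i) (σ j) = _
    rw [translateInd_eq_ite₈, hτ, hσ, hΦ]
  have hli : LinearIndependent ℚ f := by
    rw [Fintype.linearIndependent_iff]
    intro g hg
    have heval : ∀ j : Fin 9, ∑ i, g i * f i (σ j) = 0 := fun j => by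
      have := congrFun hg (σ j)
      simpa only [Finset.sum_apply, Pi.smul_apply, smul_eq_mul, Pi.zero_apply] using this
    have e0 := heval 0
    have e1 := heval 1
    have e2 := heval 2
    have e3 := heval 3
    have e4 := heval 4
    have e5 := heval 5
    have e6 := heval 6
    have e7 := heval 7
    have e8 := heval 8
    simp (config := { decide := true }) [Fin.sum_univ_succ, hval] at e0 e1 e2 e3 e4 e5 e6 e7 e8
    intro i
    fin_cases i <;> simp <;> linarith
  have h1 : Module.finrank ℚ (Submodule.span ℚ (Set.range f)) = 9 := by
    rw [finrank_span_eq_card hli, Fintype.card_fin]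
  have h2 : Submodule.span ℚ (Set.range f) ≤
      Submodule.span ℚ (Set.range fun g : ℂ ≃+* ℂ => translateInd Φ.1 g) :=
    Submodule.span_mono (by rintro _ ⟨i, rfl⟩; exact ⟨τ i, rfl⟩)
  have h3 := Submodule.finrank_mono h2
  rw [h1] at h3
  exact h3

/-- **`Rank(Φ) ≥ 7` for the type with residue set `{1, 5, 7, 11, 13, 17, 25, 29}`** (`D1`): the translates by the automorphisms of `ℂ` with cyclotomic characters
`1, 5, 7, 11, 13, 19, 25`, read at the embeddings with exponents `1, 5, 7, 11, 13, 19, 25`, are linearly independent (the `7 × 7` minor of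
`([u·c ∈ S])` has determinant `2`). [cite: Kubota1965, §2 (p. 115)] [cite: GreenGriffithsKerr2012, (V.A.7)–(V.A.8)] -/
private theorem seven_le_cmTypeRank_of_residueSet_eq_D1_fortyEight (Φ : CMType K) (hΦ : residueSet 48 Φ = {1, 5, 7, 11, 13, 17, 25, 29}) :
    7 ≤ cmTypeRank Φ := by
  classical
  have hu : ∀ i : Fin 7, ((![1, 5, 7, 11, 13, 19, 25] : Fin 7 → ZMod 48) i).val.Coprime 48 := by decide
  have hc : ∀ j : Fin 7, ((![1, 5, 7, 11, 13, 19, 25] : Fin 7 → ZMod 48) j).val.Coprime 48 := by decide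
  choose τ hτ using fun i : Fin 7 => exists_autExp_eq 48 _ (hu i)
  choose σ hσ using fun j : Fin 7 => exists_expOf_eq 48 K _ (hc j)
  let f : Fin 7 → (K →+* ℂ) → ℚ := fun i => translateInd Φ.1 (τ i)
  have hval : ∀ i j : Fin 7, f i (σ j) =
      if (![1, 5, 7, 11, 13, 19, 25] : Fin 7 → ZMod 48) i * (![1, 5, 7, 11, 13, 19, 25] : Fin 7 → ZMod 48) j ∈
        ({1, 5, 7, 11, 13, 17, 25, 29} : Finset (ZMod 48)) then (1 : ℚ) else 0 := by
    intro i j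
    show translateInd Φ.1 (τ i) (σ j) = _
    rw [translateInd_eq_ite₈, hτ, hσ, hΦ]
  have hli : LinearIndependent ℚ f := by
    rw [Fintype.linearIndependent_iff]
    intro g hg
    have heval : ∀ j : Fin 7, ∑ i, g i * f i (σ j) = 0 := fun j => by
      have := congrFun hg (σ j)
      simpa only [Finset.sum_apply, Pi.smul_apply, smul_eq_mul, Pi.zero_apply] using this
    have e0 := heval 0
    have e1 := heval 1
    have e2 := heval 2
    have e3 := heval 3
    have e4 := heval 4
    have e5 := heval 5
    have e6 := heval 6
    simp (config := { decide := true }) [Fin.sum_univ_succ, hval] at e0 e1 e2 e3 e4 e5 e6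
    intro i
    fin_cases i <;> simp <;> linarith
  have h1 : Module.finrank ℚ (Submodule.span ℚ (Set.range f)) = 7 := by
    rw [finrank_span_eq_card hli, Fintype.card_fin]
  have h2 : Submodule.span ℚ (Set.range f) ≤
      Submodule.span ℚ (Set.range fun g : ℂ ≃+* ℂ => translateInd Φ.1 g) :=
    Submodule.span_mono (by rintro _ ⟨i, rfl⟩; exact ⟨τ i, rfl⟩)
  have h3 := Submodule.finrank_mono h2
  rw [h1] at h3
  exact h3

/-- **`Rank(Φ) ≥ 7` for the type with residue set `{1, 5, 7, 11, 13, 23, 29, 31}`** (`D2`): the translates by the automorphisms of `ℂ` with cyclotomic characters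
`1, 5, 7, 11, 13, 17, 25`, read at the embeddings with exponents `1, 5, 7, 11, 13, 17, 25`, are linearly independent (the `7 × 7` minor of
`([u·c ∈ S])` has determinant `-2`). [cite: Kubota1965, §2 (p. 115)] [cite: GreenGriffithsKerr2012, (V.A.7)–(V.A.8)] -/
private theorem seven_le_cmTypeRank_of_residueSet_eq_D2_fortyEight (Φ : CMType K) (hΦ : residueSet 48 Φ = {1, 5, 7, 11, 13, 23, 29, 31}) :
    7 ≤ cmTypeRank Φ := by
  classical
  have hu : ∀ i : Fin 7, ((![1, 5, 7, 11, 13, 17, 25] : Fin 7 → ZMod 48) i).val.Coprime 48 := by decide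
  have hc : ∀ j : Fin 7, ((![1, 5, 7, 11, 13, 17, 25] : Fin 7 → ZMod 48) j).val.Coprime 48 := by decide
  choose τ hτ using fun i : Fin 7 => exists_autExp_eq 48 _ (hu i)
  choose σ hσ using fun j : Fin 7 => exists_expOf_eq 48 K _ (hc j)
  let f : Fin 7 → (K →+* ℂ) → ℚ := fun i => translateInd Φ.1 (τ i)
  have hval : ∀ i j : Fin 7, f i (σ j) =
      if (![1, 5, 7, 11, 13, 17, 25] : Fin 7 → ZMod 48) i * (![1, 5, 7, 11, 13, 17, 25] : Fin 7 → ZMod 48) j ∈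
        ({1, 5, 7, 11, 13, 23, 29, 31} : Finset (ZMod 48)) then (1 : ℚ) else 0 := by
    intro i j
    show translateInd Φ.1 (τ i) (σ j) = _
    rw [translateInd_eq_ite₈, hτ, hσ, hΦ]
  have hli : LinearIndependent ℚ f := by
    rw [Fintype.linearIndependent_iff]
    intro g hg
    have heval : ∀ j : Fin 7, ∑ i, g i * f i (σ j) = 0 := fun j => by
      have := congrFun hg (σ j)
      simpa only [Finset.sum_apply, Pi.smul_apply, smul_eq_mul, Pi.zero_apply] using this
    have e0 := heval 0
    have e1 := heval 1
    have e2 := heval 2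
    have e3 := heval 3
    have e4 := heval 4
    have e5 := heval 5
    have e6 := heval 6
    simp (config := { decide := true }) [Fin.sum_univ_succ, hval] at e0 e1 e2 e3 e4 e5 e6
    intro i
    fin_cases i <;> simp <;> linarith
  have h1 : Module.finrank ℚ (Submodule.span ℚ (Set.range f)) = 7 := by
    rw [finrank_span_eq_card hli, Fintype.card_fin]
  have h2 : Submodule.span ℚ (Set.range f) ≤
      Submodule.span ℚ (Set.range fun g : ℂ ≃+* ℂ => translateInd Φ.1 g) :=
    Submodule.span_mono (by rintro _ ⟨i, rfl⟩; exact ⟨τ i, rfl⟩)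
  have h3 := Submodule.finrank_mono h2
  rw [h1] at h3
  exact h3

/-- **`Rank(Φ) ≥ 7` for the type with residue set `{1, 5, 7, 13, 17, 19, 25, 37}`** (`D3`): the translates by the automorphisms of `ℂ` with cyclotomic characters
`1, 5, 7, 11, 13, 17, 25`, read at the embeddings with exponents `1, 5, 7, 11, 13, 17, 25`, are linearly independent (the `7 × 7` minor of
`([u·c ∈ S])` has determinant `2`). [cite: Kubota1965, §2 (p. 115)] [cite: GreenGriffithsKerr2012, (V.A.7)–(V.A.8)] -/
private theorem seven_le_cmTypeRank_of_residueSet_eq_D3_fortyEight (Φ : CMType K) (hΦ : residueSet 48 Φ = {1, 5, 7, 13, 17, 19, 25, 37}) :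
    7 ≤ cmTypeRank Φ := by
  classical
  have hu : ∀ i : Fin 7, ((![1, 5, 7, 11, 13, 17, 25] : Fin 7 → ZMod 48) i).val.Coprime 48 := by decide
  have hc : ∀ j : Fin 7, ((![1, 5, 7, 11, 13, 17, 25] : Fin 7 → ZMod 48) j).val.Coprime 48 := by decide
  choose τ hτ using fun i : Fin 7 => exists_autExp_eq 48 _ (hu i)
  choose σ hσ using fun j : Fin 7 => exists_expOf_eq 48 K _ (hc j)
  let f : Fin 7 → (K →+* ℂ) → ℚ := fun i => translateInd Φ.1 (τ i)
  have hval : ∀ i j : Fin 7, f i (σ j) =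
      if (![1, 5, 7, 11, 13, 17, 25] : Fin 7 → ZMod 48) i * (![1, 5, 7, 11, 13, 17, 25] : Fin 7 → ZMod 48) j ∈
        ({1, 5, 7, 13, 17, 19, 25, 37} : Finset (ZMod 48)) then (1 : ℚ) else 0 := by
    intro i j
    show translateInd Φ.1 (τ i) (σ j) = _
    rw [translateInd_eq_ite₈, hτ, hσ, hΦ]
  have hli : LinearIndependent ℚ f := by
    rw [Fintype.linearIndependent_iff]
    intro g hg
    have heval : ∀ j : Fin 7, ∑ i, g i * f i (σ j) = 0 := fun j => by
      have := congrFun hg (σ j)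
      simpa only [Finset.sum_apply, Pi.smul_apply, smul_eq_mul, Pi.zero_apply] using this
    have e0 := heval 0
    have e1 := heval 1
    have e2 := heval 2
    have e3 := heval 3
    have e4 := heval 4
    have e5 := heval 5
    have e6 := heval 6
    simp (config := { decide := true }) [Fin.sum_univ_succ, hval] at e0 e1 e2 e3 e4 e5 e6
    intro i
    fin_cases i <;> simp <;> linarith
  have h1 : Module.finrank ℚ (Submodule.span ℚ (Set.range f)) = 7 := by
    rw [finrank_span_eq_card hli, Fintype.card_fin]
  have h2 : Submodule.span ℚ (Set.range f) ≤
      Submodule.span ℚ (Set.range fun g : ℂ ≃+* ℂ => translateInd Φ.1 g) :=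
    Submodule.span_mono (by rintro _ ⟨i, rfl⟩; exact ⟨τ i, rfl⟩)
  have h3 := Submodule.finrank_mono h2
  rw [h1] at h3
  exact h3

/-- **`Rank(Φ) ≥ 7` for the type with residue set `{1, 5, 7, 13, 19, 23, 31, 37}`** (`D4`): the translates by the automorphisms of `ℂ` with cyclotomic characters
`1, 5, 7, 11, 13, 19, 25`, read at the embeddings with exponents `1, 5, 7, 11, 13, 19, 25`, are linearly independent (the `7 × 7` minor of
`([u·c ∈ S])` has determinant `-2`). [cite: Kubota1965, §2 (p. 115)] [cite: GreenGriffithsKerr2012, (V.A.7)–(V.A.8)] -/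
private theorem seven_le_cmTypeRank_of_residueSet_eq_D4_fortyEight (Φ : CMType K) (hΦ : residueSet 48 Φ = {1, 5, 7, 13, 19, 23, 31, 37}) :
    7 ≤ cmTypeRank Φ := by
  classical
  have hu : ∀ i : Fin 7, ((![1, 5, 7, 11, 13, 19, 25] : Fin 7 → ZMod 48) i).val.Coprime 48 := by decide
  have hc : ∀ j : Fin 7, ((![1, 5, 7, 11, 13, 19, 25] : Fin 7 → ZMod 48) j).val.Coprime 48 := by decide
  choose τ hτ using fun i : Fin 7 => exists_autExp_eq 48 _ (hu i)
  choose σ hσ using fun j : Fin 7 => exists_expOf_eq 48 K _ (hc j)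
  let f : Fin 7 → (K →+* ℂ) → ℚ := fun i => translateInd Φ.1 (τ i)
  have hval : ∀ i j : Fin 7, f i (σ j) =
      if (![1, 5, 7, 11, 13, 19, 25] : Fin 7 → ZMod 48) i * (![1, 5, 7, 11, 13, 19, 25] : Fin 7 → ZMod 48) j ∈
        ({1, 5, 7, 13, 19, 23, 31, 37} : Finset (ZMod 48)) then (1 : ℚ) else 0 := by
    intro i j
    show translateInd Φ.1 (τ i) (σ j) = _
    rw [translateInd_eq_ite₈, hτ, hσ, hΦ]
  have hli : LinearIndependent ℚ f := by
    rw [Fintype.linearIndependent_iff]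
    intro g hg
    have heval : ∀ j : Fin 7, ∑ i, g i * f i (σ j) = 0 := fun j => by
      have := congrFun hg (σ j)
      simpa only [Finset.sum_apply, Pi.smul_apply, smul_eq_mul, Pi.zero_apply] using this
    have e0 := heval 0
    have e1 := heval 1
    have e2 := heval 2
    have e3 := heval 3
    have e4 := heval 4
    have e5 := heval 5
    have e6 := heval 6
    simp (config := { decide := true }) [Fin.sum_univ_succ, hval] at e0 e1 e2 e3 e4 e5 e6
    intro i
    fin_cases i <;> simp <;> linarith
  have h1 : Module.finrank ℚ (Submodule.span ℚ (Set.range f)) = 7 := by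
    rw [finrank_span_eq_card hli, Fintype.card_fin]
  have h2 : Submodule.span ℚ (Set.range f) ≤
      Submodule.span ℚ (Set.range fun g : ℂ ≃+* ℂ => translateInd Φ.1 g) :=
    Submodule.span_mono (by rintro _ ⟨i, rfl⟩; exact ⟨τ i, rfl⟩)
  have h3 := Submodule.finrank_mono h2
  rw [h1] at h3
  exact h3

/-- **`Rank(Φ) ≥ 5` for the type with residue set `{1, 5, 7, 11, 13, 17, 19, 23}`** (`I1`): the translates by the automorphisms of `ℂ` with cyclotomic characters
`1, 5, 7, 11, 25`, read at the embeddings with exponents `1, 5, 7, 11, 25`, are linearly independent (the `5 × 5` minor of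
`([u·c ∈ S])` has determinant `2`). [cite: Kubota1965, §2 (p. 115)] [cite: GreenGriffithsKerr2012, (V.A.7)–(V.A.8)] -/
private theorem five_le_cmTypeRank_of_residueSet_eq_I1_fortyEight (Φ : CMType K) (hΦ : residueSet 48 Φ = {1, 5, 7, 11, 13, 17, 19, 23}) :
    5 ≤ cmTypeRank Φ := by
  classical
  have hu : ∀ i : Fin 5, ((![1, 5, 7, 11, 25] : Fin 5 → ZMod 48) i).val.Coprime 48 := by decide
  have hc : ∀ j : Fin 5, ((![1, 5, 7, 11, 25] : Fin 5 → ZMod 48) j).val.Coprime 48 := by decide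
  choose τ hτ using fun i : Fin 5 => exists_autExp_eq 48 _ (hu i)
  choose σ hσ using fun j : Fin 5 => exists_expOf_eq 48 K _ (hc j)
  let f : Fin 5 → (K →+* ℂ) → ℚ := fun i => translateInd Φ.1 (τ i)
  have hval : ∀ i j : Fin 5, f i (σ j) =
      if (![1, 5, 7, 11, 25] : Fin 5 → ZMod 48) i * (![1, 5, 7, 11, 25] : Fin 5 → ZMod 48) j ∈
        ({1, 5, 7, 11, 13, 17, 19, 23} : Finset (ZMod 48)) then (1 : ℚ) else 0 := by
    intro i j
    show translateInd Φ.1 (τ i) (σ j) = _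
    rw [translateInd_eq_ite₈, hτ, hσ, hΦ]
  have hli : LinearIndependent ℚ f := by
    rw [Fintype.linearIndependent_iff]
    intro g hg
    have heval : ∀ j : Fin 5, ∑ i, g i * f i (σ j) = 0 := fun j => by
      have := congrFun hg (σ j)
      simpa only [Finset.sum_apply, Pi.smul_apply, smul_eq_mul, Pi.zero_apply] using this
    have e0 := heval 0
    have e1 := heval 1
    have e2 := heval 2
    have e3 := heval 3
    have e4 := heval 4
    simp (config := { decide := true }) [Fin.sum_univ_succ, hval] at e0 e1 e2 e3 e4
    intro i
    fin_cases i <;> simp <;> linarith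
  have h1 : Module.finrank ℚ (Submodule.span ℚ (Set.range f)) = 5 := by
    rw [finrank_span_eq_card hli, Fintype.card_fin]
  have h2 : Submodule.span ℚ (Set.range f) ≤
      Submodule.span ℚ (Set.range fun g : ℂ ≃+* ℂ => translateInd Φ.1 g) :=
    Submodule.span_mono (by rintro _ ⟨i, rfl⟩; exact ⟨τ i, rfl⟩)
  have h3 := Submodule.finrank_mono h2
  rw [h1] at h3
  exact h3

/-- **`Rank(Φ) ≥ 5` for the type with residue set `{1, 5, 7, 11, 13, 19, 25, 31}`** (`I2`): the translates by the automorphisms of `ℂ` with cyclotomic characters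
`1, 5, 7, 13, 17`, read at the embeddings with exponents `1, 5, 7, 13, 17`, are linearly independent (the `5 × 5` minor of
`([u·c ∈ S])` has determinant `-2`). [cite: Kubota1965, §2 (p. 115)] [cite: GreenGriffithsKerr2012, (V.A.7)–(V.A.8)] -/
private theorem five_le_cmTypeRank_of_residueSet_eq_I2_fortyEight (Φ : CMType K) (hΦ : residueSet 48 Φ = {1, 5, 7, 11, 13, 19, 25, 31}) :
    5 ≤ cmTypeRank Φ := by
  classical
  have hu : ∀ i : Fin 5, ((![1, 5, 7, 13, 17] : Fin 5 → ZMod 48) i).val.Coprime 48 := by decide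
  have hc : ∀ j : Fin 5, ((![1, 5, 7, 13, 17] : Fin 5 → ZMod 48) j).val.Coprime 48 := by decide
  choose τ hτ using fun i : Fin 5 => exists_autExp_eq 48 _ (hu i)
  choose σ hσ using fun j : Fin 5 => exists_expOf_eq 48 K _ (hc j)
  let f : Fin 5 → (K →+* ℂ) → ℚ := fun i => translateInd Φ.1 (τ i)
  have hval : ∀ i j : Fin 5, f i (σ j) =
      if (![1, 5, 7, 13, 17] : Fin 5 → ZMod 48) i * (![1, 5, 7, 13, 17] : Fin 5 → ZMod 48) j ∈
        ({1, 5, 7, 11, 13, 19, 25, 31} : Finset (ZMod 48)) then (1 : ℚ) else 0 := by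
    intro i j
    show translateInd Φ.1 (τ i) (σ j) = _
    rw [translateInd_eq_ite₈, hτ, hσ, hΦ]
  have hli : LinearIndependent ℚ f := by
    rw [Fintype.linearIndependent_iff]
    intro g hg
    have heval : ∀ j : Fin 5, ∑ i, g i * f i (σ j) = 0 := fun j => by
      have := congrFun hg (σ j)
      simpa only [Finset.sum_apply, Pi.smul_apply, smul_eq_mul, Pi.zero_apply] using this
    have e0 := heval 0
    have e1 := heval 1
    have e2 := heval 2
    have e3 := heval 3
    have e4 := heval 4
    simp (config := { decide := true }) [Fin.sum_univ_succ, hval] at e0 e1 e2 e3 e4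
    intro i
    fin_cases i <;> simp <;> linarith
  have h1 : Module.finrank ℚ (Submodule.span ℚ (Set.range f)) = 5 := by
    rw [finrank_span_eq_card hli, Fintype.card_fin]
  have h2 : Submodule.span ℚ (Set.range f) ≤
      Submodule.span ℚ (Set.range fun g : ℂ ≃+* ℂ => translateInd Φ.1 g) :=
    Submodule.span_mono (by rintro _ ⟨i, rfl⟩; exact ⟨τ i, rfl⟩)
  have h3 := Submodule.finrank_mono h2
  rw [h1] at h3
  exact h3

/-- **`Rank(Φ) ≥ 5` for the type with residue set `{1, 5, 7, 11, 17, 23, 29, 35}`** (`I3`): the translates by the automorphisms of `ℂ` with cyclotomic characters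
`1, 5, 11, 13, 17`, read at the embeddings with exponents `1, 5, 11, 13, 17`, are linearly independent (the `5 × 5` minor of
`([u·c ∈ S])` has determinant `2`). [cite: Kubota1965, §2 (p. 115)] [cite: GreenGriffithsKerr2012, (V.A.7)–(V.A.8)] -/
private theorem five_le_cmTypeRank_of_residueSet_eq_I3_fortyEight (Φ : CMType K) (hΦ : residueSet 48 Φ = {1, 5, 7, 11, 17, 23, 29, 35}) :
    5 ≤ cmTypeRank Φ := by
  classical
  have hu : ∀ i : Fin 5, ((![1, 5, 11, 13, 17] : Fin 5 → ZMod 48) i).val.Coprime 48 := by decide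
  have hc : ∀ j : Fin 5, ((![1, 5, 11, 13, 17] : Fin 5 → ZMod 48) j).val.Coprime 48 := by decide
  choose τ hτ using fun i : Fin 5 => exists_autExp_eq 48 _ (hu i)
  choose σ hσ using fun j : Fin 5 => exists_expOf_eq 48 K _ (hc j)
  let f : Fin 5 → (K →+* ℂ) → ℚ := fun i => translateInd Φ.1 (τ i)
  have hval : ∀ i j : Fin 5, f i (σ j) =
      if (![1, 5, 11, 13, 17] : Fin 5 → ZMod 48) i * (![1, 5, 11, 13, 17] : Fin 5 → ZMod 48) j ∈
        ({1, 5, 7, 11, 17, 23, 29, 35} : Finset (ZMod 48)) then (1 : ℚ) else 0 := by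
    intro i j
    show translateInd Φ.1 (τ i) (σ j) = _
    rw [translateInd_eq_ite₈, hτ, hσ, hΦ]
  have hli : LinearIndependent ℚ f := by
    rw [Fintype.linearIndependent_iff]
    intro g hg
    have heval : ∀ j : Fin 5, ∑ i, g i * f i (σ j) = 0 := fun j => by
      have := congrFun hg (σ j)
      simpa only [Finset.sum_apply, Pi.smul_apply, smul_eq_mul, Pi.zero_apply] using this
    have e0 := heval 0
    have e1 := heval 1
    have e2 := heval 2
    have e3 := heval 3
    have e4 := heval 4
    simp (config := { decide := true }) [Fin.sum_univ_succ, hval] at e0 e1 e2 e3 e4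
    intro i
    fin_cases i <;> simp <;> linarith
  have h1 : Module.finrank ℚ (Submodule.span ℚ (Set.range f)) = 5 := by
    rw [finrank_span_eq_card hli, Fintype.card_fin]
  have h2 : Submodule.span ℚ (Set.range f) ≤
      Submodule.span ℚ (Set.range fun g : ℂ ≃+* ℂ => translateInd Φ.1 g) :=
    Submodule.span_mono (by rintro _ ⟨i, rfl⟩; exact ⟨τ i, rfl⟩)
  have h3 := Submodule.finrank_mono h2
  rw [h1] at h3
  exact h3

/-- **`Rank(Φ) ≥ 5` for the type with residue set `{1, 5, 7, 13, 17, 23, 29, 37}`** (`I4`): the translates by the automorphisms of `ℂ` with cyclotomic characters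
`1, 5, 7, 11, 13`, read at the embeddings with exponents `1, 5, 7, 11, 13`, are linearly independent (the `5 × 5` minor of
`([u·c ∈ S])` has determinant `2`). [cite: Kubota1965, §2 (p. 115)] [cite: GreenGriffithsKerr2012, (V.A.7)–(V.A.8)] -/
private theorem five_le_cmTypeRank_of_residueSet_eq_I4_fortyEight (Φ : CMType K) (hΦ : residueSet 48 Φ = {1, 5, 7, 13, 17, 23, 29, 37}) :
    5 ≤ cmTypeRank Φ := by
  classical
  have hu : ∀ i : Fin 5, ((![1, 5, 7, 11, 13] : Fin 5 → ZMod 48) i).val.Coprime 48 := by decide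
  have hc : ∀ j : Fin 5, ((![1, 5, 7, 11, 13] : Fin 5 → ZMod 48) j).val.Coprime 48 := by decide
  choose τ hτ using fun i : Fin 5 => exists_autExp_eq 48 _ (hu i)
  choose σ hσ using fun j : Fin 5 => exists_expOf_eq 48 K _ (hc j)
  let f : Fin 5 → (K →+* ℂ) → ℚ := fun i => translateInd Φ.1 (τ i)
  have hval : ∀ i j : Fin 5, f i (σ j) =
      if (![1, 5, 7, 11, 13] : Fin 5 → ZMod 48) i * (![1, 5, 7, 11, 13] : Fin 5 → ZMod 48) j ∈
        ({1, 5, 7, 13, 17, 23, 29, 37} : Finset (ZMod 48)) then (1 : ℚ) else 0 := by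
    intro i j
    show translateInd Φ.1 (τ i) (σ j) = _
    rw [translateInd_eq_ite₈, hτ, hσ, hΦ]
  have hli : LinearIndependent ℚ f := by
    rw [Fintype.linearIndependent_iff]
    intro g hg
    have heval : ∀ j : Fin 5, ∑ i, g i * f i (σ j) = 0 := fun j => by
      have := congrFun hg (σ j)
      simpa only [Finset.sum_apply, Pi.smul_apply, smul_eq_mul, Pi.zero_apply] using this
    have e0 := heval 0
    have e1 := heval 1
    have e2 := heval 2
    have e3 := heval 3
    have e4 := heval 4
    simp (config := { decide := true }) [Fin.sum_univ_succ, hval] at e0 e1 e2 e3 e4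
    intro i
    fin_cases i <;> simp <;> linarith
  have h1 : Module.finrank ℚ (Submodule.span ℚ (Set.range f)) = 5 := by
    rw [finrank_span_eq_card hli, Fintype.card_fin]
  have h2 : Submodule.span ℚ (Set.range f) ≤
      Submodule.span ℚ (Set.range fun g : ℂ ≃+* ℂ => translateInd Φ.1 g) :=
    Submodule.span_mono (by rintro _ ⟨i, rfl⟩; exact ⟨τ i, rfl⟩)
  have h3 := Submodule.finrank_mono h2
  rw [h1] at h3
  exact h3

/-- **`Rank(Φ) ≥ 5` for the type with residue set `{1, 5, 7, 13, 25, 29, 31, 37}`** (`I5`): the translates by the automorphisms of `ℂ` with cyclotomic characters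
`1, 5, 7, 11, 13`, read at the embeddings with exponents `1, 5, 7, 11, 13`, are linearly independent (the `5 × 5` minor of
`([u·c ∈ S])` has determinant `-2`). [cite: Kubota1965, §2 (p. 115)] [cite: GreenGriffithsKerr2012, (V.A.7)–(V.A.8)] -/
private theorem five_le_cmTypeRank_of_residueSet_eq_I5_fortyEight (Φ : CMType K) (hΦ : residueSet 48 Φ = {1, 5, 7, 13, 25, 29, 31, 37}) :
    5 ≤ cmTypeRank Φ := by
  classical
  have hu : ∀ i : Fin 5, ((![1, 5, 7, 11, 13] : Fin 5 → ZMod 48) i).val.Coprime 48 := by decide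
  have hc : ∀ j : Fin 5, ((![1, 5, 7, 11, 13] : Fin 5 → ZMod 48) j).val.Coprime 48 := by decide
  choose τ hτ using fun i : Fin 5 => exists_autExp_eq 48 _ (hu i)
  choose σ hσ using fun j : Fin 5 => exists_expOf_eq 48 K _ (hc j)
  let f : Fin 5 → (K →+* ℂ) → ℚ := fun i => translateInd Φ.1 (τ i)
  have hval : ∀ i j : Fin 5, f i (σ j) =
      if (![1, 5, 7, 11, 13] : Fin 5 → ZMod 48) i * (![1, 5, 7, 11, 13] : Fin 5 → ZMod 48) j ∈
        ({1, 5, 7, 13, 25, 29, 31, 37} : Finset (ZMod 48)) then (1 : ℚ) else 0 := by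
    intro i j
    show translateInd Φ.1 (τ i) (σ j) = _
    rw [translateInd_eq_ite₈, hτ, hσ, hΦ]
  have hli : LinearIndependent ℚ f := by
    rw [Fintype.linearIndependent_iff]
    intro g hg
    have heval : ∀ j : Fin 5, ∑ i, g i * f i (σ j) = 0 := fun j => by
      have := congrFun hg (σ j)
      simpa only [Finset.sum_apply, Pi.smul_apply, smul_eq_mul, Pi.zero_apply] using this
    have e0 := heval 0
    have e1 := heval 1
    have e2 := heval 2
    have e3 := heval 3
    have e4 := heval 4
    simp (config := { decide := true }) [Fin.sum_univ_succ, hval] at e0 e1 e2 e3 e4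
    intro i
    fin_cases i <;> simp <;> linarith
  have h1 : Module.finrank ℚ (Submodule.span ℚ (Set.range f)) = 5 := by
    rw [finrank_span_eq_card hli, Fintype.card_fin]
  have h2 : Submodule.span ℚ (Set.range f) ≤
      Submodule.span ℚ (Set.range fun g : ℂ ≃+* ℂ => translateInd Φ.1 g) :=
    Submodule.span_mono (by rintro _ ⟨i, rfl⟩; exact ⟨τ i, rfl⟩)
  have h3 := Submodule.finrank_mono h2
  rw [h1] at h3
  exact h3

/-- **`Rank(Φ) ≥ 5` for the type with residue set `{1, 5, 11, 13, 17, 19, 25, 41}`** (`I6`): the translates by the automorphisms of `ℂ` with cyclotomic characters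
`1, 5, 7, 11, 17`, read at the embeddings with exponents `1, 5, 7, 11, 17`, are linearly independent (the `5 × 5` minor of
`([u·c ∈ S])` has determinant `-2`). [cite: Kubota1965, §2 (p. 115)] [cite: GreenGriffithsKerr2012, (V.A.7)–(V.A.8)] -/
private theorem five_le_cmTypeRank_of_residueSet_eq_I6_fortyEight (Φ : CMType K) (hΦ : residueSet 48 Φ = {1, 5, 11, 13, 17, 19, 25, 41}) :
    5 ≤ cmTypeRank Φ := by
  classical
  have hu : ∀ i : Fin 5, ((![1, 5, 7, 11, 17] : Fin 5 → ZMod 48) i).val.Coprime 48 := by decide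
  have hc : ∀ j : Fin 5, ((![1, 5, 7, 11, 17] : Fin 5 → ZMod 48) j).val.Coprime 48 := by decide
  choose τ hτ using fun i : Fin 5 => exists_autExp_eq 48 _ (hu i)
  choose σ hσ using fun j : Fin 5 => exists_expOf_eq 48 K _ (hc j)
  let f : Fin 5 → (K →+* ℂ) → ℚ := fun i => translateInd Φ.1 (τ i)
  have hval : ∀ i j : Fin 5, f i (σ j) =
      if (![1, 5, 7, 11, 17] : Fin 5 → ZMod 48) i * (![1, 5, 7, 11, 17] : Fin 5 → ZMod 48) j ∈
        ({1, 5, 11, 13, 17, 19, 25, 41} : Finset (ZMod 48)) then (1 : ℚ) else 0 := by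
    intro i j
    show translateInd Φ.1 (τ i) (σ j) = _
    rw [translateInd_eq_ite₈, hτ, hσ, hΦ]
  have hli : LinearIndependent ℚ f := by
    rw [Fintype.linearIndependent_iff]
    intro g hg
    have heval : ∀ j : Fin 5, ∑ i, g i * f i (σ j) = 0 := fun j => by
      have := congrFun hg (σ j)
      simpa only [Finset.sum_apply, Pi.smul_apply, smul_eq_mul, Pi.zero_apply] using this
    have e0 := heval 0
    have e1 := heval 1
    have e2 := heval 2
    have e3 := heval 3
    have e4 := heval 4
    simp (config := { decide := true }) [Fin.sum_univ_succ, hval] at e0 e1 e2 e3 e4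
    intro i
    fin_cases i <;> simp <;> linarith
  have h1 : Module.finrank ℚ (Submodule.span ℚ (Set.range f)) = 5 := by
    rw [finrank_span_eq_card hli, Fintype.card_fin]
  have h2 : Submodule.span ℚ (Set.range f) ≤
      Submodule.span ℚ (Set.range fun g : ℂ ≃+* ℂ => translateInd Φ.1 g) :=
    Submodule.span_mono (by rintro _ ⟨i, rfl⟩; exact ⟨τ i, rfl⟩)
  have h3 := Submodule.finrank_mono h2
  rw [h1] at h3
  exact h3

/-- **`Rank = 9 = n + 1` for the types whose residue set is one of the eight NOT coset-balanced representatives** (Kubota's bound `Rank ≤ n + 1`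
and the `9 × 9` certificates). [cite: Kubota1965, §2 (p. 115)] [cite: Gordon1999HodgeAVSurvey, §9.4.1] -/
theorem cmTypeRank_eq_nine_of_residueSet_mem_fortyEight (Φ : CMType K)
    (hΦ : residueSet 48 Φ ∈ ({{1, 5, 7, 11, 13, 17, 19, 25}, {1, 5, 7, 11, 13, 17, 23, 29}, {1, 5, 7, 11, 13, 19, 23, 31}, {1, 5, 7, 11, 13, 25, 29, 31}, {1, 5, 7, 11, 17, 19, 23, 35}, {1, 5, 7, 13, 17, 25, 29, 37}, {1, 5, 7, 13, 19, 25, 31, 37}, {1, 5, 7, 13, 23, 29, 31, 37}} : Finset (Finset (ZMod 48)))) :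
    cmTypeRank Φ = 9 := by
  haveI := isCMField₈ K
  refine le_antisymm ?_ ?_
  · have h := cmTypeRank_le Φ
    rw [finrank_eq_sixteen₈ K] at h
    exact h
  · simp only [Finset.mem_insert, Finset.mem_singleton] at hΦ
    rcases hΦ with h | h | h | h | h | h | h | h
    · exact nine_le_cmTypeRank_of_residueSet_eq_N1_fortyEight Φ h
    · exact nine_le_cmTypeRank_of_residueSet_eq_N2_fortyEight Φ h
    · exact nine_le_cmTypeRank_of_residueSet_eq_N3_fortyEight Φ h
    · exact nine_le_cmTypeRank_of_residueSet_eq_N4_fortyEight Φ h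
    · exact nine_le_cmTypeRank_of_residueSet_eq_N5_fortyEight Φ h
    · exact nine_le_cmTypeRank_of_residueSet_eq_N6_fortyEight Φ h
    · exact nine_le_cmTypeRank_of_residueSet_eq_N7_fortyEight Φ h
    · exact nine_le_cmTypeRank_of_residueSet_eq_N8_fortyEight Φ h

/-- **`Rank = 7` EXACTLY for the type with residue set `{1, 5, 7, 11, 13, 17, 25, 29}`** (`D1`): `≥ 7` by the certificate, `≤ 7` by Yanai's bound with
`W = {1, 19, 25, 43}` (`|W| · 2·2 = 16`: `Rank + 2 ≤ 9`). [cite: Gordon1999HodgeAVSurvey, 9.4.3 (Theorem [B.140])] -/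
theorem cmTypeRank_eq_of_residueSet_eq_D1_fortyEight (Φ : CMType K) (hΦ : residueSet 48 Φ = {1, 5, 7, 11, 13, 17, 25, 29}) : cmTypeRank Φ = 7 := by
  obtain ⟨⟨hu0, h10, hm0, hn0, hc0⟩, ⟨hu1, h11, hm1, hn1, hc1⟩, ⟨hu2, h12, hm2, hn2, hc2⟩, ⟨hu3, h13, hm3, hn3, hc3⟩, ⟨hu4, h14, hm4, hn4, hc4⟩, ⟨hu5, h15, hm5, hn5, hc5⟩, ⟨hu6, h16, hm6, hn6, hc6⟩, ⟨hu7, h17, hm7, hn7, hc7⟩, ⟨hu8, h18, hm8, hn8, hc8⟩, ⟨hu9, h19, hm9, hn9, hc9⟩⟩ := subgroups_fortyEight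
  obtain ⟨hb0, hb1, hb2, hb3, hb4, hb5, hb6, hb7, hb8, hb9, hb10, hb11⟩ := cosetBalanced_reps_fortyEight
  refine le_antisymm ?_ (seven_le_cmTypeRank_of_residueSet_eq_D1_fortyEight Φ hΦ)
  have h := cmTypeRank_add_le_of_cosetBalanced Φ hu6 h16 hm6 hn6 (by rw [hΦ]; exact hb2) (m := 2) (by rw [hc6]; decide +kernel)
  have h16 : Nat.totient 48 / 2 = 8 := by decide +kernel
  omega

/-- **`Rank = 7` EXACTLY for the type with residue set `{1, 5, 7, 11, 13, 23, 29, 31}`** (`D2`): `≥ 7` by the certificate, `≤ 7` by Yanai's bound with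
`W = {1, 13, 25, 37}` (`|W| · 2·2 = 16`: `Rank + 2 ≤ 9`). [cite: Gordon1999HodgeAVSurvey, 9.4.3 (Theorem [B.140])] -/
theorem cmTypeRank_eq_of_residueSet_eq_D2_fortyEight (Φ : CMType K) (hΦ : residueSet 48 Φ = {1, 5, 7, 11, 13, 23, 29, 31}) : cmTypeRank Φ = 7 := by
  obtain ⟨⟨hu0, h10, hm0, hn0, hc0⟩, ⟨hu1, h11, hm1, hn1, hc1⟩, ⟨hu2, h12, hm2, hn2, hc2⟩, ⟨hu3, h13, hm3, hn3, hc3⟩, ⟨hu4, h14, hm4, hn4, hc4⟩, ⟨hu5, h15, hm5, hn5, hc5⟩, ⟨hu6, h16, hm6, hn6, hc6⟩, ⟨hu7, h17, hm7, hn7, hc7⟩, ⟨hu8, h18, hm8, hn8, hc8⟩, ⟨hu9, h19, hm9, hn9, hc9⟩⟩ := subgroups_fortyEight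
  obtain ⟨hb0, hb1, hb2, hb3, hb4, hb5, hb6, hb7, hb8, hb9, hb10, hb11⟩ := cosetBalanced_reps_fortyEight
  refine le_antisymm ?_ (seven_le_cmTypeRank_of_residueSet_eq_D2_fortyEight Φ hΦ)
  have h := cmTypeRank_add_le_of_cosetBalanced Φ hu7 h17 hm7 hn7 (by rw [hΦ]; exact hb5) (m := 2) (by rw [hc7]; decide +kernel)
  have h16 : Nat.totient 48 / 2 = 8 := by decide +kernel
  omega

/-- **`Rank = 7` EXACTLY for the type with residue set `{1, 5, 7, 13, 17, 19, 25, 37}`** (`D3`): `≥ 7` by the certificate, `≤ 7` by Yanai's bound with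
`W = {1, 11, 25, 35}` (`|W| · 2·2 = 16`: `Rank + 2 ≤ 9`). [cite: Gordon1999HodgeAVSurvey, 9.4.3 (Theorem [B.140])] -/
theorem cmTypeRank_eq_of_residueSet_eq_D3_fortyEight (Φ : CMType K) (hΦ : residueSet 48 Φ = {1, 5, 7, 13, 17, 19, 25, 37}) : cmTypeRank Φ = 7 := by
  obtain ⟨⟨hu0, h10, hm0, hn0, hc0⟩, ⟨hu1, h11, hm1, hn1, hc1⟩, ⟨hu2, h12, hm2, hn2, hc2⟩, ⟨hu3, h13, hm3, hn3, hc3⟩, ⟨hu4, h14, hm4, hn4, hc4⟩, ⟨hu5, h15, hm5, hn5, hc5⟩, ⟨hu6, h16, hm6, hn6, hc6⟩, ⟨hu7, h17, hm7, hn7, hc7⟩, ⟨hu8, h18, hm8, hn8, hc8⟩, ⟨hu9, h19, hm9, hn9, hc9⟩⟩ := subgroups_fortyEight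
  obtain ⟨hb0, hb1, hb2, hb3, hb4, hb5, hb6, hb7, hb8, hb9, hb10, hb11⟩ := cosetBalanced_reps_fortyEight
  refine le_antisymm ?_ (seven_le_cmTypeRank_of_residueSet_eq_D3_fortyEight Φ hΦ)
  have h := cmTypeRank_add_le_of_cosetBalanced Φ hu8 h18 hm8 hn8 (by rw [hΦ]; exact hb8) (m := 2) (by rw [hc8]; decide +kernel)
  have h16 : Nat.totient 48 / 2 = 8 := by decide +kernel
  omega

/-- **`Rank = 7` EXACTLY for the type with residue set `{1, 5, 7, 13, 19, 23, 31, 37}`** (`D4`): `≥ 7` by the certificate, `≤ 7` by Yanai's bound with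
`W = {1, 5, 25, 29}` (`|W| · 2·2 = 16`: `Rank + 2 ≤ 9`). [cite: Gordon1999HodgeAVSurvey, 9.4.3 (Theorem [B.140])] -/
theorem cmTypeRank_eq_of_residueSet_eq_D4_fortyEight (Φ : CMType K) (hΦ : residueSet 48 Φ = {1, 5, 7, 13, 19, 23, 31, 37}) : cmTypeRank Φ = 7 := by
  obtain ⟨⟨hu0, h10, hm0, hn0, hc0⟩, ⟨hu1, h11, hm1, hn1, hc1⟩, ⟨hu2, h12, hm2, hn2, hc2⟩, ⟨hu3, h13, hm3, hn3, hc3⟩, ⟨hu4, h14, hm4, hn4, hc4⟩, ⟨hu5, h15, hm5, hn5, hc5⟩, ⟨hu6, h16, hm6, hn6, hc6⟩, ⟨hu7, h17, hm7, hn7, hc7⟩, ⟨hu8, h18, hm8, hn8, hc8⟩, ⟨hu9, h19, hm9, hn9, hc9⟩⟩ := subgroups_fortyEight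
  obtain ⟨hb0, hb1, hb2, hb3, hb4, hb5, hb6, hb7, hb8, hb9, hb10, hb11⟩ := cosetBalanced_reps_fortyEight
  refine le_antisymm ?_ (seven_le_cmTypeRank_of_residueSet_eq_D4_fortyEight Φ hΦ)
  have h := cmTypeRank_add_le_of_cosetBalanced Φ hu9 h19 hm9 hn9 (by rw [hΦ]; exact hb11) (m := 2) (by rw [hc9]; decide +kernel)
  have h16 : Nat.totient 48 / 2 = 8 := by decide +kernel
  omega

/-- **`Rank = 5` EXACTLY for the type with residue set `{1, 5, 7, 11, 13, 17, 19, 23}`** (`I1`, stabiliser `{1, 23}`: induced from a primitive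
NONDEGENERATE type of an octic CM subfield): `≥ 5` by the certificate, `≤ 5` by the induced-type bound.
[cite: Kubota1965, §2 (p. 115)] [cite: KoblitzRohrlich1978, §1 p. 1184] -/
theorem cmTypeRank_eq_of_residueSet_eq_I1_fortyEight (Φ : CMType K) (hΦ : residueSet 48 Φ = {1, 5, 7, 11, 13, 17, 19, 23}) : cmTypeRank Φ = 5 := by
  obtain ⟨⟨hs0, hi0⟩, ⟨hs1, hi1⟩, ⟨hs2, hi2⟩, ⟨hs3, hi3⟩, ⟨hs4, hi4⟩, ⟨hs5, hi5⟩, ⟨hs6, hi6⟩, ⟨hs7, hi7⟩, ⟨hs8, hi8⟩, ⟨hs9, hi9⟩, ⟨hs10, hi10⟩, ⟨hs11, hi11⟩⟩ := stabilizer_reps_fortyEight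
  refine le_antisymm ?_ (five_le_cmTypeRank_of_residueSet_eq_I1_fortyEight Φ hΦ)
  exact cmTypeRank_le_succ_of_card_stabilizer_mul_eq (N := 48) (by norm_num) Φ (k := 4) (by rw [hΦ, hs0]; decide +kernel)

/-- **`Rank = 5` EXACTLY for the type with residue set `{1, 5, 7, 11, 13, 19, 25, 31}`** (`I2`, stabiliser `{1, 31}`: induced from a primitive
NONDEGENERATE type of an octic CM subfield): `≥ 5` by the certificate, `≤ 5` by the induced-type bound.
[cite: Kubota1965, §2 (p. 115)] [cite: KoblitzRohrlich1978, §1 p. 1184] -/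
theorem cmTypeRank_eq_of_residueSet_eq_I2_fortyEight (Φ : CMType K) (hΦ : residueSet 48 Φ = {1, 5, 7, 11, 13, 19, 25, 31}) : cmTypeRank Φ = 5 := by
  obtain ⟨⟨hs0, hi0⟩, ⟨hs1, hi1⟩, ⟨hs2, hi2⟩, ⟨hs3, hi3⟩, ⟨hs4, hi4⟩, ⟨hs5, hi5⟩, ⟨hs6, hi6⟩, ⟨hs7, hi7⟩, ⟨hs8, hi8⟩, ⟨hs9, hi9⟩, ⟨hs10, hi10⟩, ⟨hs11, hi11⟩⟩ := stabilizer_reps_fortyEight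
  refine le_antisymm ?_ (five_le_cmTypeRank_of_residueSet_eq_I2_fortyEight Φ hΦ)
  exact cmTypeRank_le_succ_of_card_stabilizer_mul_eq (N := 48) (by norm_num) Φ (k := 4) (by rw [hΦ, hs1]; decide +kernel)

/-- **`Rank = 5` EXACTLY for the type with residue set `{1, 5, 7, 11, 17, 23, 29, 35}`** (`I3`, stabiliser `{1, 7}`: induced from a primitive
NONDEGENERATE type of an octic CM subfield): `≥ 5` by the certificate, `≤ 5` by the induced-type bound.
[cite: Kubota1965, §2 (p. 115)] [cite: KoblitzRohrlich1978, §1 p. 1184] -/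
theorem cmTypeRank_eq_of_residueSet_eq_I3_fortyEight (Φ : CMType K) (hΦ : residueSet 48 Φ = {1, 5, 7, 11, 17, 23, 29, 35}) : cmTypeRank Φ = 5 := by
  obtain ⟨⟨hs0, hi0⟩, ⟨hs1, hi1⟩, ⟨hs2, hi2⟩, ⟨hs3, hi3⟩, ⟨hs4, hi4⟩, ⟨hs5, hi5⟩, ⟨hs6, hi6⟩, ⟨hs7, hi7⟩, ⟨hs8, hi8⟩, ⟨hs9, hi9⟩, ⟨hs10, hi10⟩, ⟨hs11, hi11⟩⟩ := stabilizer_reps_fortyEight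
  refine le_antisymm ?_ (five_le_cmTypeRank_of_residueSet_eq_I3_fortyEight Φ hΦ)
  exact cmTypeRank_le_succ_of_card_stabilizer_mul_eq (N := 48) (by norm_num) Φ (k := 4) (by rw [hΦ, hs2]; decide +kernel)

/-- **`Rank = 5` EXACTLY for the type with residue set `{1, 5, 7, 13, 17, 23, 29, 37}`** (`I4`, stabiliser `{1, 17}`: induced from a primitive
NONDEGENERATE type of an octic CM subfield): `≥ 5` by the certificate, `≤ 5` by the induced-type bound.
[cite: Kubota1965, §2 (p. 115)] [cite: KoblitzRohrlich1978, §1 p. 1184] -/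
theorem cmTypeRank_eq_of_residueSet_eq_I4_fortyEight (Φ : CMType K) (hΦ : residueSet 48 Φ = {1, 5, 7, 13, 17, 23, 29, 37}) : cmTypeRank Φ = 5 := by
  obtain ⟨⟨hs0, hi0⟩, ⟨hs1, hi1⟩, ⟨hs2, hi2⟩, ⟨hs3, hi3⟩, ⟨hs4, hi4⟩, ⟨hs5, hi5⟩, ⟨hs6, hi6⟩, ⟨hs7, hi7⟩, ⟨hs8, hi8⟩, ⟨hs9, hi9⟩, ⟨hs10, hi10⟩, ⟨hs11, hi11⟩⟩ := stabilizer_reps_fortyEight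
  refine le_antisymm ?_ (five_le_cmTypeRank_of_residueSet_eq_I4_fortyEight Φ hΦ)
  exact cmTypeRank_le_succ_of_card_stabilizer_mul_eq (N := 48) (by norm_num) Φ (k := 4) (by rw [hΦ, hs3]; decide +kernel)

/-- **`Rank = 5` EXACTLY for the type with residue set `{1, 5, 7, 13, 25, 29, 31, 37}`** (`I5`, stabiliser `{1, 25}`: induced from a primitive
NONDEGENERATE type of an octic CM subfield): `≥ 5` by the certificate, `≤ 5` by the induced-type bound.
[cite: Kubota1965, §2 (p. 115)] [cite: KoblitzRohrlich1978, §1 p. 1184] -/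
theorem cmTypeRank_eq_of_residueSet_eq_I5_fortyEight (Φ : CMType K) (hΦ : residueSet 48 Φ = {1, 5, 7, 13, 25, 29, 31, 37}) : cmTypeRank Φ = 5 := by
  obtain ⟨⟨hs0, hi0⟩, ⟨hs1, hi1⟩, ⟨hs2, hi2⟩, ⟨hs3, hi3⟩, ⟨hs4, hi4⟩, ⟨hs5, hi5⟩, ⟨hs6, hi6⟩, ⟨hs7, hi7⟩, ⟨hs8, hi8⟩, ⟨hs9, hi9⟩, ⟨hs10, hi10⟩, ⟨hs11, hi11⟩⟩ := stabilizer_reps_fortyEight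
  refine le_antisymm ?_ (five_le_cmTypeRank_of_residueSet_eq_I5_fortyEight Φ hΦ)
  exact cmTypeRank_le_succ_of_card_stabilizer_mul_eq (N := 48) (by norm_num) Φ (k := 4) (by rw [hΦ, hs4]; decide +kernel)

/-- **`Rank = 5` EXACTLY for the type with residue set `{1, 5, 11, 13, 17, 19, 25, 41}`** (`I6`, stabiliser `{1, 41}`: induced from a primitive
NONDEGENERATE type of an octic CM subfield): `≥ 5` by the certificate, `≤ 5` by the induced-type bound.
[cite: Kubota1965, §2 (p. 115)] [cite: KoblitzRohrlich1978, §1 p. 1184] -/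
theorem cmTypeRank_eq_of_residueSet_eq_I6_fortyEight (Φ : CMType K) (hΦ : residueSet 48 Φ = {1, 5, 11, 13, 17, 19, 25, 41}) : cmTypeRank Φ = 5 := by
  obtain ⟨⟨hs0, hi0⟩, ⟨hs1, hi1⟩, ⟨hs2, hi2⟩, ⟨hs3, hi3⟩, ⟨hs4, hi4⟩, ⟨hs5, hi5⟩, ⟨hs6, hi6⟩, ⟨hs7, hi7⟩, ⟨hs8, hi8⟩, ⟨hs9, hi9⟩, ⟨hs10, hi10⟩, ⟨hs11, hi11⟩⟩ := stabilizer_reps_fortyEight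
  refine le_antisymm ?_ (five_le_cmTypeRank_of_residueSet_eq_I6_fortyEight Φ hΦ)
  exact cmTypeRank_le_succ_of_card_stabilizer_mul_eq (N := 48) (by norm_num) Φ (k := 4) (by rw [hΦ, hs5]; decide +kernel)

/-- **`Rank = 3` for the types of `ℚ(ζ₄₈)` with residue stabiliser of order `4`** (induced from a quartic CM subfield, `[K₁ : ℚ] = 2·2`).
[cite: Kubota1965, §2 (p. 115)] [cite: KoblitzRohrlich1978, §1 p. 1184] -/
theorem cmTypeRank_eq_three_of_card_stabilizer_eq_four_fortyEight (Φ : CMType K) (hW : ((unitResidues 48).filter fun t => ∀ c ∈ unitResidues 48, (c * t ∈ residueSet 48 Φ ↔ c ∈ residueSet 48 Φ)).card = 4) :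
    cmTypeRank Φ = 3 :=
  cmTypeRank_eq_succ_of_card_stabilizer_mul_eq (N := 48) (by norm_num) Nat.prime_two Φ (by rw [hW]; decide +kernel)

/-- **`Rank = 2` for the types of `ℚ(ζ₄₈)` with residue stabiliser of order `8`** (induced from an imaginary quadratic subfield).
[cite: Kubota1965, §2 (p. 115)] -/
theorem cmTypeRank_eq_two_of_card_stabilizer_eq_eight_fortyEight (Φ : CMType K) (hW : ((unitResidues 48).filter fun t => ∀ c ∈ unitResidues 48, (c * t ∈ residueSet 48 Φ ↔ c ∈ residueSet 48 Φ)).card = 8) :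
    cmTypeRank Φ = 2 :=
  cmTypeRank_eq_two_of_two_mul_card_filter_eq (N := 48) (by norm_num) Φ (by rw [hW]; decide +kernel)

/-- **`Rank ≤ 5` for the types of `ℚ(ζ₄₈)` with residue stabiliser of order `2`** (induced from an octic CM subfield).
[cite: Kubota1965, §2 (p. 115)] [cite: KoblitzRohrlich1978, §1 p. 1184] -/
theorem cmTypeRank_le_five_of_card_stabilizer_eq_two_fortyEight (Φ : CMType K) (hW : ((unitResidues 48).filter fun t => ∀ c ∈ unitResidues 48, (c * t ∈ residueSet 48 Φ ↔ c ∈ residueSet 48 Φ)).card = 2) :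
    cmTypeRank Φ ≤ 5 :=
  cmTypeRank_le_succ_of_card_stabilizer_mul_eq (N := 48) (by norm_num) Φ (k := 4) (by rw [hW]; decide +kernel)

/-- **`Rank = 9` FOR EVERY TYPE OF `ℚ(ζ₄₈)` NOT COSET-BALANCED for any maximal `(−1)`-free subgroup** (it is the transform of one of the eight
representatives, and the rank is an invariant of the family). [cite: Gordon1999HodgeAVSurvey, §9.4.1] [cite: Shimura1998, §8.4 Example (1)] -/
theorem cmTypeRank_eq_nine_of_not_cosetBalanced_fortyEight (Φ : CMType K)
    (h : ¬((∀ c ∈ unitResidues 48, ((({1, 7, 17, 23} : Finset (ZMod 48))).filter fun w => c * w ∈ residueSet 48 Φ).card = ((({1, 7, 17, 23} : Finset (ZMod 48))).filter fun w => c * w ∉ residueSet 48 Φ).card) ∨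
      (∀ c ∈ unitResidues 48, ((({1, 23, 31, 41} : Finset (ZMod 48))).filter fun w => c * w ∈ residueSet 48 Φ).card = ((({1, 23, 31, 41} : Finset (ZMod 48))).filter fun w => c * w ∉ residueSet 48 Φ).card) ∨
      (∀ c ∈ unitResidues 48, ((({1, 5, 7, 11, 25, 29, 31, 35} : Finset (ZMod 48))).filter fun w => c * w ∈ residueSet 48 Φ).card = ((({1, 5, 7, 11, 25, 29, 31, 35} : Finset (ZMod 48))).filter fun w => c * w ∉ residueSet 48 Φ).card) ∨
      (∀ c ∈ unitResidues 48, ((({1, 5, 13, 17, 25, 29, 37, 41} : Finset (ZMod 48))).filter fun w => c * w ∈ residueSet 48 Φ).card = ((({1, 5, 13, 17, 25, 29, 37, 41} : Finset (ZMod 48))).filter fun w => c * w ∉ residueSet 48 Φ).card) ∨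
      (∀ c ∈ unitResidues 48, ((({1, 7, 13, 19, 25, 31, 37, 43} : Finset (ZMod 48))).filter fun w => c * w ∈ residueSet 48 Φ).card = ((({1, 7, 13, 19, 25, 31, 37, 43} : Finset (ZMod 48))).filter fun w => c * w ∉ residueSet 48 Φ).card) ∨
      (∀ c ∈ unitResidues 48, ((({1, 11, 17, 19, 25, 35, 41, 43} : Finset (ZMod 48))).filter fun w => c * w ∈ residueSet 48 Φ).card = ((({1, 11, 17, 19, 25, 35, 41, 43} : Finset (ZMod 48))).filter fun w => c * w ∉ residueSet 48 Φ).card))) :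
    cmTypeRank Φ = 9 := by
  obtain ⟨φ₀⟩ : Nonempty (K →+* ℂ) := inferInstance
  obtain ⟨Ψ, hΨ, hT⟩ := (exists_isAutTransform_fortyEight Φ φ₀).1 h
  rw [cmTypeRank_eq_of_isAutTransform hT]
  exact cmTypeRank_eq_nine_of_residueSet_mem_fortyEight Ψ hΨ

/-- **`Rank ≤ 8` for every type COSET-BALANCED for some maximal `(−1)`-free subgroup** (Yanai: degenerate).
[cite: Gordon1999HodgeAVSurvey, 9.4.3 (Theorem [B.140])] -/
theorem cmTypeRank_le_eight_of_cosetBalanced_fortyEight (Φ : CMType K)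
    (h : ((∀ c ∈ unitResidues 48, ((({1, 7, 17, 23} : Finset (ZMod 48))).filter fun w => c * w ∈ residueSet 48 Φ).card = ((({1, 7, 17, 23} : Finset (ZMod 48))).filter fun w => c * w ∉ residueSet 48 Φ).card) ∨
      (∀ c ∈ unitResidues 48, ((({1, 23, 31, 41} : Finset (ZMod 48))).filter fun w => c * w ∈ residueSet 48 Φ).card = ((({1, 23, 31, 41} : Finset (ZMod 48))).filter fun w => c * w ∉ residueSet 48 Φ).card) ∨
      (∀ c ∈ unitResidues 48, ((({1, 5, 7, 11, 25, 29, 31, 35} : Finset (ZMod 48))).filter fun w => c * w ∈ residueSet 48 Φ).card = ((({1, 5, 7, 11, 25, 29, 31, 35} : Finset (ZMod 48))).filter fun w => c * w ∉ residueSet 48 Φ).card) ∨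
      (∀ c ∈ unitResidues 48, ((({1, 5, 13, 17, 25, 29, 37, 41} : Finset (ZMod 48))).filter fun w => c * w ∈ residueSet 48 Φ).card = ((({1, 5, 13, 17, 25, 29, 37, 41} : Finset (ZMod 48))).filter fun w => c * w ∉ residueSet 48 Φ).card) ∨
      (∀ c ∈ unitResidues 48, ((({1, 7, 13, 19, 25, 31, 37, 43} : Finset (ZMod 48))).filter fun w => c * w ∈ residueSet 48 Φ).card = ((({1, 7, 13, 19, 25, 31, 37, 43} : Finset (ZMod 48))).filter fun w => c * w ∉ residueSet 48 Φ).card) ∨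
      (∀ c ∈ unitResidues 48, ((({1, 11, 17, 19, 25, 35, 41, 43} : Finset (ZMod 48))).filter fun w => c * w ∈ residueSet 48 Φ).card = ((({1, 11, 17, 19, 25, 35, 41, 43} : Finset (ZMod 48))).filter fun w => c * w ∉ residueSet 48 Φ).card))) :
    cmTypeRank Φ ≤ 8 := by
  obtain ⟨⟨hu0, h10, hm0, hn0, hc0⟩, ⟨hu1, h11, hm1, hn1, hc1⟩, ⟨hu2, h12, hm2, hn2, hc2⟩, ⟨hu3, h13, hm3, hn3, hc3⟩, ⟨hu4, h14, hm4, hn4, hc4⟩, ⟨hu5, h15, hm5, hn5, hc5⟩, ⟨hu6, h16, hm6, hn6, hc6⟩, ⟨hu7, h17, hm7, hn7, hc7⟩, ⟨hu8, h18, hm8, hn8, hc8⟩, ⟨hu9, h19, hm9, hn9, hc9⟩⟩ := subgroups_fortyEight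
  rw [show (8 : ℕ) = Nat.totient 48 / 2 by decide +kernel]
  rcases h with h | h | h | h | h | h
  · exact cmTypeRank_le_of_cosetBalanced Φ hu0 h10 hm0 hn0 h
  · exact cmTypeRank_le_of_cosetBalanced Φ hu1 h11 hm1 hn1 h
  · exact cmTypeRank_le_of_cosetBalanced Φ hu2 h12 hm2 hn2 h
  · exact cmTypeRank_le_of_cosetBalanced Φ hu3 h13 hm3 hn3 h
  · exact cmTypeRank_le_of_cosetBalanced Φ hu4 h14 hm4 hn4 h
  · exact cmTypeRank_le_of_cosetBalanced Φ hu5 h15 hm5 hn5 h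

omit [IsCyclotomicExtension {48} ℚ K] in
/-- **NONDEGENERATE ⟺ NOT COSET-BALANCED for any maximal `(−1)`-free subgroup, for the CM types of `ℚ(ζ₄₈)`** — the residue form of
«nondegenerate ⟺ equidistributed over no odd character» for this abelian field of `2`-power degree. [cite: Gordon1999HodgeAVSurvey, §9.4.1 and 9.4.3]
[cite: Kubota1965, §4 Lemma 2] -/
theorem isNondegenerate_iff_not_cosetBalanced_fortyEight (hK : IsCyclotomicExtension {48} ℚ K) (Φ : CMType K) :
    IsNondegenerate Φ ↔ ¬((∀ c ∈ unitResidues 48, ((({1, 7, 17, 23} : Finset (ZMod 48))).filter fun w => c * w ∈ residueSet 48 Φ).card = ((({1, 7, 17, 23} : Finset (ZMod 48))).filter fun w => c * w ∉ residueSet 48 Φ).card) ∨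
      (∀ c ∈ unitResidues 48, ((({1, 23, 31, 41} : Finset (ZMod 48))).filter fun w => c * w ∈ residueSet 48 Φ).card = ((({1, 23, 31, 41} : Finset (ZMod 48))).filter fun w => c * w ∉ residueSet 48 Φ).card) ∨
      (∀ c ∈ unitResidues 48, ((({1, 5, 7, 11, 25, 29, 31, 35} : Finset (ZMod 48))).filter fun w => c * w ∈ residueSet 48 Φ).card = ((({1, 5, 7, 11, 25, 29, 31, 35} : Finset (ZMod 48))).filter fun w => c * w ∉ residueSet 48 Φ).card) ∨
      (∀ c ∈ unitResidues 48, ((({1, 5, 13, 17, 25, 29, 37, 41} : Finset (ZMod 48))).filter fun w => c * w ∈ residueSet 48 Φ).card = ((({1, 5, 13, 17, 25, 29, 37, 41} : Finset (ZMod 48))).filter fun w => c * w ∉ residueSet 48 Φ).card) ∨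
      (∀ c ∈ unitResidues 48, ((({1, 7, 13, 19, 25, 31, 37, 43} : Finset (ZMod 48))).filter fun w => c * w ∈ residueSet 48 Φ).card = ((({1, 7, 13, 19, 25, 31, 37, 43} : Finset (ZMod 48))).filter fun w => c * w ∉ residueSet 48 Φ).card) ∨
      (∀ c ∈ unitResidues 48, ((({1, 11, 17, 19, 25, 35, 41, 43} : Finset (ZMod 48))).filter fun w => c * w ∈ residueSet 48 Φ).card = ((({1, 11, 17, 19, 25, 35, 41, 43} : Finset (ZMod 48))).filter fun w => c * w ∉ residueSet 48 Φ).card)) := by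
  haveI := isCMField₈ K
  rw [isNondegenerate_iff, finrank_eq_sixteen₈ K]
  constructor
  · intro h9 hb
    have h8 := cmTypeRank_le_eight_of_cosetBalanced_fortyEight Φ hb
    omega
  · intro h
    exact cmTypeRank_eq_nine_of_not_cosetBalanced_fortyEight Φ h

omit [IsCyclotomicExtension {48} ℚ K] in
/-- **Exactly `128` of the `256` CM types of `ℚ(ζ₄₈)` are nondegenerate** (eight free families of `16`). [cite: Gordon1999HodgeAVSurvey, §9.4.1]
[cite: Shimura1998, §8.4 Example (1)] -/
theorem ncard_isNondegenerate_fortyEight (hK : IsCyclotomicExtension {48} ℚ K) : {Φ : CMType K | IsNondegenerate Φ}.ncard = 128 := by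
  obtain ⟨φ₀⟩ : Nonempty (K →+* ℂ) := inferInstance
  have h := (ncard_not_cosetBalanced_fortyEight hK φ₀).1
  rw [← h]
  congr 1
  ext Φ
  exact isNondegenerate_iff_not_cosetBalanced_fortyEight hK Φ

/-- The maximal `(−1)`-free subgroups over which the degenerate primitive representatives are NOT balanced (the complement of the census's
`cosetBalanced_reps_fortyEight` within the maximal subgroups). [cite: Gordon1999HodgeAVSurvey, §9.4.1] -/
private theorem not_cosetBalanced_deg_reps_fortyEight :
    ¬(∀ c ∈ unitResidues 48, ((({1, 7, 17, 23} : Finset (ZMod 48))).filter fun w => c * w ∈ ({1, 5, 7, 11, 13, 17, 25, 29} : Finset (ZMod 48))).card = ((({1, 7, 17, 23} : Finset (ZMod 48))).filter fun w => c * w ∉ ({1, 5, 7, 11, 13, 17, 25, 29} : Finset (ZMod 48))).card) ∧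
    ¬(∀ c ∈ unitResidues 48, ((({1, 23, 31, 41} : Finset (ZMod 48))).filter fun w => c * w ∈ ({1, 5, 7, 11, 13, 17, 25, 29} : Finset (ZMod 48))).card = ((({1, 23, 31, 41} : Finset (ZMod 48))).filter fun w => c * w ∉ ({1, 5, 7, 11, 13, 17, 25, 29} : Finset (ZMod 48))).card) ∧
    ¬(∀ c ∈ unitResidues 48, ((({1, 5, 7, 11, 25, 29, 31, 35} : Finset (ZMod 48))).filter fun w => c * w ∈ ({1, 5, 7, 11, 13, 17, 25, 29} : Finset (ZMod 48))).card = ((({1, 5, 7, 11, 25, 29, 31, 35} : Finset (ZMod 48))).filter fun w => c * w ∉ ({1, 5, 7, 11, 13, 17, 25, 29} : Finset (ZMod 48))).card) ∧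
    ¬(∀ c ∈ unitResidues 48, ((({1, 5, 13, 17, 25, 29, 37, 41} : Finset (ZMod 48))).filter fun w => c * w ∈ ({1, 5, 7, 11, 13, 17, 25, 29} : Finset (ZMod 48))).card = ((({1, 5, 13, 17, 25, 29, 37, 41} : Finset (ZMod 48))).filter fun w => c * w ∉ ({1, 5, 7, 11, 13, 17, 25, 29} : Finset (ZMod 48))).card) ∧
    ¬(∀ c ∈ unitResidues 48, ((({1, 7, 17, 23} : Finset (ZMod 48))).filter fun w => c * w ∈ ({1, 5, 7, 11, 13, 23, 29, 31} : Finset (ZMod 48))).card = ((({1, 7, 17, 23} : Finset (ZMod 48))).filter fun w => c * w ∉ ({1, 5, 7, 11, 13, 23, 29, 31} : Finset (ZMod 48))).card) ∧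
    ¬(∀ c ∈ unitResidues 48, ((({1, 23, 31, 41} : Finset (ZMod 48))).filter fun w => c * w ∈ ({1, 5, 7, 11, 13, 23, 29, 31} : Finset (ZMod 48))).card = ((({1, 23, 31, 41} : Finset (ZMod 48))).filter fun w => c * w ∉ ({1, 5, 7, 11, 13, 23, 29, 31} : Finset (ZMod 48))).card) ∧
    ¬(∀ c ∈ unitResidues 48, ((({1, 5, 7, 11, 25, 29, 31, 35} : Finset (ZMod 48))).filter fun w => c * w ∈ ({1, 5, 7, 11, 13, 23, 29, 31} : Finset (ZMod 48))).card = ((({1, 5, 7, 11, 25, 29, 31, 35} : Finset (ZMod 48))).filter fun w => c * w ∉ ({1, 5, 7, 11, 13, 23, 29, 31} : Finset (ZMod 48))).card) ∧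
    ¬(∀ c ∈ unitResidues 48, ((({1, 11, 17, 19, 25, 35, 41, 43} : Finset (ZMod 48))).filter fun w => c * w ∈ ({1, 5, 7, 11, 13, 23, 29, 31} : Finset (ZMod 48))).card = ((({1, 11, 17, 19, 25, 35, 41, 43} : Finset (ZMod 48))).filter fun w => c * w ∉ ({1, 5, 7, 11, 13, 23, 29, 31} : Finset (ZMod 48))).card) ∧
    ¬(∀ c ∈ unitResidues 48, ((({1, 7, 17, 23} : Finset (ZMod 48))).filter fun w => c * w ∈ ({1, 5, 7, 13, 17, 19, 25, 37} : Finset (ZMod 48))).card = ((({1, 7, 17, 23} : Finset (ZMod 48))).filter fun w => c * w ∉ ({1, 5, 7, 13, 17, 19, 25, 37} : Finset (ZMod 48))).card) ∧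
    ¬(∀ c ∈ unitResidues 48, ((({1, 23, 31, 41} : Finset (ZMod 48))).filter fun w => c * w ∈ ({1, 5, 7, 13, 17, 19, 25, 37} : Finset (ZMod 48))).card = ((({1, 23, 31, 41} : Finset (ZMod 48))).filter fun w => c * w ∉ ({1, 5, 7, 13, 17, 19, 25, 37} : Finset (ZMod 48))).card) ∧
    ¬(∀ c ∈ unitResidues 48, ((({1, 5, 13, 17, 25, 29, 37, 41} : Finset (ZMod 48))).filter fun w => c * w ∈ ({1, 5, 7, 13, 17, 19, 25, 37} : Finset (ZMod 48))).card = ((({1, 5, 13, 17, 25, 29, 37, 41} : Finset (ZMod 48))).filter fun w => c * w ∉ ({1, 5, 7, 13, 17, 19, 25, 37} : Finset (ZMod 48))).card) ∧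
    ¬(∀ c ∈ unitResidues 48, ((({1, 7, 13, 19, 25, 31, 37, 43} : Finset (ZMod 48))).filter fun w => c * w ∈ ({1, 5, 7, 13, 17, 19, 25, 37} : Finset (ZMod 48))).card = ((({1, 7, 13, 19, 25, 31, 37, 43} : Finset (ZMod 48))).filter fun w => c * w ∉ ({1, 5, 7, 13, 17, 19, 25, 37} : Finset (ZMod 48))).card) ∧
    ¬(∀ c ∈ unitResidues 48, ((({1, 7, 17, 23} : Finset (ZMod 48))).filter fun w => c * w ∈ ({1, 5, 7, 13, 19, 23, 31, 37} : Finset (ZMod 48))).card = ((({1, 7, 17, 23} : Finset (ZMod 48))).filter fun w => c * w ∉ ({1, 5, 7, 13, 19, 23, 31, 37} : Finset (ZMod 48))).card) ∧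
    ¬(∀ c ∈ unitResidues 48, ((({1, 23, 31, 41} : Finset (ZMod 48))).filter fun w => c * w ∈ ({1, 5, 7, 13, 19, 23, 31, 37} : Finset (ZMod 48))).card = ((({1, 23, 31, 41} : Finset (ZMod 48))).filter fun w => c * w ∉ ({1, 5, 7, 13, 19, 23, 31, 37} : Finset (ZMod 48))).card) ∧
    ¬(∀ c ∈ unitResidues 48, ((({1, 7, 13, 19, 25, 31, 37, 43} : Finset (ZMod 48))).filter fun w => c * w ∈ ({1, 5, 7, 13, 19, 23, 31, 37} : Finset (ZMod 48))).card = ((({1, 7, 13, 19, 25, 31, 37, 43} : Finset (ZMod 48))).filter fun w => c * w ∉ ({1, 5, 7, 13, 19, 23, 31, 37} : Finset (ZMod 48))).card) ∧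
    ¬(∀ c ∈ unitResidues 48, ((({1, 11, 17, 19, 25, 35, 41, 43} : Finset (ZMod 48))).filter fun w => c * w ∈ ({1, 5, 7, 13, 19, 23, 31, 37} : Finset (ZMod 48))).card = ((({1, 11, 17, 19, 25, 35, 41, 43} : Finset (ZMod 48))).filter fun w => c * w ∉ ({1, 5, 7, 13, 19, 23, 31, 37} : Finset (ZMod 48))).card) := by
  refine ⟨?_, ?_, ?_, ?_, ?_, ?_, ?_, ?_, ?_, ?_, ?_, ?_, ?_, ?_, ?_, ?_⟩ <;> decide +kernel

/-- **THE RANKS OF THE PRIMITIVE COSET-BALANCED TYPES OF `ℚ(ζ₄₈)`, by their balance profile over the maximal `(−1)`-free subgroups** (each is the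
transform of one of the 4 representatives; balance and rank are invariants of the family). [cite: Gordon1999HodgeAVSurvey, §9.4.2 and 9.4.3]
[cite: Shimura1998, §8.4 Example (1)] -/
theorem cmTypeRank_of_isPrimitive_of_cosetBalanced_fortyEight (Φ : CMType K) (φ₀ : K →+* ℂ) (hp : IsPrimitive (ℂ ≃+* ℂ) Φ.1 φ₀)
    (hb : ((∀ c ∈ unitResidues 48, ((({1, 7, 17, 23} : Finset (ZMod 48))).filter fun w => c * w ∈ residueSet 48 Φ).card = ((({1, 7, 17, 23} : Finset (ZMod 48))).filter fun w => c * w ∉ residueSet 48 Φ).card) ∨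
      (∀ c ∈ unitResidues 48, ((({1, 23, 31, 41} : Finset (ZMod 48))).filter fun w => c * w ∈ residueSet 48 Φ).card = ((({1, 23, 31, 41} : Finset (ZMod 48))).filter fun w => c * w ∉ residueSet 48 Φ).card) ∨
      (∀ c ∈ unitResidues 48, ((({1, 5, 7, 11, 25, 29, 31, 35} : Finset (ZMod 48))).filter fun w => c * w ∈ residueSet 48 Φ).card = ((({1, 5, 7, 11, 25, 29, 31, 35} : Finset (ZMod 48))).filter fun w => c * w ∉ residueSet 48 Φ).card) ∨
      (∀ c ∈ unitResidues 48, ((({1, 5, 13, 17, 25, 29, 37, 41} : Finset (ZMod 48))).filter fun w => c * w ∈ residueSet 48 Φ).card = ((({1, 5, 13, 17, 25, 29, 37, 41} : Finset (ZMod 48))).filter fun w => c * w ∉ residueSet 48 Φ).card) ∨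
      (∀ c ∈ unitResidues 48, ((({1, 7, 13, 19, 25, 31, 37, 43} : Finset (ZMod 48))).filter fun w => c * w ∈ residueSet 48 Φ).card = ((({1, 7, 13, 19, 25, 31, 37, 43} : Finset (ZMod 48))).filter fun w => c * w ∉ residueSet 48 Φ).card) ∨
      (∀ c ∈ unitResidues 48, ((({1, 11, 17, 19, 25, 35, 41, 43} : Finset (ZMod 48))).filter fun w => c * w ∈ residueSet 48 Φ).card = ((({1, 11, 17, 19, 25, 35, 41, 43} : Finset (ZMod 48))).filter fun w => c * w ∉ residueSet 48 Φ).card))) :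
    ((¬(∀ c ∈ unitResidues 48, ((({1, 7, 17, 23} : Finset (ZMod 48))).filter fun w => c * w ∈ residueSet 48 Φ).card = ((({1, 7, 17, 23} : Finset (ZMod 48))).filter fun w => c * w ∉ residueSet 48 Φ).card) ∧
        ¬(∀ c ∈ unitResidues 48, ((({1, 23, 31, 41} : Finset (ZMod 48))).filter fun w => c * w ∈ residueSet 48 Φ).card = ((({1, 23, 31, 41} : Finset (ZMod 48))).filter fun w => c * w ∉ residueSet 48 Φ).card) ∧
        ¬(∀ c ∈ unitResidues 48, ((({1, 5, 7, 11, 25, 29, 31, 35} : Finset (ZMod 48))).filter fun w => c * w ∈ residueSet 48 Φ).card = ((({1, 5, 7, 11, 25, 29, 31, 35} : Finset (ZMod 48))).filter fun w => c * w ∉ residueSet 48 Φ).card) ∧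
        ¬(∀ c ∈ unitResidues 48, ((({1, 5, 13, 17, 25, 29, 37, 41} : Finset (ZMod 48))).filter fun w => c * w ∈ residueSet 48 Φ).card = ((({1, 5, 13, 17, 25, 29, 37, 41} : Finset (ZMod 48))).filter fun w => c * w ∉ residueSet 48 Φ).card) ∧
        (∀ c ∈ unitResidues 48, ((({1, 7, 13, 19, 25, 31, 37, 43} : Finset (ZMod 48))).filter fun w => c * w ∈ residueSet 48 Φ).card = ((({1, 7, 13, 19, 25, 31, 37, 43} : Finset (ZMod 48))).filter fun w => c * w ∉ residueSet 48 Φ).card) ∧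
        (∀ c ∈ unitResidues 48, ((({1, 11, 17, 19, 25, 35, 41, 43} : Finset (ZMod 48))).filter fun w => c * w ∈ residueSet 48 Φ).card = ((({1, 11, 17, 19, 25, 35, 41, 43} : Finset (ZMod 48))).filter fun w => c * w ∉ residueSet 48 Φ).card)) ∧ cmTypeRank Φ = 7) ∨
    ((¬(∀ c ∈ unitResidues 48, ((({1, 7, 17, 23} : Finset (ZMod 48))).filter fun w => c * w ∈ residueSet 48 Φ).card = ((({1, 7, 17, 23} : Finset (ZMod 48))).filter fun w => c * w ∉ residueSet 48 Φ).card) ∧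
        ¬(∀ c ∈ unitResidues 48, ((({1, 23, 31, 41} : Finset (ZMod 48))).filter fun w => c * w ∈ residueSet 48 Φ).card = ((({1, 23, 31, 41} : Finset (ZMod 48))).filter fun w => c * w ∉ residueSet 48 Φ).card) ∧
        ¬(∀ c ∈ unitResidues 48, ((({1, 5, 7, 11, 25, 29, 31, 35} : Finset (ZMod 48))).filter fun w => c * w ∈ residueSet 48 Φ).card = ((({1, 5, 7, 11, 25, 29, 31, 35} : Finset (ZMod 48))).filter fun w => c * w ∉ residueSet 48 Φ).card) ∧
        (∀ c ∈ unitResidues 48, ((({1, 5, 13, 17, 25, 29, 37, 41} : Finset (ZMod 48))).filter fun w => c * w ∈ residueSet 48 Φ).card = ((({1, 5, 13, 17, 25, 29, 37, 41} : Finset (ZMod 48))).filter fun w => c * w ∉ residueSet 48 Φ).card) ∧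
        (∀ c ∈ unitResidues 48, ((({1, 7, 13, 19, 25, 31, 37, 43} : Finset (ZMod 48))).filter fun w => c * w ∈ residueSet 48 Φ).card = ((({1, 7, 13, 19, 25, 31, 37, 43} : Finset (ZMod 48))).filter fun w => c * w ∉ residueSet 48 Φ).card) ∧
        ¬(∀ c ∈ unitResidues 48, ((({1, 11, 17, 19, 25, 35, 41, 43} : Finset (ZMod 48))).filter fun w => c * w ∈ residueSet 48 Φ).card = ((({1, 11, 17, 19, 25, 35, 41, 43} : Finset (ZMod 48))).filter fun w => c * w ∉ residueSet 48 Φ).card)) ∧ cmTypeRank Φ = 7) ∨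
    ((¬(∀ c ∈ unitResidues 48, ((({1, 7, 17, 23} : Finset (ZMod 48))).filter fun w => c * w ∈ residueSet 48 Φ).card = ((({1, 7, 17, 23} : Finset (ZMod 48))).filter fun w => c * w ∉ residueSet 48 Φ).card) ∧
        ¬(∀ c ∈ unitResidues 48, ((({1, 23, 31, 41} : Finset (ZMod 48))).filter fun w => c * w ∈ residueSet 48 Φ).card = ((({1, 23, 31, 41} : Finset (ZMod 48))).filter fun w => c * w ∉ residueSet 48 Φ).card) ∧
        (∀ c ∈ unitResidues 48, ((({1, 5, 7, 11, 25, 29, 31, 35} : Finset (ZMod 48))).filter fun w => c * w ∈ residueSet 48 Φ).card = ((({1, 5, 7, 11, 25, 29, 31, 35} : Finset (ZMod 48))).filter fun w => c * w ∉ residueSet 48 Φ).card) ∧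
        ¬(∀ c ∈ unitResidues 48, ((({1, 5, 13, 17, 25, 29, 37, 41} : Finset (ZMod 48))).filter fun w => c * w ∈ residueSet 48 Φ).card = ((({1, 5, 13, 17, 25, 29, 37, 41} : Finset (ZMod 48))).filter fun w => c * w ∉ residueSet 48 Φ).card) ∧
        ¬(∀ c ∈ unitResidues 48, ((({1, 7, 13, 19, 25, 31, 37, 43} : Finset (ZMod 48))).filter fun w => c * w ∈ residueSet 48 Φ).card = ((({1, 7, 13, 19, 25, 31, 37, 43} : Finset (ZMod 48))).filter fun w => c * w ∉ residueSet 48 Φ).card) ∧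
        (∀ c ∈ unitResidues 48, ((({1, 11, 17, 19, 25, 35, 41, 43} : Finset (ZMod 48))).filter fun w => c * w ∈ residueSet 48 Φ).card = ((({1, 11, 17, 19, 25, 35, 41, 43} : Finset (ZMod 48))).filter fun w => c * w ∉ residueSet 48 Φ).card)) ∧ cmTypeRank Φ = 7) ∨
    ((¬(∀ c ∈ unitResidues 48, ((({1, 7, 17, 23} : Finset (ZMod 48))).filter fun w => c * w ∈ residueSet 48 Φ).card = ((({1, 7, 17, 23} : Finset (ZMod 48))).filter fun w => c * w ∉ residueSet 48 Φ).card) ∧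
        ¬(∀ c ∈ unitResidues 48, ((({1, 23, 31, 41} : Finset (ZMod 48))).filter fun w => c * w ∈ residueSet 48 Φ).card = ((({1, 23, 31, 41} : Finset (ZMod 48))).filter fun w => c * w ∉ residueSet 48 Φ).card) ∧
        (∀ c ∈ unitResidues 48, ((({1, 5, 7, 11, 25, 29, 31, 35} : Finset (ZMod 48))).filter fun w => c * w ∈ residueSet 48 Φ).card = ((({1, 5, 7, 11, 25, 29, 31, 35} : Finset (ZMod 48))).filter fun w => c * w ∉ residueSet 48 Φ).card) ∧
        (∀ c ∈ unitResidues 48, ((({1, 5, 13, 17, 25, 29, 37, 41} : Finset (ZMod 48))).filter fun w => c * w ∈ residueSet 48 Φ).card = ((({1, 5, 13, 17, 25, 29, 37, 41} : Finset (ZMod 48))).filter fun w => c * w ∉ residueSet 48 Φ).card) ∧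
        ¬(∀ c ∈ unitResidues 48, ((({1, 7, 13, 19, 25, 31, 37, 43} : Finset (ZMod 48))).filter fun w => c * w ∈ residueSet 48 Φ).card = ((({1, 7, 13, 19, 25, 31, 37, 43} : Finset (ZMod 48))).filter fun w => c * w ∉ residueSet 48 Φ).card) ∧
        ¬(∀ c ∈ unitResidues 48, ((({1, 11, 17, 19, 25, 35, 41, 43} : Finset (ZMod 48))).filter fun w => c * w ∈ residueSet 48 Φ).card = ((({1, 11, 17, 19, 25, 35, 41, 43} : Finset (ZMod 48))).filter fun w => c * w ∉ residueSet 48 Φ).card)) ∧ cmTypeRank Φ = 7) := by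
  obtain ⟨⟨hu0, h10, hm0, hn0, hc0⟩, ⟨hu1, h11, hm1, hn1, hc1⟩, ⟨hu2, h12, hm2, hn2, hc2⟩, ⟨hu3, h13, hm3, hn3, hc3⟩, ⟨hu4, h14, hm4, hn4, hc4⟩, ⟨hu5, h15, hm5, hn5, hc5⟩, ⟨hu6, h16, hm6, hn6, hc6⟩, ⟨hu7, h17, hm7, hn7, hc7⟩, ⟨hu8, h18, hm8, hn8, hc8⟩, ⟨hu9, h19, hm9, hn9, hc9⟩⟩ := subgroups_fortyEight
  obtain ⟨hb0, hb1, hb2, hb3, hb4, hb5, hb6, hb7, hb8, hb9, hb10, hb11⟩ := cosetBalanced_reps_fortyEight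
  obtain ⟨hnb0, hnb1, hnb2, hnb3, hnb4, hnb5, hnb6, hnb7, hnb8, hnb9, hnb10, hnb11, hnb12, hnb13, hnb14, hnb15⟩ := not_cosetBalanced_deg_reps_fortyEight
  obtain ⟨Ψ, hΨ, hT⟩ := (exists_isAutTransform_fortyEight Φ φ₀).2.1 hp hb
  rw [cmTypeRank_eq_of_isAutTransform hT]
  -- balance transports along the family in both directions
  have fwd : ∀ {W : Finset (ZMod 48)}, W ⊆ unitResidues 48 →
      (∀ c ∈ unitResidues 48, (W.filter fun w => c * w ∈ residueSet 48 Ψ).card = (W.filter fun w => c * w ∉ residueSet 48 Ψ).card) →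
      (∀ c ∈ unitResidues 48, (W.filter fun w => c * w ∈ residueSet 48 Φ).card = (W.filter fun w => c * w ∉ residueSet 48 Φ).card) :=
    fun {W} hWu h ↦ cosetBalanced_of_isAutTransform hT hWu h
  have bwd : ∀ {W : Finset (ZMod 48)}, W ⊆ unitResidues 48 →
      ¬(∀ c ∈ unitResidues 48, (W.filter fun w => c * w ∈ residueSet 48 Ψ).card = (W.filter fun w => c * w ∉ residueSet 48 Ψ).card) →
      ¬(∀ c ∈ unitResidues 48, (W.filter fun w => c * w ∈ residueSet 48 Φ).card = (W.filter fun w => c * w ∉ residueSet 48 Φ).card) :=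
    fun {W} hWu h h' ↦ h (cosetBalanced_of_isAutTransform hT.symm hWu h')
  simp only [Finset.mem_insert, Finset.mem_singleton] at hΨ
  rcases hΨ with h | h | h | h
  · refine Or.inl ?_
    exact ⟨⟨bwd hu0 (by rw [h]; exact hnb0), bwd hu1 (by rw [h]; exact hnb1), bwd hu2 (by rw [h]; exact hnb2), bwd hu3 (by rw [h]; exact hnb3), fwd hu4 (by rw [h]; exact hb0), fwd hu5 (by rw [h]; exact hb1)⟩, cmTypeRank_eq_of_residueSet_eq_D1_fortyEight Ψ h⟩
  · refine Or.inr (Or.inl ?_)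
    exact ⟨⟨bwd hu0 (by rw [h]; exact hnb4), bwd hu1 (by rw [h]; exact hnb5), bwd hu2 (by rw [h]; exact hnb6), fwd hu3 (by rw [h]; exact hb3), fwd hu4 (by rw [h]; exact hb4), bwd hu5 (by rw [h]; exact hnb7)⟩, cmTypeRank_eq_of_residueSet_eq_D2_fortyEight Ψ h⟩
  · refine Or.inr (Or.inr (Or.inl ?_))
    exact ⟨⟨bwd hu0 (by rw [h]; exact hnb8), bwd hu1 (by rw [h]; exact hnb9), fwd hu2 (by rw [h]; exact hb6), bwd hu3 (by rw [h]; exact hnb10), bwd hu4 (by rw [h]; exact hnb11), fwd hu5 (by rw [h]; exact hb7)⟩, cmTypeRank_eq_of_residueSet_eq_D3_fortyEight Ψ h⟩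
  · refine Or.inr (Or.inr (Or.inr (?_)))
    exact ⟨⟨bwd hu0 (by rw [h]; exact hnb12), bwd hu1 (by rw [h]; exact hnb13), fwd hu2 (by rw [h]; exact hb9), fwd hu3 (by rw [h]; exact hb10), bwd hu4 (by rw [h]; exact hnb14), bwd hu5 (by rw [h]; exact hnb15)⟩, cmTypeRank_eq_of_residueSet_eq_D4_fortyEight Ψ h⟩

/-- **THE RANKS OF THE IMPRIMITIVE TYPES OF `ℚ(ζ₄₈)`: `5`, `3`, `2` according as the residue stabiliser has order `2`, `4`, `8`.**
[cite: Kubota1965, §2 (p. 115)] [cite: KoblitzRohrlich1978, §1 p. 1184] [cite: Shimura1998, §8.2 Prop. 26] -/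
theorem cmTypeRank_of_not_isPrimitive_fortyEight (Φ : CMType K) (φ₀ : K →+* ℂ) (hΦ : ¬IsPrimitive (ℂ ≃+* ℂ) Φ.1 φ₀) :
    (((unitResidues 48).filter fun t => ∀ c ∈ unitResidues 48, (c * t ∈ residueSet 48 Φ ↔ c ∈ residueSet 48 Φ)).card = 2 ∧ cmTypeRank Φ = 5) ∨
    (((unitResidues 48).filter fun t => ∀ c ∈ unitResidues 48, (c * t ∈ residueSet 48 Φ ↔ c ∈ residueSet 48 Φ)).card = 4 ∧ cmTypeRank Φ = 3) ∨
    (((unitResidues 48).filter fun t => ∀ c ∈ unitResidues 48, (c * t ∈ residueSet 48 Φ ↔ c ∈ residueSet 48 Φ)).card = 8 ∧ cmTypeRank Φ = 2) := by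
  rcases card_stabilizer_of_not_isPrimitive_fortyEight Φ φ₀ hΦ with h2 | h4 | h8
  · refine Or.inl ⟨h2, ?_⟩
    obtain ⟨Ψ, hΨ, hT⟩ := (exists_isAutTransform_fortyEight Φ φ₀).2.2 hΦ
    obtain ⟨⟨hs0, hi0⟩, ⟨hs1, hi1⟩, ⟨hs2, hi2⟩, ⟨hs3, hi3⟩, ⟨hs4, hi4⟩, ⟨hs5, hi5⟩, ⟨hs6, hi6⟩, ⟨hs7, hi7⟩, ⟨hs8, hi8⟩, ⟨hs9, hi9⟩, ⟨hs10, hi10⟩, ⟨hs11, hi11⟩⟩ := stabilizer_reps_fortyEight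
    have hstab := filter_stabilizer_eq_of_isAutTransform_fortyEight hT
    rw [cmTypeRank_eq_of_isAutTransform hT]
    rw [hstab] at h2
    simp only [Finset.mem_insert, Finset.mem_singleton] at hΨ
    rcases hΨ with h | h | h | h | h | h | h | h | h | h | h | h
    · exact cmTypeRank_eq_of_residueSet_eq_I1_fortyEight Ψ h
    · exact cmTypeRank_eq_of_residueSet_eq_I2_fortyEight Ψ h
    · exact cmTypeRank_eq_of_residueSet_eq_I3_fortyEight Ψ h
    · exact cmTypeRank_eq_of_residueSet_eq_I4_fortyEight Ψ h
    · exact cmTypeRank_eq_of_residueSet_eq_I5_fortyEight Ψ h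
    · exact cmTypeRank_eq_of_residueSet_eq_I6_fortyEight Ψ h
    · exact absurd h2 (by rw [h, hs6]; decide +kernel)
    · exact absurd h2 (by rw [h, hs7]; decide +kernel)
    · exact absurd h2 (by rw [h, hs8]; decide +kernel)
    · exact absurd h2 (by rw [h, hs9]; decide +kernel)
    · exact absurd h2 (by rw [h, hs10]; decide +kernel)
    · exact absurd h2 (by rw [h, hs11]; decide +kernel)
  · exact Or.inr (Or.inl ⟨h4, cmTypeRank_eq_three_of_card_stabilizer_eq_four_fortyEight Φ h4⟩)
  · exact Or.inr (Or.inr ⟨h8, cmTypeRank_eq_two_of_card_stabilizer_eq_eight_fortyEight Φ h8⟩)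

omit [IsCyclotomicExtension {48} ℚ K] in
/-- **`Rank ∈ {9, 7, 5, 3, 2}` for every CM type of `ℚ(ζ₄₈)`.** [cite: Gordon1999HodgeAVSurvey, §9.4.1–9.4.3] [cite: Kubota1965, §2] -/
theorem cmTypeRank_mem_fortyEight (hK : IsCyclotomicExtension {48} ℚ K) (Φ : CMType K) : cmTypeRank Φ = 9 ∨ cmTypeRank Φ = 7 ∨ cmTypeRank Φ = 5 ∨ cmTypeRank Φ = 3 ∨ cmTypeRank Φ = 2 := by
  obtain ⟨φ₀⟩ : Nonempty (K →+* ℂ) := inferInstance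
  by_cases hb : ((∀ c ∈ unitResidues 48, ((({1, 7, 17, 23} : Finset (ZMod 48))).filter fun w => c * w ∈ residueSet 48 Φ).card = ((({1, 7, 17, 23} : Finset (ZMod 48))).filter fun w => c * w ∉ residueSet 48 Φ).card) ∨
      (∀ c ∈ unitResidues 48, ((({1, 23, 31, 41} : Finset (ZMod 48))).filter fun w => c * w ∈ residueSet 48 Φ).card = ((({1, 23, 31, 41} : Finset (ZMod 48))).filter fun w => c * w ∉ residueSet 48 Φ).card) ∨
      (∀ c ∈ unitResidues 48, ((({1, 5, 7, 11, 25, 29, 31, 35} : Finset (ZMod 48))).filter fun w => c * w ∈ residueSet 48 Φ).card = ((({1, 5, 7, 11, 25, 29, 31, 35} : Finset (ZMod 48))).filter fun w => c * w ∉ residueSet 48 Φ).card) ∨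
      (∀ c ∈ unitResidues 48, ((({1, 5, 13, 17, 25, 29, 37, 41} : Finset (ZMod 48))).filter fun w => c * w ∈ residueSet 48 Φ).card = ((({1, 5, 13, 17, 25, 29, 37, 41} : Finset (ZMod 48))).filter fun w => c * w ∉ residueSet 48 Φ).card) ∨
      (∀ c ∈ unitResidues 48, ((({1, 7, 13, 19, 25, 31, 37, 43} : Finset (ZMod 48))).filter fun w => c * w ∈ residueSet 48 Φ).card = ((({1, 7, 13, 19, 25, 31, 37, 43} : Finset (ZMod 48))).filter fun w => c * w ∉ residueSet 48 Φ).card) ∨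
      (∀ c ∈ unitResidues 48, ((({1, 11, 17, 19, 25, 35, 41, 43} : Finset (ZMod 48))).filter fun w => c * w ∈ residueSet 48 Φ).card = ((({1, 11, 17, 19, 25, 35, 41, 43} : Finset (ZMod 48))).filter fun w => c * w ∉ residueSet 48 Φ).card))
  · by_cases hp : IsPrimitive (ℂ ≃+* ℂ) Φ.1 φ₀
    · rcases cmTypeRank_of_isPrimitive_of_cosetBalanced_fortyEight Φ φ₀ hp hb with ⟨-, h⟩ | ⟨-, h⟩ | ⟨-, h⟩ | ⟨-, h⟩ <;> rw [h] <;> decide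
    · rcases cmTypeRank_of_not_isPrimitive_fortyEight Φ φ₀ hp with ⟨-, h⟩ | ⟨-, h⟩ | ⟨-, h⟩ <;> rw [h] <;> decide
  · have h := cmTypeRank_eq_nine_of_not_cosetBalanced_fortyEight Φ hb
    rw [h]; decide

omit [IsCyclotomicExtension {48} ℚ K] in
/-- **Primitive ⟺ `Rank ≥ 7`**, for the CM types of `ℚ(ζ₄₈)` (primitive ranks `9, 7`, imprimitive ranks `5, 3, 2`).
[cite: Shimura1998, §8.2 Prop. 26] [cite: Kubota1965, §2] -/
theorem isPrimitive_iff_seven_le_cmTypeRank_fortyEight (hK : IsCyclotomicExtension {48} ℚ K) (Φ : CMType K) (φ₀ : K →+* ℂ) :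
    IsPrimitive (ℂ ≃+* ℂ) Φ.1 φ₀ ↔ 7 ≤ cmTypeRank Φ := by
  constructor
  · intro hp
    by_cases hb : ((∀ c ∈ unitResidues 48, ((({1, 7, 17, 23} : Finset (ZMod 48))).filter fun w => c * w ∈ residueSet 48 Φ).card = ((({1, 7, 17, 23} : Finset (ZMod 48))).filter fun w => c * w ∉ residueSet 48 Φ).card) ∨
      (∀ c ∈ unitResidues 48, ((({1, 23, 31, 41} : Finset (ZMod 48))).filter fun w => c * w ∈ residueSet 48 Φ).card = ((({1, 23, 31, 41} : Finset (ZMod 48))).filter fun w => c * w ∉ residueSet 48 Φ).card) ∨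
      (∀ c ∈ unitResidues 48, ((({1, 5, 7, 11, 25, 29, 31, 35} : Finset (ZMod 48))).filter fun w => c * w ∈ residueSet 48 Φ).card = ((({1, 5, 7, 11, 25, 29, 31, 35} : Finset (ZMod 48))).filter fun w => c * w ∉ residueSet 48 Φ).card) ∨
      (∀ c ∈ unitResidues 48, ((({1, 5, 13, 17, 25, 29, 37, 41} : Finset (ZMod 48))).filter fun w => c * w ∈ residueSet 48 Φ).card = ((({1, 5, 13, 17, 25, 29, 37, 41} : Finset (ZMod 48))).filter fun w => c * w ∉ residueSet 48 Φ).card) ∨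
      (∀ c ∈ unitResidues 48, ((({1, 7, 13, 19, 25, 31, 37, 43} : Finset (ZMod 48))).filter fun w => c * w ∈ residueSet 48 Φ).card = ((({1, 7, 13, 19, 25, 31, 37, 43} : Finset (ZMod 48))).filter fun w => c * w ∉ residueSet 48 Φ).card) ∨
      (∀ c ∈ unitResidues 48, ((({1, 11, 17, 19, 25, 35, 41, 43} : Finset (ZMod 48))).filter fun w => c * w ∈ residueSet 48 Φ).card = ((({1, 11, 17, 19, 25, 35, 41, 43} : Finset (ZMod 48))).filter fun w => c * w ∉ residueSet 48 Φ).card))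
    · rcases cmTypeRank_of_isPrimitive_of_cosetBalanced_fortyEight Φ φ₀ hp hb with ⟨-, h⟩ | ⟨-, h⟩ | ⟨-, h⟩ | ⟨-, h⟩ <;> omega
    · have h := cmTypeRank_eq_nine_of_not_cosetBalanced_fortyEight Φ hb
      omega
  · intro h7
    by_contra hp
    rcases cmTypeRank_of_not_isPrimitive_fortyEight Φ φ₀ hp with ⟨-, h⟩ | ⟨-, h⟩ | ⟨-, h⟩ <;> omega

end Types

/-! ### §2 Abelian varieties with complex multiplication by `ℚ(ζ₄₈)` -/

section Varieties

variable {K : Type} [Field K] [NumberField K]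
  {A : AbelianVariety ℂ} {ι : 𝓞 K →+* End A} {θ : K →+* Module.End ℂ (complexBetti A.X 1)}

/-- `dim A = 8` for a realisation of a CM type of `ℚ(ζ₄₈)`. [cite: Shimura1998, §6.2 Theorem 3] -/
theorem dim_eq_eight_of_isCMTypeRealisation_fortyEight (hK : IsCyclotomicExtension {48} ℚ K) {Φ : CMType K} (hA : IsCMTypeRealisation Φ A ι θ) :
    A.dim = 8 := by
  have h := Literature.AlgebraicGeometry.Motives.schemeDim_eq_holds hA.1
  rw [finrank_eq_sixteen₈ K] at h
  exact h

/-- **`Bᵐ(Aⁿ) ⊗ ℂ = Dᵐ(Aⁿ) ⊗ ℂ` FOR ALL `n, m`, FOR EVERY TYPE OF `ℚ(ζ₄₈)` THAT IS NOT A PRIMITIVE COSET-BALANCED ONE** (`192` of the `256` types: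
nondegenerate, or imprimitive and then induced from a NONDEGENERATE type of an octic, quartic or quadratic CM subfield).
[cite: Gordon1999HodgeAVSurvey, Thm. 6.4 and §9.3] [cite: Kubota1965, §2] -/
theorem hodgeClassSpan_pow_eq_divisorClassesSpan_of_fortyEight (hK : IsCyclotomicExtension {48} ℚ K) (Φ : CMType K) (φ₀ : K →+* ℂ)
    (h : IsPrimitive (ℂ ≃+* ℂ) Φ.1 φ₀ →
      ¬((∀ c ∈ unitResidues 48, ((({1, 7, 17, 23} : Finset (ZMod 48))).filter fun w => c * w ∈ residueSet 48 Φ).card = ((({1, 7, 17, 23} : Finset (ZMod 48))).filter fun w => c * w ∉ residueSet 48 Φ).card) ∨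
      (∀ c ∈ unitResidues 48, ((({1, 23, 31, 41} : Finset (ZMod 48))).filter fun w => c * w ∈ residueSet 48 Φ).card = ((({1, 23, 31, 41} : Finset (ZMod 48))).filter fun w => c * w ∉ residueSet 48 Φ).card) ∨
      (∀ c ∈ unitResidues 48, ((({1, 5, 7, 11, 25, 29, 31, 35} : Finset (ZMod 48))).filter fun w => c * w ∈ residueSet 48 Φ).card = ((({1, 5, 7, 11, 25, 29, 31, 35} : Finset (ZMod 48))).filter fun w => c * w ∉ residueSet 48 Φ).card) ∨
      (∀ c ∈ unitResidues 48, ((({1, 5, 13, 17, 25, 29, 37, 41} : Finset (ZMod 48))).filter fun w => c * w ∈ residueSet 48 Φ).card = ((({1, 5, 13, 17, 25, 29, 37, 41} : Finset (ZMod 48))).filter fun w => c * w ∉ residueSet 48 Φ).card) ∨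
      (∀ c ∈ unitResidues 48, ((({1, 7, 13, 19, 25, 31, 37, 43} : Finset (ZMod 48))).filter fun w => c * w ∈ residueSet 48 Φ).card = ((({1, 7, 13, 19, 25, 31, 37, 43} : Finset (ZMod 48))).filter fun w => c * w ∉ residueSet 48 Φ).card) ∨
      (∀ c ∈ unitResidues 48, ((({1, 11, 17, 19, 25, 35, 41, 43} : Finset (ZMod 48))).filter fun w => c * w ∈ residueSet 48 Φ).card = ((({1, 11, 17, 19, 25, 35, 41, 43} : Finset (ZMod 48))).filter fun w => c * w ∉ residueSet 48 Φ).card)))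
    (hA : IsCMTypeRealisation Φ A ι θ) (n m : ℕ) :
    hodgeClassSpan (⨁ fun _ : Fin n => A).dim (⨁ fun _ : Fin n => A).X m =
      divisorClassesSpan (⨁ fun _ : Fin n => A).X (⨁ fun _ : Fin n => A).dim m := by
  haveI := isCMField₈ K
  by_cases hΦ : IsPrimitive (ℂ ≃+* ℂ) Φ.1 φ₀
  · exact ((isNondegenerate_iff_not_cosetBalanced_fortyEight hK Φ).2 (h hΦ)).hodgeClassSpan_pow_eq_divisorClassesSpan hA n m
  · rcases cmTypeRank_of_not_isPrimitive_fortyEight Φ φ₀ hΦ with ⟨hs, hr⟩ | ⟨hs, hr⟩ | ⟨hs, hr⟩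
    · exact hodgeClassSpan_pow_eq_divisorClassesSpan_of_card_stabilizer_mul_eq (N := 48) (by norm_num) Φ (k := 4)
        (by rw [hs]; decide +kernel) hr hA n m
    · exact hodgeClassSpan_pow_eq_divisorClassesSpan_of_card_stabilizer_mul_eq (N := 48) (by norm_num) Φ (k := 2)
        (by rw [hs]; decide +kernel) hr hA n m
    · exact hodgeClassSpan_pow_eq_divisorClassesSpan_of_card_stabilizer_mul_eq (N := 48) (by norm_num) Φ (k := 1)
        (by rw [hs]; decide +kernel) hr hA n m

/-- `Bᵐ ⊗ ℂ = Dᵐ ⊗ ℂ` for all `m` on an abelian variety gives the Hodge conjecture for it. [cite: Gordon1999HodgeAVSurvey, §9.3] -/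
private theorem hodgeConjectureFor_of_forall_hodgeClassSpan_eq₈ (B : AbelianVariety ℂ)
    (h : ∀ m : ℕ, hodgeClassSpan B.dim B.X m = divisorClassesSpan B.X B.dim m) : HodgeConjectureFor B.dim B.X :=
  ⟨Literature.AlgebraicGeometry.HodgeTheory.nonempty_hodgeModel_holds
      (Literature.AlgebraicGeometry.Motives.AbelianVariety.isSmoothProjective_holds (A := B)),
    fun m _ hc hmm ↦ Literature.AlgebraicGeometry.HodgeTheory.AbelianVariety.divisorClassesSpan_le_algebraicClasses B
      (fun b hb hb' ↦ Literature.AlgebraicGeometry.HodgeTheory.lefschetzOneOne_rational_holds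
        (Literature.AlgebraicGeometry.Motives.AbelianVariety.isSmoothProjective_holds (A := B)) b hb hb') m
      ((h m) ▸ Submodule.subset_span ⟨hc, hmm⟩)⟩

/-- **THE HODGE CONJECTURE FOR EVERY POWER OF EVERY ABELIAN VARIETY WITH COMPLEX MULTIPLICATION BY `ℚ(ζ₄₈)` WHOSE TYPE IS NOT A PRIMITIVE
COSET-BALANCED ONE** (`192` of the `256` types), unconditionally. [cite: Gordon1999HodgeAVSurvey, Thm. 6.4 and §9.3] -/
theorem hodgeConjectureFor_pow_of_fortyEight (hK : IsCyclotomicExtension {48} ℚ K) (Φ : CMType K) (φ₀ : K →+* ℂ)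
    (h : IsPrimitive (ℂ ≃+* ℂ) Φ.1 φ₀ →
      ¬((∀ c ∈ unitResidues 48, ((({1, 7, 17, 23} : Finset (ZMod 48))).filter fun w => c * w ∈ residueSet 48 Φ).card = ((({1, 7, 17, 23} : Finset (ZMod 48))).filter fun w => c * w ∉ residueSet 48 Φ).card) ∨
      (∀ c ∈ unitResidues 48, ((({1, 23, 31, 41} : Finset (ZMod 48))).filter fun w => c * w ∈ residueSet 48 Φ).card = ((({1, 23, 31, 41} : Finset (ZMod 48))).filter fun w => c * w ∉ residueSet 48 Φ).card) ∨
      (∀ c ∈ unitResidues 48, ((({1, 5, 7, 11, 25, 29, 31, 35} : Finset (ZMod 48))).filter fun w => c * w ∈ residueSet 48 Φ).card = ((({1, 5, 7, 11, 25, 29, 31, 35} : Finset (ZMod 48))).filter fun w => c * w ∉ residueSet 48 Φ).card) ∨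
      (∀ c ∈ unitResidues 48, ((({1, 5, 13, 17, 25, 29, 37, 41} : Finset (ZMod 48))).filter fun w => c * w ∈ residueSet 48 Φ).card = ((({1, 5, 13, 17, 25, 29, 37, 41} : Finset (ZMod 48))).filter fun w => c * w ∉ residueSet 48 Φ).card) ∨
      (∀ c ∈ unitResidues 48, ((({1, 7, 13, 19, 25, 31, 37, 43} : Finset (ZMod 48))).filter fun w => c * w ∈ residueSet 48 Φ).card = ((({1, 7, 13, 19, 25, 31, 37, 43} : Finset (ZMod 48))).filter fun w => c * w ∉ residueSet 48 Φ).card) ∨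
      (∀ c ∈ unitResidues 48, ((({1, 11, 17, 19, 25, 35, 41, 43} : Finset (ZMod 48))).filter fun w => c * w ∈ residueSet 48 Φ).card = ((({1, 11, 17, 19, 25, 35, 41, 43} : Finset (ZMod 48))).filter fun w => c * w ∉ residueSet 48 Φ).card)))
    (hA : IsCMTypeRealisation Φ A ι θ) (n : ℕ) :
    HodgeConjectureFor (⨁ fun _ : Fin n => A).dim (⨁ fun _ : Fin n => A).X :=
  hodgeConjectureFor_of_forall_hodgeClassSpan_eq₈ _ (fun m ↦ hodgeClassSpan_pow_eq_divisorClassesSpan_of_fortyEight hK Φ φ₀ h hA n m)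

/-- **EVERY REALISATION OF A PRIMITIVE TYPE OF `ℚ(ζ₄₈)` COSET-BALANCED FOR A MAXIMAL `(−1)`-FREE SUBGROUP OF ORDER `8` IS A SIMPLE ABELIAN `8`-FOLD
CARRYING RATIONAL `(4,4)`-CLASSES OUTSIDE `D⁴(A) ⊗ ℂ`** — the Weil classes of `(A, k)`, `k` the imaginary quadratic fixed field
(ℚ(√−6), ℚ(i), ℚ(√−3), ℚ(√−2)), acting with multiplicities `(4,4)`; `dim B⁴ − dim D⁴ ≥ 2`.
[cite: Gordon1999HodgeAVSurvey, 5.13 (ii) and 9.2.2] [cite: vanGeemen1994HodgeAV, Thm. 4.5 and 4.7] [cite: Pohlmann1968, §3] [cite: Shimura1998, §8.2 Prop. 26] -/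
theorem exists_exceptional_four_of_cosetBalanced_fortyEight (hK : IsCyclotomicExtension {48} ℚ K) (Φ : CMType K) (φ₀ : K →+* ℂ)
    (hΦ : IsPrimitive (ℂ ≃+* ℂ) Φ.1 φ₀)
    (hbal : (∀ c ∈ unitResidues 48, ((({1, 5, 7, 11, 25, 29, 31, 35} : Finset (ZMod 48))).filter fun w => c * w ∈ residueSet 48 Φ).card = ((({1, 5, 7, 11, 25, 29, 31, 35} : Finset (ZMod 48))).filter fun w => c * w ∉ residueSet 48 Φ).card) ∨
      (∀ c ∈ unitResidues 48, ((({1, 5, 13, 17, 25, 29, 37, 41} : Finset (ZMod 48))).filter fun w => c * w ∈ residueSet 48 Φ).card = ((({1, 5, 13, 17, 25, 29, 37, 41} : Finset (ZMod 48))).filter fun w => c * w ∉ residueSet 48 Φ).card) ∨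
      (∀ c ∈ unitResidues 48, ((({1, 7, 13, 19, 25, 31, 37, 43} : Finset (ZMod 48))).filter fun w => c * w ∈ residueSet 48 Φ).card = ((({1, 7, 13, 19, 25, 31, 37, 43} : Finset (ZMod 48))).filter fun w => c * w ∉ residueSet 48 Φ).card) ∨
      (∀ c ∈ unitResidues 48, ((({1, 11, 17, 19, 25, 35, 41, 43} : Finset (ZMod 48))).filter fun w => c * w ∈ residueSet 48 Φ).card = ((({1, 11, 17, 19, 25, 35, 41, 43} : Finset (ZMod 48))).filter fun w => c * w ∉ residueSet 48 Φ).card))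
    (hA : IsCMTypeRealisation Φ A ι θ) :
    A.IsSimple ∧ A.dim = 8 ∧
      (∃ c : complexBetti A.X (2 * 4), IsRationalClass c ∧ IsOfHodgeType 8 A.X (2 * 4) 4 4 c ∧ c ∉ divisorClassesSpan A.X 8 4) ∧
      2 ≤ Module.finrank ℂ ↥(hodgeClassSpan 8 A.X 4) - Module.finrank ℂ ↥(divisorClassesSpan A.X 8 4) := by
  obtain ⟨⟨hu0, h10, hm0, hn0, hc0⟩, ⟨hu1, h11, hm1, hn1, hc1⟩, ⟨hu2, h12, hm2, hn2, hc2⟩, ⟨hu3, h13, hm3, hn3, hc3⟩, ⟨hu4, h14, hm4, hn4, hc4⟩, ⟨hu5, h15, hm5, hn5, hc5⟩, ⟨hu6, h16, hm6, hn6, hc6⟩, ⟨hu7, h17, hm7, hn7, hc7⟩, ⟨hu8, h18, hm8, hn8, hc8⟩, ⟨hu9, h19, hm9, hn9, hc9⟩⟩ := subgroups_fortyEight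
  have hprim : HasTrivialStabilizer 48 (residueSet 48 Φ) := (isPrimitive_iff_hasTrivialStabilizer 48 Φ φ₀).1 hΦ
  have htot : Nat.totient 48 / 2 = 8 := by decide +kernel
  refine ⟨isSimple_of_isCMTypeRealisation_of_isPrimitive hA φ₀ hΦ, dim_eq_eight_of_isCMTypeRealisation_fortyEight hK hA, ?_, ?_⟩
  · rcases hbal with hb | hb | hb | hb
    · obtain ⟨c, hcQ, hcH, hcD⟩ := exists_exceptional_of_cosetBalanced hu2 h12 hm2 hn2 hb hprim hc2 hA
      rw [htot] at hcH hcD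
      exact ⟨c, hcQ, hcH, hcD⟩
    · obtain ⟨c, hcQ, hcH, hcD⟩ := exists_exceptional_of_cosetBalanced hu3 h13 hm3 hn3 hb hprim hc3 hA
      rw [htot] at hcH hcD
      exact ⟨c, hcQ, hcH, hcD⟩
    · obtain ⟨c, hcQ, hcH, hcD⟩ := exists_exceptional_of_cosetBalanced hu4 h14 hm4 hn4 hb hprim hc4 hA
      rw [htot] at hcH hcD
      exact ⟨c, hcQ, hcH, hcD⟩
    · obtain ⟨c, hcQ, hcH, hcD⟩ := exists_exceptional_of_cosetBalanced hu5 h15 hm5 hn5 hb hprim hc5 hA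
      rw [htot] at hcH hcD
      exact ⟨c, hcQ, hcH, hcD⟩
  · rcases hbal with hb | hb | hb | hb
    · have h := two_le_finrank_hodgeClassSpan_sub_finrank_divisorClassesSpan_of_cosetBalanced hu2 h12 hm2 hn2 hb hprim hc2 hA
      rwa [htot] at h
    · have h := two_le_finrank_hodgeClassSpan_sub_finrank_divisorClassesSpan_of_cosetBalanced hu3 h13 hm3 hn3 hb hprim hc3 hA
      rwa [htot] at h
    · have h := two_le_finrank_hodgeClassSpan_sub_finrank_divisorClassesSpan_of_cosetBalanced hu4 h14 hm4 hn4 hb hprim hc4 hA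
      rwa [htot] at h
    · have h := two_le_finrank_hodgeClassSpan_sub_finrank_divisorClassesSpan_of_cosetBalanced hu5 h15 hm5 hn5 hb hprim hc5 hA
      rwa [htot] at h

/-- **EVERY REALISATION OF A PRIMITIVE TYPE OF `ℚ(ζ₄₈)` COSET-BALANCED FOR A `(−1)`-FREE SUBGROUP OF ORDER `4` IS A SIMPLE ABELIAN `8`-FOLD CARRYING
RATIONAL `(2,2)`-CLASSES OUTSIDE `D²(A) ⊗ ℂ`** — the generalised Weil classes of `(A, k)` for the quartic CM fixed field `k` of `W`, in `H⁴`;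
`dim B² − dim D² ≥ 2`. [cite: Gordon1999HodgeAVSurvey, 5.13 (ii), 9.2.2 and 9.4.3] [cite: vanGeemen1994HodgeAV, Thm. 4.5 and 4.7] [cite: Pohlmann1968, §3] -/
theorem exists_exceptional_two_of_cosetBalanced_fortyEight (hK : IsCyclotomicExtension {48} ℚ K) (Φ : CMType K) (φ₀ : K →+* ℂ)
    (hΦ : IsPrimitive (ℂ ≃+* ℂ) Φ.1 φ₀)
    (hbal : (∀ c ∈ unitResidues 48, ((({1, 7, 17, 23} : Finset (ZMod 48))).filter fun w => c * w ∈ residueSet 48 Φ).card = ((({1, 7, 17, 23} : Finset (ZMod 48))).filter fun w => c * w ∉ residueSet 48 Φ).card) ∨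
      (∀ c ∈ unitResidues 48, ((({1, 23, 31, 41} : Finset (ZMod 48))).filter fun w => c * w ∈ residueSet 48 Φ).card = ((({1, 23, 31, 41} : Finset (ZMod 48))).filter fun w => c * w ∉ residueSet 48 Φ).card) ∨
      (∀ c ∈ unitResidues 48, ((({1, 19, 25, 43} : Finset (ZMod 48))).filter fun w => c * w ∈ residueSet 48 Φ).card = ((({1, 19, 25, 43} : Finset (ZMod 48))).filter fun w => c * w ∉ residueSet 48 Φ).card) ∨
      (∀ c ∈ unitResidues 48, ((({1, 13, 25, 37} : Finset (ZMod 48))).filter fun w => c * w ∈ residueSet 48 Φ).card = ((({1, 13, 25, 37} : Finset (ZMod 48))).filter fun w => c * w ∉ residueSet 48 Φ).card) ∨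
      (∀ c ∈ unitResidues 48, ((({1, 11, 25, 35} : Finset (ZMod 48))).filter fun w => c * w ∈ residueSet 48 Φ).card = ((({1, 11, 25, 35} : Finset (ZMod 48))).filter fun w => c * w ∉ residueSet 48 Φ).card) ∨
      (∀ c ∈ unitResidues 48, ((({1, 5, 25, 29} : Finset (ZMod 48))).filter fun w => c * w ∈ residueSet 48 Φ).card = ((({1, 5, 25, 29} : Finset (ZMod 48))).filter fun w => c * w ∉ residueSet 48 Φ).card))
    (hA : IsCMTypeRealisation Φ A ι θ) :
    A.IsSimple ∧ A.dim = 8 ∧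
      (∃ c : complexBetti A.X (2 * 2), IsRationalClass c ∧ IsOfHodgeType 8 A.X (2 * 2) 2 2 c ∧ c ∉ divisorClassesSpan A.X 8 2) ∧
      2 ≤ Module.finrank ℂ ↥(hodgeClassSpan 8 A.X 2) - Module.finrank ℂ ↥(divisorClassesSpan A.X 8 2) := by
  obtain ⟨⟨hu0, h10, hm0, hn0, hc0⟩, ⟨hu1, h11, hm1, hn1, hc1⟩, ⟨hu2, h12, hm2, hn2, hc2⟩, ⟨hu3, h13, hm3, hn3, hc3⟩, ⟨hu4, h14, hm4, hn4, hc4⟩, ⟨hu5, h15, hm5, hn5, hc5⟩, ⟨hu6, h16, hm6, hn6, hc6⟩, ⟨hu7, h17, hm7, hn7, hc7⟩, ⟨hu8, h18, hm8, hn8, hc8⟩, ⟨hu9, h19, hm9, hn9, hc9⟩⟩ := subgroups_fortyEight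
  have hprim : HasTrivialStabilizer 48 (residueSet 48 Φ) := (isPrimitive_iff_hasTrivialStabilizer 48 Φ φ₀).1 hΦ
  have htot : Nat.totient 48 / 2 = 8 := by decide +kernel
  refine ⟨isSimple_of_isCMTypeRealisation_of_isPrimitive hA φ₀ hΦ, dim_eq_eight_of_isCMTypeRealisation_fortyEight hK hA, ?_, ?_⟩
  · rcases hbal with hb | hb | hb | hb | hb | hb
    · obtain ⟨c, hcQ, hcH, hcD⟩ := exists_exceptional_of_cosetBalanced hu0 h10 hm0 hn0 hb hprim hc0 hA
      rw [htot] at hcH hcD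
      exact ⟨c, hcQ, hcH, hcD⟩
    · obtain ⟨c, hcQ, hcH, hcD⟩ := exists_exceptional_of_cosetBalanced hu1 h11 hm1 hn1 hb hprim hc1 hA
      rw [htot] at hcH hcD
      exact ⟨c, hcQ, hcH, hcD⟩
    · obtain ⟨c, hcQ, hcH, hcD⟩ := exists_exceptional_of_cosetBalanced hu6 h16 hm6 hn6 hb hprim hc6 hA
      rw [htot] at hcH hcD
      exact ⟨c, hcQ, hcH, hcD⟩
    · obtain ⟨c, hcQ, hcH, hcD⟩ := exists_exceptional_of_cosetBalanced hu7 h17 hm7 hn7 hb hprim hc7 hA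
      rw [htot] at hcH hcD
      exact ⟨c, hcQ, hcH, hcD⟩
    · obtain ⟨c, hcQ, hcH, hcD⟩ := exists_exceptional_of_cosetBalanced hu8 h18 hm8 hn8 hb hprim hc8 hA
      rw [htot] at hcH hcD
      exact ⟨c, hcQ, hcH, hcD⟩
    · obtain ⟨c, hcQ, hcH, hcD⟩ := exists_exceptional_of_cosetBalanced hu9 h19 hm9 hn9 hb hprim hc9 hA
      rw [htot] at hcH hcD
      exact ⟨c, hcQ, hcH, hcD⟩
  · rcases hbal with hb | hb | hb | hb | hb | hb
    · have h := two_le_finrank_hodgeClassSpan_sub_finrank_divisorClassesSpan_of_cosetBalanced hu0 h10 hm0 hn0 hb hprim hc0 hA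
      rwa [htot] at h
    · have h := two_le_finrank_hodgeClassSpan_sub_finrank_divisorClassesSpan_of_cosetBalanced hu1 h11 hm1 hn1 hb hprim hc1 hA
      rwa [htot] at h
    · have h := two_le_finrank_hodgeClassSpan_sub_finrank_divisorClassesSpan_of_cosetBalanced hu6 h16 hm6 hn6 hb hprim hc6 hA
      rwa [htot] at h
    · have h := two_le_finrank_hodgeClassSpan_sub_finrank_divisorClassesSpan_of_cosetBalanced hu7 h17 hm7 hn7 hb hprim hc7 hA
      rwa [htot] at h
    · have h := two_le_finrank_hodgeClassSpan_sub_finrank_divisorClassesSpan_of_cosetBalanced hu8 h18 hm8 hn8 hb hprim hc8 hA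
      rwa [htot] at h
    · have h := two_le_finrank_hodgeClassSpan_sub_finrank_divisorClassesSpan_of_cosetBalanced hu9 h19 hm9 hn9 hb hprim hc9 hA
      rwa [htot] at h

/-- **`B⁴ ≠ D⁴` or `B² ≠ D²` for every realisation of a primitive coset-balanced type of `ℚ(ζ₄₈)`** (balanced for an order-`8` maximal subgroup ⟹
`B⁴(A) ⊗ ℂ ≠ D⁴(A) ⊗ ℂ`; otherwise it is balanced for a `(−1)`-free subgroup of order `4` and `B²(A) ⊗ ℂ ≠ D²(A) ⊗ ℂ`).
[cite: Gordon1999HodgeAVSurvey, 5.13 (ii) and 9.4.3] -/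
theorem hodgeClassSpan_ne_of_cosetBalanced_fortyEight (hK : IsCyclotomicExtension {48} ℚ K) (Φ : CMType K) (φ₀ : K →+* ℂ)
    (hΦ : IsPrimitive (ℂ ≃+* ℂ) Φ.1 φ₀)
    (hb : ((∀ c ∈ unitResidues 48, ((({1, 7, 17, 23} : Finset (ZMod 48))).filter fun w => c * w ∈ residueSet 48 Φ).card = ((({1, 7, 17, 23} : Finset (ZMod 48))).filter fun w => c * w ∉ residueSet 48 Φ).card) ∨
      (∀ c ∈ unitResidues 48, ((({1, 23, 31, 41} : Finset (ZMod 48))).filter fun w => c * w ∈ residueSet 48 Φ).card = ((({1, 23, 31, 41} : Finset (ZMod 48))).filter fun w => c * w ∉ residueSet 48 Φ).card) ∨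
      (∀ c ∈ unitResidues 48, ((({1, 5, 7, 11, 25, 29, 31, 35} : Finset (ZMod 48))).filter fun w => c * w ∈ residueSet 48 Φ).card = ((({1, 5, 7, 11, 25, 29, 31, 35} : Finset (ZMod 48))).filter fun w => c * w ∉ residueSet 48 Φ).card) ∨
      (∀ c ∈ unitResidues 48, ((({1, 5, 13, 17, 25, 29, 37, 41} : Finset (ZMod 48))).filter fun w => c * w ∈ residueSet 48 Φ).card = ((({1, 5, 13, 17, 25, 29, 37, 41} : Finset (ZMod 48))).filter fun w => c * w ∉ residueSet 48 Φ).card) ∨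
      (∀ c ∈ unitResidues 48, ((({1, 7, 13, 19, 25, 31, 37, 43} : Finset (ZMod 48))).filter fun w => c * w ∈ residueSet 48 Φ).card = ((({1, 7, 13, 19, 25, 31, 37, 43} : Finset (ZMod 48))).filter fun w => c * w ∉ residueSet 48 Φ).card) ∨
      (∀ c ∈ unitResidues 48, ((({1, 11, 17, 19, 25, 35, 41, 43} : Finset (ZMod 48))).filter fun w => c * w ∈ residueSet 48 Φ).card = ((({1, 11, 17, 19, 25, 35, 41, 43} : Finset (ZMod 48))).filter fun w => c * w ∉ residueSet 48 Φ).card)))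
    (hA : IsCMTypeRealisation Φ A ι θ) :
    (((∀ c ∈ unitResidues 48, ((({1, 5, 7, 11, 25, 29, 31, 35} : Finset (ZMod 48))).filter fun w => c * w ∈ residueSet 48 Φ).card = ((({1, 5, 7, 11, 25, 29, 31, 35} : Finset (ZMod 48))).filter fun w => c * w ∉ residueSet 48 Φ).card) ∨
      (∀ c ∈ unitResidues 48, ((({1, 5, 13, 17, 25, 29, 37, 41} : Finset (ZMod 48))).filter fun w => c * w ∈ residueSet 48 Φ).card = ((({1, 5, 13, 17, 25, 29, 37, 41} : Finset (ZMod 48))).filter fun w => c * w ∉ residueSet 48 Φ).card) ∨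
      (∀ c ∈ unitResidues 48, ((({1, 7, 13, 19, 25, 31, 37, 43} : Finset (ZMod 48))).filter fun w => c * w ∈ residueSet 48 Φ).card = ((({1, 7, 13, 19, 25, 31, 37, 43} : Finset (ZMod 48))).filter fun w => c * w ∉ residueSet 48 Φ).card) ∨
      (∀ c ∈ unitResidues 48, ((({1, 11, 17, 19, 25, 35, 41, 43} : Finset (ZMod 48))).filter fun w => c * w ∈ residueSet 48 Φ).card = ((({1, 11, 17, 19, 25, 35, 41, 43} : Finset (ZMod 48))).filter fun w => c * w ∉ residueSet 48 Φ).card)) ∧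
      hodgeClassSpan 8 A.X 4 ≠ divisorClassesSpan A.X 8 4) ∨
    (((∀ c ∈ unitResidues 48, ((({1, 7, 17, 23} : Finset (ZMod 48))).filter fun w => c * w ∈ residueSet 48 Φ).card = ((({1, 7, 17, 23} : Finset (ZMod 48))).filter fun w => c * w ∉ residueSet 48 Φ).card) ∨
      (∀ c ∈ unitResidues 48, ((({1, 23, 31, 41} : Finset (ZMod 48))).filter fun w => c * w ∈ residueSet 48 Φ).card = ((({1, 23, 31, 41} : Finset (ZMod 48))).filter fun w => c * w ∉ residueSet 48 Φ).card) ∨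
      (∀ c ∈ unitResidues 48, ((({1, 19, 25, 43} : Finset (ZMod 48))).filter fun w => c * w ∈ residueSet 48 Φ).card = ((({1, 19, 25, 43} : Finset (ZMod 48))).filter fun w => c * w ∉ residueSet 48 Φ).card) ∨
      (∀ c ∈ unitResidues 48, ((({1, 13, 25, 37} : Finset (ZMod 48))).filter fun w => c * w ∈ residueSet 48 Φ).card = ((({1, 13, 25, 37} : Finset (ZMod 48))).filter fun w => c * w ∉ residueSet 48 Φ).card) ∨
      (∀ c ∈ unitResidues 48, ((({1, 11, 25, 35} : Finset (ZMod 48))).filter fun w => c * w ∈ residueSet 48 Φ).card = ((({1, 11, 25, 35} : Finset (ZMod 48))).filter fun w => c * w ∉ residueSet 48 Φ).card) ∨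
      (∀ c ∈ unitResidues 48, ((({1, 5, 25, 29} : Finset (ZMod 48))).filter fun w => c * w ∈ residueSet 48 Φ).card = ((({1, 5, 25, 29} : Finset (ZMod 48))).filter fun w => c * w ∉ residueSet 48 Φ).card)) ∧
      hodgeClassSpan 8 A.X 2 ≠ divisorClassesSpan A.X 8 2) := by
  have h4 : ((∀ c ∈ unitResidues 48, ((({1, 5, 7, 11, 25, 29, 31, 35} : Finset (ZMod 48))).filter fun w => c * w ∈ residueSet 48 Φ).card = ((({1, 5, 7, 11, 25, 29, 31, 35} : Finset (ZMod 48))).filter fun w => c * w ∉ residueSet 48 Φ).card) ∨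
      (∀ c ∈ unitResidues 48, ((({1, 5, 13, 17, 25, 29, 37, 41} : Finset (ZMod 48))).filter fun w => c * w ∈ residueSet 48 Φ).card = ((({1, 5, 13, 17, 25, 29, 37, 41} : Finset (ZMod 48))).filter fun w => c * w ∉ residueSet 48 Φ).card) ∨
      (∀ c ∈ unitResidues 48, ((({1, 7, 13, 19, 25, 31, 37, 43} : Finset (ZMod 48))).filter fun w => c * w ∈ residueSet 48 Φ).card = ((({1, 7, 13, 19, 25, 31, 37, 43} : Finset (ZMod 48))).filter fun w => c * w ∉ residueSet 48 Φ).card) ∨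
      (∀ c ∈ unitResidues 48, ((({1, 11, 17, 19, 25, 35, 41, 43} : Finset (ZMod 48))).filter fun w => c * w ∈ residueSet 48 Φ).card = ((({1, 11, 17, 19, 25, 35, 41, 43} : Finset (ZMod 48))).filter fun w => c * w ∉ residueSet 48 Φ).card)) →
      hodgeClassSpan 8 A.X 4 ≠ divisorClassesSpan A.X 8 4 := fun hb8 h ↦ by
    obtain ⟨-, -, ⟨c, hcQ, hcH, hcD⟩, -⟩ := exists_exceptional_four_of_cosetBalanced_fortyEight hK Φ φ₀ hΦ hb8 hA
    exact hcD (h ▸ Submodule.subset_span ⟨hcQ, hcH⟩)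
  have h2 : ((∀ c ∈ unitResidues 48, ((({1, 7, 17, 23} : Finset (ZMod 48))).filter fun w => c * w ∈ residueSet 48 Φ).card = ((({1, 7, 17, 23} : Finset (ZMod 48))).filter fun w => c * w ∉ residueSet 48 Φ).card) ∨
      (∀ c ∈ unitResidues 48, ((({1, 23, 31, 41} : Finset (ZMod 48))).filter fun w => c * w ∈ residueSet 48 Φ).card = ((({1, 23, 31, 41} : Finset (ZMod 48))).filter fun w => c * w ∉ residueSet 48 Φ).card) ∨
      (∀ c ∈ unitResidues 48, ((({1, 19, 25, 43} : Finset (ZMod 48))).filter fun w => c * w ∈ residueSet 48 Φ).card = ((({1, 19, 25, 43} : Finset (ZMod 48))).filter fun w => c * w ∉ residueSet 48 Φ).card) ∨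
      (∀ c ∈ unitResidues 48, ((({1, 13, 25, 37} : Finset (ZMod 48))).filter fun w => c * w ∈ residueSet 48 Φ).card = ((({1, 13, 25, 37} : Finset (ZMod 48))).filter fun w => c * w ∉ residueSet 48 Φ).card) ∨
      (∀ c ∈ unitResidues 48, ((({1, 11, 25, 35} : Finset (ZMod 48))).filter fun w => c * w ∈ residueSet 48 Φ).card = ((({1, 11, 25, 35} : Finset (ZMod 48))).filter fun w => c * w ∉ residueSet 48 Φ).card) ∨
      (∀ c ∈ unitResidues 48, ((({1, 5, 25, 29} : Finset (ZMod 48))).filter fun w => c * w ∈ residueSet 48 Φ).card = ((({1, 5, 25, 29} : Finset (ZMod 48))).filter fun w => c * w ∉ residueSet 48 Φ).card)) →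
      hodgeClassSpan 8 A.X 2 ≠ divisorClassesSpan A.X 8 2 := fun hb4 h ↦ by
    obtain ⟨-, -, ⟨c, hcQ, hcH, hcD⟩, -⟩ := exists_exceptional_two_of_cosetBalanced_fortyEight hK Φ φ₀ hΦ hb4 hA
    exact hcD (h ▸ Submodule.subset_span ⟨hcQ, hcH⟩)
  rcases cmTypeRank_of_isPrimitive_of_cosetBalanced_fortyEight Φ φ₀ hΦ hb with ⟨hpr, -⟩ | ⟨hpr, -⟩ | ⟨hpr, -⟩ | ⟨hpr, -⟩
  · exact Or.inl ⟨Or.inr (Or.inr (Or.inl hpr.2.2.2.2.1)), h4 (Or.inr (Or.inr (Or.inl hpr.2.2.2.2.1)))⟩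
  · exact Or.inl ⟨Or.inr (Or.inl hpr.2.2.2.1), h4 (Or.inr (Or.inl hpr.2.2.2.1))⟩
  · exact Or.inl ⟨Or.inl hpr.2.2.1, h4 (Or.inl hpr.2.2.1)⟩
  · exact Or.inl ⟨Or.inl hpr.2.2.1, h4 (Or.inl hpr.2.2.1)⟩

/-- **THE DICHOTOMY FOR THE CM ABELIAN VARIETIES OF `ℚ(ζ₄₈)`**: for every abelian variety `A` with complex multiplication by `ℚ(ζ₄₈)` (any type):
EITHER `B•(Aⁿ) ⊗ ℂ = D•(Aⁿ) ⊗ ℂ` for all `n` and the Hodge conjecture holds for every power of `A` (`192` types), OR the type is primitive and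
coset-balanced (`64` types) and `A` is a simple `8`-fold with `B⁴(A) ⊗ ℂ ≠ D⁴(A) ⊗ ℂ` or `B²(A) ⊗ ℂ ≠ D²(A) ⊗ ℂ`.
[cite: Gordon1999HodgeAVSurvey, Thm. 6.4, §9.3, 5.13 (ii), §9.4] -/
theorem hodgeConjectureFor_pow_or_exceptional_fortyEight (hK : IsCyclotomicExtension {48} ℚ K) (Φ : CMType K) (φ₀ : K →+* ℂ)
    (hA : IsCMTypeRealisation Φ A ι θ) :
    ((∀ n m : ℕ, hodgeClassSpan (⨁ fun _ : Fin n => A).dim (⨁ fun _ : Fin n => A).X m =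
        divisorClassesSpan (⨁ fun _ : Fin n => A).X (⨁ fun _ : Fin n => A).dim m) ∧
      ∀ n : ℕ, HodgeConjectureFor (⨁ fun _ : Fin n => A).dim (⨁ fun _ : Fin n => A).X) ∨
    (IsPrimitive (ℂ ≃+* ℂ) Φ.1 φ₀ ∧
      ((∀ c ∈ unitResidues 48, ((({1, 7, 17, 23} : Finset (ZMod 48))).filter fun w => c * w ∈ residueSet 48 Φ).card = ((({1, 7, 17, 23} : Finset (ZMod 48))).filter fun w => c * w ∉ residueSet 48 Φ).card) ∨
      (∀ c ∈ unitResidues 48, ((({1, 23, 31, 41} : Finset (ZMod 48))).filter fun w => c * w ∈ residueSet 48 Φ).card = ((({1, 23, 31, 41} : Finset (ZMod 48))).filter fun w => c * w ∉ residueSet 48 Φ).card) ∨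
      (∀ c ∈ unitResidues 48, ((({1, 5, 7, 11, 25, 29, 31, 35} : Finset (ZMod 48))).filter fun w => c * w ∈ residueSet 48 Φ).card = ((({1, 5, 7, 11, 25, 29, 31, 35} : Finset (ZMod 48))).filter fun w => c * w ∉ residueSet 48 Φ).card) ∨
      (∀ c ∈ unitResidues 48, ((({1, 5, 13, 17, 25, 29, 37, 41} : Finset (ZMod 48))).filter fun w => c * w ∈ residueSet 48 Φ).card = ((({1, 5, 13, 17, 25, 29, 37, 41} : Finset (ZMod 48))).filter fun w => c * w ∉ residueSet 48 Φ).card) ∨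
      (∀ c ∈ unitResidues 48, ((({1, 7, 13, 19, 25, 31, 37, 43} : Finset (ZMod 48))).filter fun w => c * w ∈ residueSet 48 Φ).card = ((({1, 7, 13, 19, 25, 31, 37, 43} : Finset (ZMod 48))).filter fun w => c * w ∉ residueSet 48 Φ).card) ∨
      (∀ c ∈ unitResidues 48, ((({1, 11, 17, 19, 25, 35, 41, 43} : Finset (ZMod 48))).filter fun w => c * w ∈ residueSet 48 Φ).card = ((({1, 11, 17, 19, 25, 35, 41, 43} : Finset (ZMod 48))).filter fun w => c * w ∉ residueSet 48 Φ).card)) ∧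
      A.IsSimple ∧ A.dim = 8 ∧
      (hodgeClassSpan 8 A.X 4 ≠ divisorClassesSpan A.X 8 4 ∨ hodgeClassSpan 8 A.X 2 ≠ divisorClassesSpan A.X 8 2)) := by
  by_cases h : IsPrimitive (ℂ ≃+* ℂ) Φ.1 φ₀ ∧
      ((∀ c ∈ unitResidues 48, ((({1, 7, 17, 23} : Finset (ZMod 48))).filter fun w => c * w ∈ residueSet 48 Φ).card = ((({1, 7, 17, 23} : Finset (ZMod 48))).filter fun w => c * w ∉ residueSet 48 Φ).card) ∨
      (∀ c ∈ unitResidues 48, ((({1, 23, 31, 41} : Finset (ZMod 48))).filter fun w => c * w ∈ residueSet 48 Φ).card = ((({1, 23, 31, 41} : Finset (ZMod 48))).filter fun w => c * w ∉ residueSet 48 Φ).card) ∨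
      (∀ c ∈ unitResidues 48, ((({1, 5, 7, 11, 25, 29, 31, 35} : Finset (ZMod 48))).filter fun w => c * w ∈ residueSet 48 Φ).card = ((({1, 5, 7, 11, 25, 29, 31, 35} : Finset (ZMod 48))).filter fun w => c * w ∉ residueSet 48 Φ).card) ∨
      (∀ c ∈ unitResidues 48, ((({1, 5, 13, 17, 25, 29, 37, 41} : Finset (ZMod 48))).filter fun w => c * w ∈ residueSet 48 Φ).card = ((({1, 5, 13, 17, 25, 29, 37, 41} : Finset (ZMod 48))).filter fun w => c * w ∉ residueSet 48 Φ).card) ∨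
      (∀ c ∈ unitResidues 48, ((({1, 7, 13, 19, 25, 31, 37, 43} : Finset (ZMod 48))).filter fun w => c * w ∈ residueSet 48 Φ).card = ((({1, 7, 13, 19, 25, 31, 37, 43} : Finset (ZMod 48))).filter fun w => c * w ∉ residueSet 48 Φ).card) ∨
      (∀ c ∈ unitResidues 48, ((({1, 11, 17, 19, 25, 35, 41, 43} : Finset (ZMod 48))).filter fun w => c * w ∈ residueSet 48 Φ).card = ((({1, 11, 17, 19, 25, 35, 41, 43} : Finset (ZMod 48))).filter fun w => c * w ∉ residueSet 48 Φ).card))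
  · refine Or.inr ⟨h.1, h.2, isSimple_of_isCMTypeRealisation_of_isPrimitive hA φ₀ h.1, dim_eq_eight_of_isCMTypeRealisation_fortyEight hK hA, ?_⟩
    rcases hodgeClassSpan_ne_of_cosetBalanced_fortyEight hK Φ φ₀ h.1 h.2 hA with ⟨-, h4⟩ | ⟨-, h2⟩
    · exact Or.inl h4
    · exact Or.inr h2
  · have h' : IsPrimitive (ℂ ≃+* ℂ) Φ.1 φ₀ →
        ¬((∀ c ∈ unitResidues 48, ((({1, 7, 17, 23} : Finset (ZMod 48))).filter fun w => c * w ∈ residueSet 48 Φ).card = ((({1, 7, 17, 23} : Finset (ZMod 48))).filter fun w => c * w ∉ residueSet 48 Φ).card) ∨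
      (∀ c ∈ unitResidues 48, ((({1, 23, 31, 41} : Finset (ZMod 48))).filter fun w => c * w ∈ residueSet 48 Φ).card = ((({1, 23, 31, 41} : Finset (ZMod 48))).filter fun w => c * w ∉ residueSet 48 Φ).card) ∨
      (∀ c ∈ unitResidues 48, ((({1, 5, 7, 11, 25, 29, 31, 35} : Finset (ZMod 48))).filter fun w => c * w ∈ residueSet 48 Φ).card = ((({1, 5, 7, 11, 25, 29, 31, 35} : Finset (ZMod 48))).filter fun w => c * w ∉ residueSet 48 Φ).card) ∨
      (∀ c ∈ unitResidues 48, ((({1, 5, 13, 17, 25, 29, 37, 41} : Finset (ZMod 48))).filter fun w => c * w ∈ residueSet 48 Φ).card = ((({1, 5, 13, 17, 25, 29, 37, 41} : Finset (ZMod 48))).filter fun w => c * w ∉ residueSet 48 Φ).card) ∨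
      (∀ c ∈ unitResidues 48, ((({1, 7, 13, 19, 25, 31, 37, 43} : Finset (ZMod 48))).filter fun w => c * w ∈ residueSet 48 Φ).card = ((({1, 7, 13, 19, 25, 31, 37, 43} : Finset (ZMod 48))).filter fun w => c * w ∉ residueSet 48 Φ).card) ∨
      (∀ c ∈ unitResidues 48, ((({1, 11, 17, 19, 25, 35, 41, 43} : Finset (ZMod 48))).filter fun w => c * w ∈ residueSet 48 Φ).card = ((({1, 11, 17, 19, 25, 35, 41, 43} : Finset (ZMod 48))).filter fun w => c * w ∉ residueSet 48 Φ).card)) := fun hp hb ↦ h ⟨hp, hb⟩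
    exact Or.inl ⟨fun n m ↦ hodgeClassSpan_pow_eq_divisorClassesSpan_of_fortyEight hK Φ φ₀ h' hA n m,
      fun n ↦ hodgeConjectureFor_pow_of_fortyEight hK Φ φ₀ h' hA n⟩

variable (K) in
/-- **NON-VACUITY (Shimura §6.2 Thm. 3, tree `exists_isCMTypeRealisation`): there ARE simple abelian `8`-FOLDS with complex multiplication by
`𝓞_{ℚ(ζ₄₈)}` of primitive coset-balanced types — one with `B⁴ ≠ D⁴` (residue set `{1, 5, 7, 11, 13, 17, 25, 29}`), one with `B² ≠ D²`
(residue set `{1, 5, 7, 11, 13, 17, 25, 29}`) — and one of a nondegenerate type, all of whose powers satisfy the Hodge conjecture.**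
[cite: Shimura1998, §6.2 Thm. 3] [cite: Gordon1999HodgeAVSurvey, §9.4.2] -/
theorem exists_isSimple_exceptional_fortyEight [hK : IsCyclotomicExtension {48} ℚ K] :
    (∃ (Φ : CMType K) (A : AbelianVariety ℂ) (ι' : 𝓞 K →+* End A) (θ' : K →+* Module.End ℂ (complexBetti A.X 1)),
      IsCMTypeRealisation Φ A ι' θ' ∧ A.IsSimple ∧ A.dim = 8 ∧ hodgeClassSpan 8 A.X 4 ≠ divisorClassesSpan A.X 8 4) ∧
    (∃ (Φ : CMType K) (A : AbelianVariety ℂ) (ι' : 𝓞 K →+* End A) (θ' : K →+* Module.End ℂ (complexBetti A.X 1)),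
      IsCMTypeRealisation Φ A ι' θ' ∧ A.IsSimple ∧ A.dim = 8 ∧ hodgeClassSpan 8 A.X 2 ≠ divisorClassesSpan A.X 8 2) ∧
    (∃ (Φ : CMType K) (A : AbelianVariety ℂ) (ι' : 𝓞 K →+* End A) (θ' : K →+* Module.End ℂ (complexBetti A.X 1)),
      IsCMTypeRealisation Φ A ι' θ' ∧ A.IsSimple ∧ A.dim = 8 ∧
        ∀ n : ℕ, HodgeConjectureFor (⨁ fun _ : Fin n => A).dim (⨁ fun _ : Fin n => A).X) := by
  haveI := isCMField₈ K
  obtain ⟨φ₀⟩ : Nonempty (K →+* ℂ) := inferInstance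
  obtain ⟨hrN0, hrN1, hrN2, hrN3, hrN4, hrN5, hrN6, hrN7, hrD0, hrD1, hrD2, hrD3, hrI0, hrI1, hrI2, hrI3, hrI4, hrI5, hrI6, hrI7, hrI8, hrI9, hrI10, hrI11⟩ := isCMResidueSet_reps_fortyEight
  obtain ⟨hpN0, hpN1, hpN2, hpN3, hpN4, hpN5, hpN6, hpN7, hpD0, hpD1, hpD2, hpD3⟩ := hasTrivialStabilizer_reps_fortyEight
  obtain ⟨hb0, hb1, hb2, hb3, hb4, hb5, hb6, hb7, hb8, hb9, hb10, hb11⟩ := cosetBalanced_reps_fortyEight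
  have hp : ∀ {Φ : CMType K}, HasTrivialStabilizer 48 (residueSet 48 Φ) → IsPrimitive (ℂ ≃+* ℂ) Φ.1 φ₀ :=
    fun {Φ} h ↦ (isPrimitive_iff_hasTrivialStabilizer 48 Φ φ₀).2 h
  refine ⟨?_, ?_, ?_⟩
  · obtain ⟨Φ, hr⟩ := exists_residueSet_eq_fortyEight (L := K) hrD0
    obtain ⟨A, ι', θ', hA⟩ := Literature.AlgebraicGeometry.ComplexMultiplication.exists_isCMTypeRealisation Φ
    have hpr : IsPrimitive (ℂ ≃+* ℂ) Φ.1 φ₀ := hp (by rw [hr]; exact hpD0)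
    have hbal : (∀ c ∈ unitResidues 48, ((({1, 5, 7, 11, 25, 29, 31, 35} : Finset (ZMod 48))).filter fun w => c * w ∈ residueSet 48 Φ).card = ((({1, 5, 7, 11, 25, 29, 31, 35} : Finset (ZMod 48))).filter fun w => c * w ∉ residueSet 48 Φ).card) ∨
      (∀ c ∈ unitResidues 48, ((({1, 5, 13, 17, 25, 29, 37, 41} : Finset (ZMod 48))).filter fun w => c * w ∈ residueSet 48 Φ).card = ((({1, 5, 13, 17, 25, 29, 37, 41} : Finset (ZMod 48))).filter fun w => c * w ∉ residueSet 48 Φ).card) ∨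
      (∀ c ∈ unitResidues 48, ((({1, 7, 13, 19, 25, 31, 37, 43} : Finset (ZMod 48))).filter fun w => c * w ∈ residueSet 48 Φ).card = ((({1, 7, 13, 19, 25, 31, 37, 43} : Finset (ZMod 48))).filter fun w => c * w ∉ residueSet 48 Φ).card) ∨
      (∀ c ∈ unitResidues 48, ((({1, 11, 17, 19, 25, 35, 41, 43} : Finset (ZMod 48))).filter fun w => c * w ∈ residueSet 48 Φ).card = ((({1, 11, 17, 19, 25, 35, 41, 43} : Finset (ZMod 48))).filter fun w => c * w ∉ residueSet 48 Φ).card) :=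
      Or.inr (Or.inr (Or.inl (by rw [hr]; exact hb0)))
    obtain ⟨hS, hd, ⟨c, hcQ, hcH, hcD⟩, -⟩ := exists_exceptional_four_of_cosetBalanced_fortyEight hK Φ φ₀ hpr hbal hA
    exact ⟨Φ, A, ι', θ', hA, hS, hd, fun h ↦ hcD (h ▸ Submodule.subset_span ⟨hcQ, hcH⟩)⟩
  · obtain ⟨Φ, hr⟩ := exists_residueSet_eq_fortyEight (L := K) hrD0
    obtain ⟨A, ι', θ', hA⟩ := Literature.AlgebraicGeometry.ComplexMultiplication.exists_isCMTypeRealisation Φ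
    have hpr : IsPrimitive (ℂ ≃+* ℂ) Φ.1 φ₀ := hp (by rw [hr]; exact hpD0)
    have hbal : (∀ c ∈ unitResidues 48, ((({1, 7, 17, 23} : Finset (ZMod 48))).filter fun w => c * w ∈ residueSet 48 Φ).card = ((({1, 7, 17, 23} : Finset (ZMod 48))).filter fun w => c * w ∉ residueSet 48 Φ).card) ∨
      (∀ c ∈ unitResidues 48, ((({1, 23, 31, 41} : Finset (ZMod 48))).filter fun w => c * w ∈ residueSet 48 Φ).card = ((({1, 23, 31, 41} : Finset (ZMod 48))).filter fun w => c * w ∉ residueSet 48 Φ).card) ∨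
      (∀ c ∈ unitResidues 48, ((({1, 19, 25, 43} : Finset (ZMod 48))).filter fun w => c * w ∈ residueSet 48 Φ).card = ((({1, 19, 25, 43} : Finset (ZMod 48))).filter fun w => c * w ∉ residueSet 48 Φ).card) ∨
      (∀ c ∈ unitResidues 48, ((({1, 13, 25, 37} : Finset (ZMod 48))).filter fun w => c * w ∈ residueSet 48 Φ).card = ((({1, 13, 25, 37} : Finset (ZMod 48))).filter fun w => c * w ∉ residueSet 48 Φ).card) ∨
      (∀ c ∈ unitResidues 48, ((({1, 11, 25, 35} : Finset (ZMod 48))).filter fun w => c * w ∈ residueSet 48 Φ).card = ((({1, 11, 25, 35} : Finset (ZMod 48))).filter fun w => c * w ∉ residueSet 48 Φ).card) ∨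
      (∀ c ∈ unitResidues 48, ((({1, 5, 25, 29} : Finset (ZMod 48))).filter fun w => c * w ∈ residueSet 48 Φ).card = ((({1, 5, 25, 29} : Finset (ZMod 48))).filter fun w => c * w ∉ residueSet 48 Φ).card) :=
      Or.inr (Or.inr (Or.inl (by rw [hr]; exact hb2)))
    obtain ⟨hS, hd, ⟨c, hcQ, hcH, hcD⟩, -⟩ := exists_exceptional_two_of_cosetBalanced_fortyEight hK Φ φ₀ hpr hbal hA
    exact ⟨Φ, A, ι', θ', hA, hS, hd, fun h ↦ hcD (h ▸ Submodule.subset_span ⟨hcQ, hcH⟩)⟩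
  · obtain ⟨Φ, hr⟩ := exists_residueSet_eq_fortyEight (L := K) hrN0
    obtain ⟨A, ι', θ', hA⟩ := Literature.AlgebraicGeometry.ComplexMultiplication.exists_isCMTypeRealisation Φ
    have hpr : IsPrimitive (ℂ ≃+* ℂ) Φ.1 φ₀ := hp (by rw [hr]; exact hpN0)
    have hn : ¬((∀ c ∈ unitResidues 48, ((({1, 7, 17, 23} : Finset (ZMod 48))).filter fun w => c * w ∈ residueSet 48 Φ).card = ((({1, 7, 17, 23} : Finset (ZMod 48))).filter fun w => c * w ∉ residueSet 48 Φ).card) ∨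
      (∀ c ∈ unitResidues 48, ((({1, 23, 31, 41} : Finset (ZMod 48))).filter fun w => c * w ∈ residueSet 48 Φ).card = ((({1, 23, 31, 41} : Finset (ZMod 48))).filter fun w => c * w ∉ residueSet 48 Φ).card) ∨
      (∀ c ∈ unitResidues 48, ((({1, 5, 7, 11, 25, 29, 31, 35} : Finset (ZMod 48))).filter fun w => c * w ∈ residueSet 48 Φ).card = ((({1, 5, 7, 11, 25, 29, 31, 35} : Finset (ZMod 48))).filter fun w => c * w ∉ residueSet 48 Φ).card) ∨
      (∀ c ∈ unitResidues 48, ((({1, 5, 13, 17, 25, 29, 37, 41} : Finset (ZMod 48))).filter fun w => c * w ∈ residueSet 48 Φ).card = ((({1, 5, 13, 17, 25, 29, 37, 41} : Finset (ZMod 48))).filter fun w => c * w ∉ residueSet 48 Φ).card) ∨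
      (∀ c ∈ unitResidues 48, ((({1, 7, 13, 19, 25, 31, 37, 43} : Finset (ZMod 48))).filter fun w => c * w ∈ residueSet 48 Φ).card = ((({1, 7, 13, 19, 25, 31, 37, 43} : Finset (ZMod 48))).filter fun w => c * w ∉ residueSet 48 Φ).card) ∨
      (∀ c ∈ unitResidues 48, ((({1, 11, 17, 19, 25, 35, 41, 43} : Finset (ZMod 48))).filter fun w => c * w ∈ residueSet 48 Φ).card = ((({1, 11, 17, 19, 25, 35, 41, 43} : Finset (ZMod 48))).filter fun w => c * w ∉ residueSet 48 Φ).card)) := by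
      rw [hr]; exact not_cosetBalanced_reps_fortyEight.1
    exact ⟨Φ, A, ι', θ', hA, isSimple_of_isCMTypeRealisation_of_isPrimitive hA φ₀ hpr, dim_eq_eight_of_isCMTypeRealisation_fortyEight hK hA,
      fun n ↦ hodgeConjectureFor_pow_of_fortyEight hK Φ φ₀ (fun _ ↦ hn) hA n⟩

end Varieties

/-! ### §3 Complex tori with an endomorphism of characteristic polynomial `Φ₄₈` -/

section Tori

variable {ι : Type} [Fintype ι] [DecidableEq ι] {E : Type} [NormedAddCommGroup E] [NormedSpace ℂ E]
  {P : (ι → ℝ) ≃L[ℝ] E}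

set_option backward.isDefEq.respectTransparency false in -- Mathlib's instance
-- `IsCyclotomicExtension {48} ℚ (CyclotomicField 48 ℚ)` is keyed on `CyclotomicField.algebra`, the goal on `DivisionRing.toRatAlgebra`
/-- **`rank MT(X) ∈ {9, 7, 5, 3, 2}` FOR A COMPLEX TORUS WITH AN ENDOMORPHISM OF CHARACTERISTIC POLYNOMIAL `Φ₄₈`, and `X` is simple
iff `rank MT(X) ≥ 7`**: `X ≅ ℂ⁸/Φ(𝔞)` (structure theorem), `rank MT(X) = Rank(Φ)` (§1). [cite: Shimura1998, §6.2 Thm. 3] [cite: Gordon1999HodgeAVSurvey, §9.4] -/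
theorem mtRank_hodgeStructure_mem_and_isSimple_iff_fortyEight [HodgeTensorFacts.{0, 0}] {A : Matrix ι ι ℤ} (hA : A ∈ endRingInt P)
    (hP : A.charpoly = cyclotomic 48 ℤ) :
    ((hodgeStructure P 1).mtRank = 9 ∨ (hodgeStructure P 1).mtRank = 7 ∨ (hodgeStructure P 1).mtRank = 5 ∨ (hodgeStructure P 1).mtRank = 3 ∨ (hodgeStructure P 1).mtRank = 2) ∧
      (ComplexTorus.IsSimple P ↔ 7 ≤ (hodgeStructure P 1).mtRank) := by
  have hζ := IsCyclotomicExtension.zeta_spec 48 ℚ (CyclotomicField 48 ℚ)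
  obtain ⟨Φ, I, e, he, he₂, -⟩ := exists_cmType_ideal_iso_of_charpoly_eq_cyclotomic hζ hA hP
  haveI : IsCMField (CyclotomicField 48 ℚ) := isCMField₈ (CyclotomicField 48 ℚ)
  obtain ⟨φ₀⟩ : Nonempty (CyclotomicField 48 ℚ →+* ℂ) := inferInstance
  have hXiso : IsIsomorphic P (periodIso Φ I) := ⟨e, he, he₂⟩
  rw [IsIsomorphic.mtRank_hodgeStructure_eq P (periodIso Φ I) (k := 1) hXiso, mtRank_hodgeStructure_periodIso_eq_cmTypeRank Φ I,
    hXiso.isSimple_iff, isSimple_periodIso_iff_isPrimitive Φ I φ₀]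
  exact ⟨cmTypeRank_mem_fortyEight inferInstance Φ, isPrimitive_iff_seven_le_cmTypeRank_fortyEight inferInstance Φ φ₀⟩

set_option backward.isDefEq.respectTransparency false in -- see above
/-- **FOR `X` WITH `P_u = Φ₄₈`: `Hdg(Xᵏ) = Div(Xᵏ)` FOR ALL `k` ⟺ (`X` simple → `rank MT(X) = 9`)** — simple: Hazama–Murty's criterion `rank = dim + 1`;
non-simple: `X ≅ ℂ⁸/Φ(𝔞)` with `Φ` imprimitive, induced from a NONDEGENERATE type (§0–§1), so `Hdg = Div` on all powers.
[cite: Gordon1999HodgeAVSurvey, 7.5 and §9.3] [cite: MoonenZarhin1999LowDim, §2 Thm. (2.7)] [cite: Shimura1998, §6.2 Thm. 3] -/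
theorem forall_divisorClasses_powPeriod_eq_hodgeClasses_iff_fortyEight [HodgeTensorFacts.{0, 0}] {A : Matrix ι ι ℤ} (hA : A ∈ endRingInt P)
    (hP : A.charpoly = cyclotomic 48 ℤ) :
    (∀ k p : ℕ, divisorClasses (powPeriod P k) p = hodgeClasses (powPeriod P k) p) ↔
      (ComplexTorus.IsSimple P → (hodgeStructure P 1).mtRank = 9) := by
  have hζ := IsCyclotomicExtension.zeta_spec 48 ℚ (CyclotomicField 48 ℚ)
  obtain ⟨Φ, I, e, he, he₂, -⟩ := exists_cmType_ideal_iso_of_charpoly_eq_cyclotomic hζ hA hP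
  haveI : IsCMField (CyclotomicField 48 ℚ) := isCMField₈ (CyclotomicField 48 ℚ)
  obtain ⟨φ₀⟩ : Nonempty (CyclotomicField 48 ℚ →+* ℂ) := inferInstance
  have hXiso : IsIsomorphic P (periodIso Φ I) := ⟨e, he, he₂⟩
  have hcard : Fintype.card (basisIndex I) = 16 := by rw [card_basisIndex_eq_finrank, finrank_eq_sixteen₈ (CyclotomicField 48 ℚ)]
  haveI : Nonempty (basisIndex I) := Fintype.card_pos_iff.1 (by omega)
  have hY := isAbelianVariety_periodIso Φ I
  rw [hXiso.isIsogenous.forall_powPeriod_divisorClasses_eq_hodgeClasses_iff, hXiso.isSimple_iff,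
    IsIsomorphic.mtRank_hodgeStructure_eq P (periodIso Φ I) (k := 1) hXiso]
  by_cases hS : ComplexTorus.IsSimple (periodIso Φ I)
  · rw [hY.forall_powPeriod_divisorClasses_eq_hodgeClasses_iff_mtRank_eq_card_of_isSimple_of_isTorusSubgroup_mumfordTateGroupC hS
        (isTorusSubgroup_mumfordTateGroupC_periodIso Φ I), hcard]
    simp only [hS, forall_true_left]
  · simp only [hS, false_implies, iff_true]
    have hnp : ¬IsPrimitive (ℂ ≃+* ℂ) Φ.1 φ₀ := fun h ↦ hS ((isSimple_periodIso_iff_isPrimitive Φ I φ₀).2 h)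
    rcases cmTypeRank_of_not_isPrimitive_fortyEight Φ φ₀ hnp with ⟨hs, hr⟩ | ⟨hs, hr⟩ | ⟨hs, hr⟩
    · exact divisorClasses_powPeriod_periodIso_eq_hodgeClasses_of_card_stabilizer_mul_eq (N := 48) (by norm_num) Φ (k := 4)
        (by rw [hs]; decide +kernel) hr I
    · exact divisorClasses_powPeriod_periodIso_eq_hodgeClasses_of_card_stabilizer_mul_eq (N := 48) (by norm_num) Φ (k := 2)
        (by rw [hs]; decide +kernel) hr I
    · exact divisorClasses_powPeriod_periodIso_eq_hodgeClasses_of_card_stabilizer_mul_eq (N := 48) (by norm_num) Φ (k := 1)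
        (by rw [hs]; decide +kernel) hr I

/-- **`Hdg(Xᵏ) = Div(Xᵏ)` for all `k` when `X` is not simple or `rank MT(X) = 9`.** [cite: Gordon1999HodgeAVSurvey, 7.5] [cite: MoonenZarhin1999LowDim, §2 (2.7)] -/
theorem divisorClasses_powPeriod_eq_hodgeClasses_of_fortyEight [HodgeTensorFacts.{0, 0}] {A : Matrix ι ι ℤ} (hA : A ∈ endRingInt P)
    (hP : A.charpoly = cyclotomic 48 ℤ) (h : ComplexTorus.IsSimple P → (hodgeStructure P 1).mtRank = 9) (k p : ℕ) :
    divisorClasses (powPeriod P k) p = hodgeClasses (powPeriod P k) p :=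
  (forall_divisorClasses_powPeriod_eq_hodgeClasses_iff_fortyEight hA hP).2 h k p

set_option backward.isDefEq.respectTransparency false in -- see above
/-- **EACH PRIMITIVE RANK OCCURS AMONG SIMPLE ABELIAN `8`-FOLDS WITH `u = ζ₄₈`**: for a type `Φ` whose residue set is a representative of rank
`9, 7` and any ideal `𝔞`, the torus `ℂ⁸/Φ(𝔞)` is a simple abelian variety with the endomorphism `ζ₄₈` and `rank MT = Rank(Φ)`; only for rank
`9` is `Hdg = Div` on all powers. [cite: Shimura1998, §6.2 Thm. 3] [cite: Gordon1999HodgeAVSurvey, 7.5 and §9.4.2] -/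
theorem exists_isSimple_mtRank_eq_fortyEight [HodgeTensorFacts.{0, 0}] :
    (∃ Φ : CMType (CyclotomicField 48 ℚ), ∀ I : (FractionalIdeal (𝓞 (CyclotomicField 48 ℚ))⁰ (CyclotomicField 48 ℚ))ˣ,
      ComplexTorus.IsSimple (periodIso Φ I) ∧ IsAbelianVariety (periodIso Φ I) ∧
      (∃ A ∈ endRingInt (periodIso Φ I), A.charpoly = cyclotomic 48 ℤ) ∧
      (hodgeStructure (periodIso Φ I) 1).mtRank = 9) ∧
    (∃ Φ : CMType (CyclotomicField 48 ℚ), ∀ I : (FractionalIdeal (𝓞 (CyclotomicField 48 ℚ))⁰ (CyclotomicField 48 ℚ))ˣ,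
      ComplexTorus.IsSimple (periodIso Φ I) ∧ IsAbelianVariety (periodIso Φ I) ∧
      (∃ A ∈ endRingInt (periodIso Φ I), A.charpoly = cyclotomic 48 ℤ) ∧
      (hodgeStructure (periodIso Φ I) 1).mtRank = 7) := by
  have hζ := IsCyclotomicExtension.zeta_spec 48 ℚ (CyclotomicField 48 ℚ)
  haveI : IsCMField (CyclotomicField 48 ℚ) := isCMField₈ (CyclotomicField 48 ℚ)
  obtain ⟨φ₀⟩ : Nonempty (CyclotomicField 48 ℚ →+* ℂ) := inferInstance
  obtain ⟨hrN0, hrN1, hrN2, hrN3, hrN4, hrN5, hrN6, hrN7, hrD0, hrD1, hrD2, hrD3, hrI0, hrI1, hrI2, hrI3, hrI4, hrI5, hrI6, hrI7, hrI8, hrI9, hrI10, hrI11⟩ := isCMResidueSet_reps_fortyEight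
  obtain ⟨hpN0, hpN1, hpN2, hpN3, hpN4, hpN5, hpN6, hpN7, hpD0, hpD1, hpD2, hpD3⟩ := hasTrivialStabilizer_reps_fortyEight
  have hend : ∀ (Φ : CMType (CyclotomicField 48 ℚ)) (I : (FractionalIdeal (𝓞 (CyclotomicField 48 ℚ))⁰ (CyclotomicField 48 ℚ))ˣ),
      ∃ A ∈ endRingInt (periodIso Φ I), A.charpoly = cyclotomic 48 ℤ :=
    fun Φ I ↦ ⟨Literature.NumberTheory.ComplexMultiplication.CMTypeLattice.mulMatrix I hζ.toInteger,
      mulMatrix_toInteger_mem_endRingInt hζ Φ I, charpoly_mulMatrix_toInteger hζ I⟩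
  have hsimple : ∀ {Φ : CMType (CyclotomicField 48 ℚ)}, HasTrivialStabilizer 48 (residueSet 48 Φ) →
      ∀ I, ComplexTorus.IsSimple (periodIso Φ I) := fun {Φ} hΦ I ↦
    (isSimple_periodIso_iff_isPrimitive Φ I φ₀).2 ((isPrimitive_iff_hasTrivialStabilizer 48 Φ φ₀).2 hΦ)
  refine ⟨?_, ?_⟩
  · obtain ⟨Φ, hr⟩ := exists_residueSet_eq_fortyEight (L := CyclotomicField 48 ℚ) hrN0
    refine ⟨Φ, fun I ↦ ⟨hsimple (by rw [hr]; exact hpN0) I, isAbelianVariety_periodIso Φ I, hend Φ I, ?_⟩⟩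
    rw [mtRank_hodgeStructure_periodIso_eq_cmTypeRank Φ I]
    exact cmTypeRank_eq_nine_of_residueSet_mem_fortyEight Φ (by rw [hr]; simp)
  · obtain ⟨Φ, hr⟩ := exists_residueSet_eq_fortyEight (L := CyclotomicField 48 ℚ) hrD0
    refine ⟨Φ, fun I ↦ ⟨hsimple (by rw [hr]; exact hpD0) I, isAbelianVariety_periodIso Φ I, hend Φ I, ?_⟩⟩
    rw [mtRank_hodgeStructure_periodIso_eq_cmTypeRank Φ I]
    exact cmTypeRank_eq_of_residueSet_eq_D1_fortyEight Φ hr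

end Tori

end ComplexTorus

end Literature.Geometry.Kaehler

end
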